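import Mathlib.Analysis.Distribution.AEEqOfIntegralContDiff
import Mathlib.Analysis.Fourier.PoissonSummation
import Mathlib.Analysis.Fourier.Inversion
import Mathlib.MeasureTheory.Integral.IntegralEqImproper
import Mathlib.MeasureTheory.Measure.Lebesgue.Integral
import Mathlib.Analysis.SpecialFunctions.ImproperIntegrals
import Mathlib.Analysis.Real.Pi.Bounds
import Mathlib.NumberTheory.ZetaValues
import Literature.NumberTheory.LFunctions.BurnolFourierZeta
import Literature.Analysis.FunctionSpaces.PlancherelL1L2
import HarnessLib

/-!
# Burnol, *On Fourier and Zeta(s)* — proofs: the co-Poisson summation on `ℝ`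

RH-FREE. Proofs file for `Literature/NumberTheory/LFunctions/BurnolFourierZeta.lean` (Burnol,
Forum Math. 16 (2004) 789–840 = arXiv:math/0112254, §§3–4). WHAT THIS IS NOT: nothing here bears
on the truth of RH; these are theorems of classical harmonic analysis (Poisson summation).

## Contents

For a smooth even `α` with compact support away from the origin (`CoPoisson.IsTestAway α`) and
its inversion `β = I(α)`, `I(α)(y) = α(1/y)/|y|`:

* `CoPoisson.IsTestAway.isTestAway_inv` : `I(α)` is again such a test function;
* `CoPoisson.IsTestAway.coSum_eq_tsum_fourier` : the **key formula**
  `P'(α)(y) = Σ_{m ≥ 1} 𝓕(I α)(m y)` for `y ≠ 0` (Burnol's `E'_ℝ(g)(y) = Σ_{n ≠ 0} γ(ny)`,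
  proof of Thm 3.8, TeX l. 1107–1115), from Mathlib's Poisson summation formula
  `SchwartzMap.tsum_eq_tsum_fourier` applied to the Schwartz function `x ↦ β(x/y)`;
* decay `‖P'(α)(y)‖ ≤ K/y²`, continuity, boundedness, `P'(α) ∈ L¹ ∩ L²`, constancy near `0`;
* `Burnol2004_thm_3_8_holds : Burnol2004_thm_3_8` — **Theorem 3.8 discharged**;
* `CoPoisson.IsTestAway.integral_mul_coSum_eq` : the **weak intertwining identity**
  `∫ φ·P'(α) = ∫ 𝓕φ·P'(I(α))` for every even Schwartz function `φ` — Burnol's first proof of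
  the co-Poisson intertwining (TeX l. 1163–1200): Tonelli, Poisson summation for the dilates
  `x ↦ φ(xu)` (`SchwartzMap.compCLMOfContinuousLinearEquiv`), the substitution `u ↦ 1/u`, and
  `∫ 𝓕φ = φ(0)`;
* `Burnol2004_thm_4_4_holds : Burnol2004_thm_4_4` — **Theorem 4.4 (co-Poisson intertwining
  `𝓕(P'(α)) = P'(I(α))`) discharged**: from the weak identity by self-adjointness of `𝓕`
  (`Literature.Analysis.FunctionSpaces.integral_fourier_schwartz_smul_eq`), symmetrisation of real
  test functions, `ae_eq_of_integral_contDiff_smul_eq` and continuity of both sides;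
* `Burnol2004_thm_4_2_holds : Burnol2004_thm_4_2` — **Theorem 4.2 (the intertwining as tempered
  distributions, for even measurable `g` with `∫₀^∞|g|dt/t + ∫₀^∞|g|dt < ∞`) discharged**: the
  weak identity re-proved for this class ("everything is absolutely convergent", TeX l. 1283) with
  the dilation-sum bound `Σ_{n≥1}|ψ(nu)| ≤ (M+C)/|u| + M` for a bounded `ψ` with quadratic decay,
  stability of the class under `I`, and reduction of a general Schwartz `φ` to its even part;
* `Burnol2004_lemma_4_1_holds : Burnol2004_lemma_4_1` — **Lemma 4.1 discharged**: for even
  measurable `g` with `∫₀^∞|g(u)|du/u < ∞`, a.e. absolute convergence of `Σ_n g(t/n)/n`, local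
  integrability of the sum and `∫₀^u Σ_n g(t/n)/n dt = O(u)`, from the printed count
  `∫_{(-T,T)} Σ_n |g(t/n)|/n dt ≤ T·∫|g(u)|du/|u|` done with lower Lebesgue integrals;
* `Burnol2004_thm_4_5_holds : Burnol2004_thm_4_5` — **Theorem 4.5 (= 4.6) discharged**: for
  `C²` even `g` with compact support away from the origin, `P'(g)` and its dual sum are continuous
  `L¹` functions and `𝓕(P'(g))` equals the dual sum pointwise — the structure lemmas redone for
  `C²` data (quadratic decay of `𝓕(Ig)` from `𝓕(f'') = (2πit)²𝓕f`, Poisson summation under power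
  decay `Real.tsum_eq_tsum_fourier_of_rpow_decay`), then Theorem 4.2 made pointwise by Fubini
  against Schwartz functions and continuity of both sides;
* `Burnol2004_thm_3_9_holds : Burnol2004_thm_3_9` — **Theorem 3.9 discharged**: `P'(α)` is an
  even Schwartz function (`CoPoisson.IsTestAway.exists_schwartzMap_coe_eq`), constant near `0`,
  with `𝓕(P'(α)) = −∫₀^∞α` near `0` and `𝓕(P'(α)) = P'(Iα)`; the Schwartz property from the
  local finiteness of the sum (smoothness) and termwise differentiation of `Σ_m γ(my)`,
  `γ = 𝓕(Iα)`, on the half-lines `|y| > 1/2` (`hasDerivAt_tsum_of_isPreconnected`) with the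
  bounds `|y|^p |m^k γ^{(k)}(my)| ≤ C_{k,p}/m²` from the Schwartz decay of `γ^{(k)}`.
  With this, every named fact of `BurnolFourierZeta.lean` (Part 1, §§3–5) is a theorem.

## References

* J.-F. Burnol, *On Fourier and Zeta(s)*, Forum Math. 16 (2004), 789–840, Thm 3.8 and its proof,
  Thm 3.9, §4 (TeX l. 1163–1200), Lemma 4.1, Thms 4.2, 4.4, 4.5. [cite: Burnol2004, Thm 3.8 (TeX l. 1040–1115), Thm 3.9 (TeX l. 1137–1160), Lemma 4.1 (TeX l. 1207–1232), Thm 4.2 (TeX l. 1235–1285), Thm 4.4 (TeX l. 1287), Thm 4.5 (TeX l. 1415–1502)]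
-/

noncomputable section

open Complex MeasureTheory Set Filter SchwartzMap FourierTransform
open scoped Real Topology ContDiff

namespace Literature.NumberTheory.LFunctions

namespace CoPoisson


variable {α : ℝ → ℂ}

/-! ## A. Elementary properties of test functions away from the origin -/

namespace IsTestAway

/-- Auxiliary step (elementary). [folklore] -/
private theorem continuous (h : IsTestAway α) : Continuous α := h.contDiff.continuous

/-- `α` vanishes on a neighbourhood `(-δ, δ)` of `0`. [folklore] -/
private theorem exists_ball (h : IsTestAway α) : ∃ δ : ℝ, 0 < δ ∧ ∀ y : ℝ, |y| < δ → α y = 0 := by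
  have hopen : IsOpen (tsupport α)ᶜ := (isClosed_tsupport α).isOpen_compl
  obtain ⟨δ, hδ, hball⟩ := Metric.isOpen_iff.1 hopen 0 h.zero_notMem_tsupport
  refine ⟨δ, hδ, fun y hy ↦ ?_⟩
  have hy' : y ∈ (tsupport α)ᶜ := hball (by simpa [Real.dist_eq] using hy)
  exact image_eq_zero_of_notMem_tsupport hy'

/-- `α` vanishes outside a bounded set `[-R, R]`. [folklore] -/
private theorem exists_bound (h : IsTestAway α) : ∃ R : ℝ, 0 < R ∧ ∀ y : ℝ, R < |y| → α y = 0 := by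
  obtain ⟨R, hR⟩ := (h.hasCompactSupport.isCompact.isBounded).subset_closedBall 0 |>.imp
    (fun R h ↦ h) |> fun ⟨R, h⟩ ↦ (⟨R, h⟩ : ∃ R, tsupport α ⊆ Metric.closedBall 0 R)
  refine ⟨max R 1, by positivity, fun y hy ↦ ?_⟩
  apply image_eq_zero_of_notMem_tsupport
  intro hmem
  have := hR hmem
  rw [Metric.mem_closedBall, dist_zero_right, Real.norm_eq_abs] at this
  linarith [le_max_left R 1]

/-- Auxiliary step (elementary). [folklore] -/
private theorem apply_zero (h : IsTestAway α) : α 0 = 0 := by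
  obtain ⟨δ, hδ, hz⟩ := h.exists_ball
  exact hz 0 (by simpa using hδ)

/-- Auxiliary step (elementary). [folklore] -/
private theorem exists_norm_le (h : IsTestAway α) : ∃ C : ℝ, 0 ≤ C ∧ ∀ y, ‖α y‖ ≤ C := by
  obtain ⟨C, hC⟩ := (h.continuous.norm).bddAbove_range_of_hasCompactSupport h.hasCompactSupport.norm
  exact ⟨max C 0, le_max_right _ _, fun y ↦ (hC ⟨y, rfl⟩).trans (le_max_left _ _)⟩

/-- Auxiliary step (elementary). [folklore] -/
private theorem integrable (h : IsTestAway α) : Integrable α :=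
  h.continuous.integrable_of_hasCompactSupport h.hasCompactSupport

/-- `u ↦ α(u)/u` is integrable (the integrand vanishes near `0`). [folklore] -/
private theorem measurable_div (h : IsTestAway α) : Measurable fun u : ℝ ↦ α u / (u : ℂ) :=
  h.continuous.measurable.mul (Complex.measurable_ofReal.inv)


/-- Auxiliary step (elementary). [folklore] -/
private theorem integrable_div (h : IsTestAway α) : Integrable fun u : ℝ ↦ α u / (u : ℂ) := by
  obtain ⟨δ, hδ, hz⟩ := h.exists_ball
  refine (h.integrable.norm.mul_const δ⁻¹).mono' h.measurable_div.aestronglyMeasurable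
    (Eventually.of_forall fun u ↦ ?_)
  by_cases hu : |u| < δ
  · simp [hz u hu]
  · rw [not_lt] at hu
    rw [norm_div, Complex.norm_real, Real.norm_eq_abs, div_eq_mul_inv]
    gcongr

end IsTestAway

/-! ## B. The inversion `I` preserves the test class -/

/-- `I(α)(y) = |y|⁻¹ · α(y⁻¹)`. [folklore] -/
private theorem inv_eq_smul (α : ℝ → ℂ) : inv α = fun y : ℝ ↦ ((|y|⁻¹ : ℝ) : ℂ) * α y⁻¹ := by
  funext y
  rw [inv, div_eq_inv_mul, Complex.ofReal_inv]

/-- The inversion `I` preserves the class of smooth even test functions with compact support away from the origin (Thm 3.9: the replacement `α(y) ↦ α(1/y)/|y|` stays in the class). [cite: Burnol2004, Thm 3.9 (TeX l. 1150–1153)] -/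
theorem IsTestAway.isTestAway_inv (h : IsTestAway α) : IsTestAway (inv α) := by
  obtain ⟨δ, hδ, hz⟩ := h.exists_ball
  obtain ⟨R, hR, hR'⟩ := h.exists_bound
  -- vanishing of `inv α` near `0` and far out
  have hnear : ∀ y : ℝ, |y| < R⁻¹ → inv α y = 0 := by
    intro y hy
    rcases eq_or_ne y 0 with rfl | hy0
    · simp [CoPoisson.inv, h.apply_zero]
    · have : R < |y⁻¹| := by
        rw [abs_inv]; rwa [lt_inv_comm₀ hR (abs_pos.2 hy0)]
      simp [CoPoisson.inv, hR' _ this]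
  have hfar : ∀ y : ℝ, δ⁻¹ < |y| → inv α y = 0 := by
    intro y hy
    have hy0 : y ≠ 0 := by
      rintro rfl; rw [abs_zero] at hy; linarith [inv_pos.2 hδ]
    have : |y⁻¹| < δ := by
      rw [abs_inv]; rwa [inv_lt_comm₀ (abs_pos.2 hy0) hδ]
    simp [CoPoisson.inv, hz _ this]
  refine ⟨?_, ?_, ?_, ?_⟩
  · -- smoothness
    rw [contDiff_iff_contDiffAt]
    intro y
    rcases eq_or_ne y 0 with rfl | hy0
    · -- locally zero
      have hev : (inv α) =ᶠ[𝓝 (0:ℝ)] fun _ ↦ (0 : ℂ) := by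
        have : Metric.ball (0:ℝ) R⁻¹ ∈ 𝓝 (0 : ℝ) := Metric.ball_mem_nhds _ (inv_pos.2 hR)
        filter_upwards [this] with y hy
        exact hnear y (by simpa using hy)
      exact (contDiffAt_const.congr_of_eventuallyEq hev)
    · rw [inv_eq_smul]
      have h1 : ContDiffAt ℝ ∞ (fun y : ℝ ↦ y⁻¹) y := contDiffAt_inv ℝ hy0
      have h2 : ContDiffAt ℝ ∞ (fun y : ℝ ↦ α y⁻¹) y := (h.contDiff.contDiffAt).comp y h1
      have h3 : ContDiffAt ℝ ∞ (fun y : ℝ ↦ |y|⁻¹) y := by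
        have : ContDiffAt ℝ ∞ (fun y : ℝ ↦ ‖y‖) y := contDiffAt_norm ℝ hy0
        simp only [Real.norm_eq_abs] at this
        exact this.inv (abs_pos.2 hy0).ne'
      have h4 : ContDiffAt ℝ ∞ (fun y : ℝ ↦ ((|y|⁻¹ : ℝ) : ℂ)) y :=
        (Complex.ofRealCLM.contDiff.contDiffAt).comp y h3
      exact h4.mul h2
  · intro y
    simp only [CoPoisson.inv, inv_neg, h.even, abs_neg]
  · -- compact support: support ⊆ closedBall 0 δ⁻¹
    apply HasCompactSupport.of_support_subset_isCompact (isCompact_closedBall (0:ℝ) δ⁻¹)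
    intro y hy
    rw [Metric.mem_closedBall, dist_zero_right, Real.norm_eq_abs]
    by_contra hlt
    exact hy (hfar y (not_le.1 hlt))
  · -- `0 ∉ tsupport`
    intro hmem
    have hball : Metric.ball (0:ℝ) R⁻¹ ∈ 𝓝 (0:ℝ) := Metric.ball_mem_nhds _ (inv_pos.2 hR)
    have : (inv α) =ᶠ[𝓝 (0:ℝ)] 0 := by
      filter_upwards [hball] with y hy
      exact hnear y (by simpa using hy)
    exact (notMem_tsupport_iff_eventuallyEq.2 this) hmem

/-- On `(0,∞)`, `I(α)(u) = α(1/u)/u`. [folklore] -/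
private theorem inv_apply_of_pos (α : ℝ → ℂ) {u : ℝ} (hu : 0 < u) : inv α u = α u⁻¹ / (u : ℂ) := by
  rw [CoPoisson.inv, abs_of_pos hu]



/-! ## C. Finite-sum structure of the co-Poisson sum -/

namespace IsTestAway

/-- Terms of the co-Poisson sum vanish beyond `n ≈ |y|/δ`. [folklore] -/
private theorem exists_terms_eq_zero (h : IsTestAway α) :
    ∃ δ : ℝ, 0 < δ ∧ (∀ y : ℝ, |y| < δ → α y = 0) ∧
      ∀ (y : ℝ) (n : ℕ), |y| / δ ≤ n → α (y / ((n : ℝ) + 1)) = 0 := by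
  obtain ⟨δ, hδ, hz⟩ := h.exists_ball
  refine ⟨δ, hδ, hz, fun y n hn ↦ hz _ ?_⟩
  have hn1 : (0 : ℝ) < (n : ℝ) + 1 := by positivity
  rw [abs_div, abs_of_pos hn1, div_lt_iff₀ hn1]
  rw [div_le_iff₀ hδ] at hn
  nlinarith

end IsTestAway


/-- For `|y|/δ ≤ N` the co-Poisson sum is a finite sum over `n < N`. [folklore] -/
private theorem IsTestAway.tsum_term_eq_sum (h : IsTestAway α) :
    ∃ δ : ℝ, 0 < δ ∧ (∀ y : ℝ, |y| < δ → α y = 0) ∧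
      ∀ (y : ℝ) (N : ℕ), |y| / δ ≤ N →
        (∑' n : ℕ, α (y / ((n : ℝ) + 1)) / ((n : ℂ) + 1)) =
          ∑ n ∈ Finset.range N, α (y / ((n : ℝ) + 1)) / ((n : ℂ) + 1) := by
  obtain ⟨δ, hδ, hz, hN⟩ := h.exists_terms_eq_zero
  refine ⟨δ, hδ, hz, fun y N hyN ↦ tsum_eq_sum fun n hn ↦ ?_⟩
  rw [Finset.mem_range, not_lt] at hn
  have : |y| / δ ≤ n := hyN.trans (by exact_mod_cast hn)
  simp [hN y n this]

/-- Auxiliary step (elementary). [folklore] -/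
private theorem IsTestAway.summable_term (h : IsTestAway α) (y : ℝ) : Summable fun n : ℕ ↦ α (y / ((n : ℝ) + 1)) / ((n : ℂ) + 1) := by
  obtain ⟨δ, hδ, -, hN⟩ := h.exists_terms_eq_zero
  refine summable_of_ne_finset_zero (s := Finset.range (⌈|y| / δ⌉₊)) fun n hn ↦ ?_
  rw [Finset.mem_range, not_lt] at hn
  have : |y| / δ ≤ n := (Nat.le_ceil _).trans (by exact_mod_cast hn)
  simp [hN y n this]

/-- Near the origin `P'(α)` is the constant `-∫_0^∞ α(u) du/u` (Thm 3.8: "equal to the constant … in a neighborhood of the origin"). [cite: Burnol2004, Thm 3.8 (TeX l. 1043)] -/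
theorem IsTestAway.coSum_eventually_eq (h : IsTestAway α) :
    ∀ᶠ y in 𝓝 (0 : ℝ), coSum α y = -∫ u in Ioi (0 : ℝ), α u / (u : ℂ) := by
  obtain ⟨δ, hδ, hz, -⟩ := h.tsum_term_eq_sum
  have hball : Metric.ball (0 : ℝ) δ ∈ 𝓝 (0 : ℝ) := Metric.ball_mem_nhds _ hδ
  filter_upwards [hball] with y hy
  rw [Metric.mem_ball, dist_zero_right, Real.norm_eq_abs] at hy
  have hterm : ∀ n : ℕ, α (y / ((n : ℝ) + 1)) / ((n : ℂ) + 1) = 0 := by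
    intro n
    have hn1 : (0 : ℝ) < (n : ℝ) + 1 := by positivity
    have : |y / ((n : ℝ) + 1)| < δ := by
      rw [abs_div, abs_of_pos hn1, div_lt_iff₀ hn1]
      nlinarith [abs_nonneg y]
    simp [hz _ this]
  rw [coSum, tsum_congr hterm, tsum_zero, zero_sub]

/-- `P'(α)` is even for even `α` (Thm 3.9: "an even function on `ℝ`"). [cite: Burnol2004, Thm 3.9 (TeX l. 1140)] -/
theorem coSum_neg (hα : ∀ y, α (-y) = α y) (y : ℝ) : coSum α (-y) = coSum α y := by
  simp only [coSum, neg_div, hα]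

/-- The dual side `Σ α(n/t)/|t| − ∫α` is even for even `α`. [cite: Burnol2004, Thm 3.9 (TeX l. 1140)] -/
theorem coSumDual_neg (hα : ∀ y, α (-y) = α y) (t : ℝ) : coSumDual α (-t) = coSumDual α t := by
  simp only [coSumDual, div_neg, hα, abs_neg]


/-! ## D. Fourier lemmas: dilation, evenness, value at `0`, Schwartz decay -/

/-- Dilation: `𝓕[g(·/y)](ξ) = |y| · 𝓕g(y ξ)` for `y ≠ 0`. [folklore] -/
private theorem fourier_comp_div_eq (g : ℝ → ℂ) {y : ℝ} (hy : y ≠ 0) (ξ : ℝ) :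
    𝓕 (fun x : ℝ ↦ g (x / y)) ξ = ((|y| : ℝ) : ℂ) * 𝓕 g (y * ξ) := by
  rw [Real.fourier_real_eq, Real.fourier_real_eq]
  have e : (fun v : ℝ ↦ 𝐞 (-(v * ξ)) • g (v / y)) =
      fun v : ℝ ↦ (fun u : ℝ ↦ 𝐞 (-(u * (y * ξ))) • g u) (v / y) := by
    funext v
    simp only
    congr 3
    field_simp
  rw [e, Measure.integral_comp_div (fun u : ℝ ↦ 𝐞 (-(u * (y * ξ))) • g u) y,
    Complex.real_smul]

/-- The Fourier transform of an even function is even. [folklore] -/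
private theorem fourier_neg_of_even {g : ℝ → ℂ} (hg : ∀ x, g (-x) = g x) (w : ℝ) :
    𝓕 g (-w) = 𝓕 g w := by
  rw [← Real.fourierInv_eq_fourier_neg, Real.fourierInv_eq_fourier_comp_neg]
  simp only [hg]

/-- `𝓕 g(0) = ∫ g`. [folklore] -/
private theorem fourier_apply_zero (g : ℝ → ℂ) : 𝓕 g 0 = ∫ v : ℝ, g v := by
  rw [Real.fourier_real_eq]
  simp

/-- An even integrable function has `∫_ℝ g = 2 ∫_0^∞ g`. [folklore] -/
private theorem integral_eq_two_mul_Ioi {g : ℝ → ℂ} (hg : Integrable g) (he : ∀ x, g (-x) = g x) :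
    ∫ v : ℝ, g v = 2 * ∫ v in Ioi (0 : ℝ), g v := by
  rw [← intervalIntegral.integral_Iic_add_Ioi (b := 0) hg.integrableOn hg.integrableOn]
  have : ∫ v in Iic (0 : ℝ), g v = ∫ v in Ioi (0 : ℝ), g v := by
    calc ∫ v in Iic (0 : ℝ), g v = ∫ v in Iic (0 : ℝ), g (-v) := by simp only [he]
      _ = ∫ v in Ioi (-0 : ℝ), g v := integral_comp_neg_Iic 0 g
      _ = ∫ v in Ioi (0 : ℝ), g v := by rw [neg_zero]
  rw [this, two_mul]

/-- Schwartz decay of the Fourier transform of a test function: `t² |𝓕β(t)| ≤ C`. [folklore] -/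
private theorem IsTestAway.exists_sq_mul_norm_fourier_le {β : ℝ → ℂ} (hβ : IsTestAway β) :
    ∃ C : ℝ, 0 < C ∧ ∀ t : ℝ, t ^ 2 * ‖𝓕 β t‖ ≤ C := by
  set ψ : 𝓢(ℝ, ℂ) := hβ.hasCompactSupport.toSchwartzMap hβ.contDiff with hψ
  obtain ⟨C, hC0, hC⟩ := (𝓕 ψ).decay 2 0
  refine ⟨C, hC0, fun t ↦ ?_⟩
  have h := hC t
  rw [norm_iteratedFDeriv_zero, Real.norm_eq_abs, sq_abs] at h
  have hcoe : (𝓕 ψ) t = 𝓕 β t := congrFun (SchwartzMap.fourier_coe ψ) t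
  rwa [hcoe] at h

/-- Auxiliary step (elementary). [folklore] -/
private theorem IsTestAway.norm_fourier_le {β : ℝ → ℂ} (hβ : IsTestAway β) :
    ∃ C : ℝ, 0 < C ∧ ∀ t : ℝ, t ≠ 0 → ‖𝓕 β t‖ ≤ C / t ^ 2 := by
  obtain ⟨C, hC0, hC⟩ := hβ.exists_sq_mul_norm_fourier_le
  refine ⟨C, hC0, fun t ht ↦ ?_⟩
  rw [le_div_iff₀ (by positivity), mul_comm]
  exact hC t

/-- `∫_0^∞ I(α)(u) du... `: the substitution `u ↦ 1/u`: `∫_0^∞ α(1/u) du/u = ∫_0^∞ α(v) dv/v`. [folklore] -/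
private theorem integral_Ioi_comp_inv_div (α : ℝ → ℂ) :
    ∫ u in Ioi (0 : ℝ), α u⁻¹ / (u : ℂ) = ∫ v in Ioi (0 : ℝ), α v / (v : ℂ) := by
  have h := integral_comp_rpow_Ioi (fun v : ℝ ↦ α v / (v : ℂ)) (p := -1) (by norm_num)
  rw [← h]
  refine setIntegral_congr_fun measurableSet_Ioi fun x hx ↦ ?_
  have hx0 : (0 : ℝ) < x := hx
  simp only [Real.rpow_neg_one]
  have hx2 : x ^ ((-1 : ℝ) - 1) = (x ^ 2)⁻¹ := by
    rw [show ((-1 : ℝ) - 1) = -2 by norm_num, Real.rpow_neg hx0.le, Real.rpow_two]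
  rw [hx2, abs_neg, abs_one, one_mul, Complex.real_smul]
  have hxC : (x : ℂ) ≠ 0 := by exact_mod_cast hx0.ne'
  push_cast
  field_simp

/-- `∫_0^∞ I(α) = ∫_0^∞ α(u) du/u`. [folklore] -/
private theorem integral_Ioi_inv (α : ℝ → ℂ) :
    ∫ u in Ioi (0 : ℝ), inv α u = ∫ v in Ioi (0 : ℝ), α v / (v : ℂ) := by
  rw [← integral_Ioi_comp_inv_div]
  exact setIntegral_congr_fun measurableSet_Ioi fun u hu ↦ inv_apply_of_pos α hu

/-- `∫_0^∞ I(α)(u) du/u = ∫_0^∞ α`. [folklore] -/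
private theorem integral_Ioi_inv_div (α : ℝ → ℂ) :
    ∫ u in Ioi (0 : ℝ), inv α u / (u : ℂ) = ∫ v in Ioi (0 : ℝ), α v := by
  have h := integral_comp_rpow_Ioi (fun v : ℝ ↦ α v) (p := -1) (by norm_num)
  rw [← h]
  refine setIntegral_congr_fun measurableSet_Ioi fun x hx ↦ ?_
  have hx0 : (0 : ℝ) < x := hx
  simp only [Real.rpow_neg_one, inv_apply_of_pos α hx0]
  have hx2 : x ^ ((-1 : ℝ) - 1) = (x ^ 2)⁻¹ := by
    rw [show ((-1 : ℝ) - 1) = -2 by norm_num, Real.rpow_neg hx0.le, Real.rpow_two]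
  rw [hx2, abs_neg, abs_one, one_mul, Complex.real_smul]
  have hxC : (x : ℂ) ≠ 0 := by exact_mod_cast hx0.ne'
  push_cast
  field_simp


/-- Splitting an even absolutely convergent `ℤ`-sum: `Σ_ℤ F = F 0 + 2 Σ_{n ≥ 1} F n`. [folklore] -/
private theorem tsum_int_of_even {F : ℤ → ℂ} (he : ∀ n : ℤ, F (-n) = F n)
    (hs : Summable fun n : ℕ ↦ F n) :
    ∑' n : ℤ, F n = F 0 + 2 * ∑' n : ℕ, F ((n : ℤ) + 1) := by
  have hs1 : Summable fun n : ℕ ↦ F ((n : ℤ) + 1) := by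
    have := (summable_nat_add_iff 1).2 hs
    simpa [Nat.cast_succ] using this
  have hs' : Summable fun n : ℕ ↦ F (-((n : ℤ) + 1)) := by
    simpa only [he] using hs1
  rw [tsum_of_nat_of_neg_add_one hs hs', hs.tsum_eq_zero_add]
  simp only [he]
  push_cast
  ring


/-! ## E. Poisson summation for the dilates and the formula `P'(α)(y) = Σ_{m≥1} 𝓕(Iα)(my)` -/

/-- The dilate `x ↦ β(x/y)` (`y ≠ 0`) has compact support. [folklore] -/
private theorem IsTestAway.hasCompactSupport_comp_div {β : ℝ → ℂ} (hβ : IsTestAway β) {y : ℝ}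
    (hy : y ≠ 0) : HasCompactSupport (fun x : ℝ ↦ β (x / y)) := by
  have h := hβ.hasCompactSupport.comp_homeomorph (Homeomorph.mulRight₀ y⁻¹ (inv_ne_zero hy))
  convert h using 1
  funext x
  simp [Homeomorph.coe_mulRight₀, div_eq_mul_inv]

/-- Auxiliary step (elementary). [folklore] -/
private theorem IsTestAway.contDiff_comp_div {β : ℝ → ℂ} (hβ : IsTestAway β) (y : ℝ) :
    ContDiff ℝ ∞ (fun x : ℝ ↦ β (x / y)) :=
  hβ.contDiff.comp (contDiff_id.div_const y)

/-- Poisson summation for the dilate `x ↦ β(x/y)` of a test function: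
`Σ_{n ∈ ℤ} β(n/y) = |y| Σ_{m ∈ ℤ} 𝓕β(y m)`. [folklore] -/
private theorem IsTestAway.tsum_int_comp_div {β : ℝ → ℂ} (hβ : IsTestAway β) {y : ℝ} (hy : y ≠ 0) :
    ∑' n : ℤ, β (n / y) = ∑' m : ℤ, ((|y| : ℝ) : ℂ) * 𝓕 β (y * m) := by
  set ψ : 𝓢(ℝ, ℂ) := (hβ.hasCompactSupport_comp_div hy).toSchwartzMap (hβ.contDiff_comp_div y)
    with hψ
  have h := SchwartzMap.tsum_eq_tsum_fourier ψ 0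
  simp only [zero_add, QuotientAddGroup.mk_zero, fourier_eval_zero, mul_one] at h
  have hL : ∀ n : ℤ, ψ n = β (n / y) := fun n ↦ rfl
  have hR : ∀ m : ℤ, (𝓕 ψ) m = ((|y| : ℝ) : ℂ) * 𝓕 β (y * m) := by
    intro m
    rw [congrFun (SchwartzMap.fourier_coe ψ) m]
    exact fourier_comp_div_eq β hy m
  simp only [hL, hR] at h
  exact h

/-- The dilate values at positive integers: `β((n+1)/y) = |y| · α(y/(n+1))/(n+1)` for
`β = I(α)`. [folklore] -/
private theorem inv_apply_nat_div (α : ℝ → ℂ) (y : ℝ) (n : ℕ) :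
    inv α (((n : ℝ) + 1) / y) = ((|y| : ℝ) : ℂ) * (α (y / ((n : ℝ) + 1)) / ((n : ℂ) + 1)) := by
  rcases eq_or_ne y 0 with rfl | hy
  · simp [CoPoisson.inv]
  have hn1 : (0 : ℝ) < (n : ℝ) + 1 := by positivity
  rw [CoPoisson.inv, inv_div, abs_div, abs_of_pos hn1]
  have h1 : (((n : ℝ) + 1 : ℝ) : ℂ) ≠ 0 := by exact_mod_cast hn1.ne'
  have h2 : ((|y| : ℝ) : ℂ) ≠ 0 := by exact_mod_cast (abs_pos.2 hy).ne'
  push_cast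
  field_simp

/-- Summability of `m ↦ 𝓕β(y(m+1))` from the Schwartz decay. [folklore] -/
private theorem IsTestAway.summable_fourier_mul_nat {β : ℝ → ℂ} (hβ : IsTestAway β) {y : ℝ}
    (hy : y ≠ 0) : Summable fun m : ℕ ↦ 𝓕 β (y * (((m : ℝ) + 1))) := by
  obtain ⟨C, hC0, hC⟩ := hβ.norm_fourier_le
  have hs : Summable fun m : ℕ ↦ C / y ^ 2 * (1 / ((m : ℝ) + 1) ^ 2) := by
    have := (summable_nat_add_iff 1).2 (Real.summable_one_div_nat_pow.2 one_lt_two)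
    refine (Summable.mul_left (C / y ^ 2) ?_)
    simpa [Nat.cast_succ] using this
  refine Summable.of_norm_bounded hs fun m ↦ ?_
  have hm : y * ((m : ℝ) + 1) ≠ 0 := mul_ne_zero hy (by positivity)
  refine (hC _ hm).trans (le_of_eq ?_)
  field_simp

/-- **Key formula**: for `y ≠ 0`, `P'(α)(y) = Σ_{m ≥ 1} 𝓕(I(α))(m y)` (Burnol 2004, proof of Thm 3.8, TeX l. 1107–1115: `E'_ℝ(g)(y) = Σ_{n ≠ 0} γ(ny)`, `γ = 𝓕β`), by Poisson summation for the dilate `x ↦ I(α)(x/y)` and `∫_0^∞ I(α) = ∫_0^∞ α(u)du/u`. [cite: Burnol2004, proof of Thm 3.8 (TeX l. 1107–1115)] -/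
theorem IsTestAway.coSum_eq_tsum_fourier (h : IsTestAway α) {y : ℝ} (hy : y ≠ 0) :
    coSum α y = ∑' m : ℕ, 𝓕 (inv α) (y * ((m : ℝ) + 1)) := by
  have hβ := h.isTestAway_inv
  have hP := hβ.tsum_int_comp_div hy
  -- left-hand side
  have hLsum : Summable fun n : ℕ ↦ inv α ((n : ℝ) / y) := by
    have : Summable fun n : ℕ ↦ inv α (((n : ℝ) + 1) / y) := by
      simp only [inv_apply_nat_div]
      exact (h.summable_term y).mul_left _
    have h1 := (summable_nat_add_iff (f := fun n : ℕ ↦ inv α ((n : ℝ) / y)) 1).1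
    apply h1
    simpa [Nat.cast_succ] using this
  have hLeven : ∀ n : ℤ, inv α (((-n : ℤ) : ℝ) / y) = inv α ((n : ℝ) / y) := by
    intro n; rw [Int.cast_neg, neg_div, hβ.even]
  have hL := tsum_int_of_even (F := fun n : ℤ ↦ inv α ((n : ℝ) / y)) hLeven
    (by simpa using hLsum)
  -- right-hand side
  have hRsum : Summable fun m : ℕ ↦ ((|y| : ℝ) : ℂ) * 𝓕 (inv α) (y * (m : ℝ)) := by
    have : Summable fun m : ℕ ↦ ((|y| : ℝ) : ℂ) * 𝓕 (inv α) (y * ((m : ℝ) + 1)) :=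
      (hβ.summable_fourier_mul_nat hy).mul_left _
    have h1 := (summable_nat_add_iff
      (f := fun m : ℕ ↦ ((|y| : ℝ) : ℂ) * 𝓕 (inv α) (y * (m : ℝ))) 1).1
    apply h1
    simpa [Nat.cast_succ] using this
  have hReven : ∀ m : ℤ, ((|y| : ℝ) : ℂ) * 𝓕 (inv α) (y * ((-m : ℤ) : ℝ)) =
      ((|y| : ℝ) : ℂ) * 𝓕 (inv α) (y * (m : ℝ)) := by
    intro m; rw [Int.cast_neg, mul_neg, fourier_neg_of_even hβ.even]
  have hR := tsum_int_of_even (F := fun m : ℤ ↦ ((|y| : ℝ) : ℂ) * 𝓕 (inv α) (y * (m : ℝ)))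
    hReven (by simpa using hRsum)
  -- combine
  simp only [Int.cast_zero, zero_div, mul_zero] at hL hR
  rw [hL, hR] at hP
  have h0 : inv α 0 = 0 := hβ.apply_zero
  rw [h0, zero_add, fourier_apply_zero, integral_eq_two_mul_Ioi hβ.integrable hβ.even,
    integral_Ioi_inv] at hP
  have hterm : (∑' n : ℕ, inv α ((((n : ℤ) + 1 : ℤ) : ℝ) / y)) =
      ((|y| : ℝ) : ℂ) * ∑' n : ℕ, (α (y / ((n : ℝ) + 1)) / ((n : ℂ) + 1)) := by
    rw [← tsum_mul_left]; congr 1; funext n; push_cast; exact inv_apply_nat_div α y n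
  rw [hterm] at hP
  have hyC : ((|y| : ℝ) : ℂ) ≠ 0 := by exact_mod_cast (abs_pos.2 hy).ne'
  rw [coSum]
  -- hP : 2 * (|y| * S) = |y| * (2 * c) + 2 * ∑' m, |y| * 𝓕β(y(m+1))
  have hP' : (∑' n : ℕ, (α (y / ((n : ℝ) + 1)) / ((n : ℂ) + 1))) = (∫ v in Ioi (0:ℝ), α v / (v : ℂ)) +
      ∑' m : ℕ, 𝓕 (inv α) (y * ((m : ℝ) + 1)) := by
    have h2 : (∑' m : ℕ, ((|y| : ℝ) : ℂ) * 𝓕 (inv α) (y * ((((m : ℤ) + 1 : ℤ) : ℝ)))) =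
        ((|y| : ℝ) : ℂ) * ∑' m : ℕ, 𝓕 (inv α) (y * ((m : ℝ) + 1)) := by
      rw [← tsum_mul_left]; congr 1; funext m; push_cast; rfl
    rw [h2] at hP
    have h3 : ((|y| : ℝ) : ℂ) * (∑' n : ℕ, (α (y / ((n : ℝ) + 1)) / ((n : ℂ) + 1))) =
        ((|y| : ℝ) : ℂ) * ((∫ v in Ioi (0:ℝ), α v / (v : ℂ)) +
          ∑' m : ℕ, 𝓕 (inv α) (y * ((m : ℝ) + 1))) := by
      linear_combination hP / 2
    exact mul_left_cancel₀ hyC h3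
  rw [hP']
  ring


/-! ## F. Decay, continuity, integrability of `P'(α)`; Theorem 3.8 -/

/-- `Σ_{m ≥ 1} 1/m² ≤ 2`. [folklore] -/
private theorem tsum_one_div_nat_succ_sq_le_two : ∑' m : ℕ, 1 / ((m : ℝ) + 1) ^ 2 ≤ 2 := by
  have h := hasSum_zeta_two
  have h1 : ∑' n : ℕ, (1 : ℝ) / (n : ℝ) ^ 2 = π ^ 2 / 6 := h.tsum_eq
  have h2 : ∑' n : ℕ, (1 : ℝ) / (n : ℝ) ^ 2 = 1 / ((0 : ℕ) : ℝ) ^ 2 +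
      ∑' m : ℕ, (1 : ℝ) / (((m + 1 : ℕ) : ℝ)) ^ 2 := h.summable.tsum_eq_zero_add
  simp only [Nat.cast_zero, ne_eq, OfNat.ofNat_ne_zero, not_false_eq_true, zero_pow, div_zero,
    zero_add, Nat.cast_add, Nat.cast_one] at h2
  rw [← h2, h1]
  nlinarith [Real.pi_lt_d2, Real.pi_pos]

/-- Decay `‖P'(α)(y)‖ ≤ K/y²` (`y ≠ 0`), from the key formula and the Schwartz decay of `𝓕(Iα)` (Thm 3.9: `P'(α)` is of rapid decrease; only the quadratic rate is recorded). [cite: Burnol2004, Thm 3.9 (TeX l. 1137)] -/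
theorem IsTestAway.exists_norm_coSum_le_div_sq (h : IsTestAway α) :
    ∃ K : ℝ, 0 < K ∧ ∀ y : ℝ, y ≠ 0 → ‖coSum α y‖ ≤ K / y ^ 2 := by
  have hβ := h.isTestAway_inv
  obtain ⟨C, hC0, hC⟩ := hβ.norm_fourier_le
  refine ⟨2 * C, by positivity, fun y hy ↦ ?_⟩
  rw [h.coSum_eq_tsum_fourier hy]
  have hb : ∀ m : ℕ, ‖𝓕 (inv α) (y * ((m : ℝ) + 1))‖ ≤ C / y ^ 2 * (1 / ((m : ℝ) + 1) ^ 2) := by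
    intro m
    have hm : y * ((m : ℝ) + 1) ≠ 0 := mul_ne_zero hy (by positivity)
    refine (hC _ hm).trans (le_of_eq ?_)
    field_simp
  have hs : Summable fun m : ℕ ↦ C / y ^ 2 * (1 / ((m : ℝ) + 1) ^ 2) := by
    have := (summable_nat_add_iff 1).2 (Real.summable_one_div_nat_pow.2 one_lt_two)
    refine (Summable.mul_left (C / y ^ 2) ?_)
    simpa [Nat.cast_succ] using this
  have hns : Summable fun m : ℕ ↦ ‖𝓕 (inv α) (y * ((m : ℝ) + 1))‖ :=
    Summable.of_nonneg_of_le (fun _ ↦ norm_nonneg _) hb hs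
  calc ‖∑' m : ℕ, 𝓕 (inv α) (y * ((m : ℝ) + 1))‖
      ≤ ∑' m : ℕ, ‖𝓕 (inv α) (y * ((m : ℝ) + 1))‖ := norm_tsum_le_tsum_norm hns
    _ ≤ ∑' m : ℕ, C / y ^ 2 * (1 / ((m : ℝ) + 1) ^ 2) := hns.tsum_le_tsum hb hs
    _ = C / y ^ 2 * ∑' m : ℕ, 1 / ((m : ℝ) + 1) ^ 2 := tsum_mul_left
    _ ≤ C / y ^ 2 * 2 :=
        mul_le_mul_of_nonneg_left tsum_one_div_nat_succ_sq_le_two (by positivity)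
    _ = 2 * C / y ^ 2 := by ring

/-- Each summand `y ↦ α(y/(n+1))/(n+1)` is continuous. [folklore] -/
private theorem IsTestAway.continuous_term (h : IsTestAway α) (n : ℕ) :
    Continuous fun y : ℝ ↦ α (y / ((n : ℝ) + 1)) / ((n : ℂ) + 1) := by
  exact ((h.continuous.comp (continuous_id.div_const _))).div_const _

/-- `P'(α)` is continuous (locally a finite sum of dilates of `α`). [cite: Burnol2004, Thm 3.9 (TeX l. 1137)] -/
theorem IsTestAway.continuous_coSum (h : IsTestAway α) : Continuous (coSum α) := by
  obtain ⟨δ, hδ, -, hN⟩ := h.tsum_term_eq_sum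
  rw [continuous_iff_continuousAt]
  intro y₀
  set N : ℕ := ⌈(|y₀| + 1) / δ⌉₊ with hNdef
  have hev : coSum α =ᶠ[𝓝 y₀] fun y ↦ (∑ n ∈ Finset.range N, (α (y / ((n : ℝ) + 1)) / ((n : ℂ) + 1))) -
      ∫ u in Ioi (0 : ℝ), α u / (u : ℂ) := by
    have hball : Metric.ball y₀ 1 ∈ 𝓝 y₀ := Metric.ball_mem_nhds _ one_pos
    filter_upwards [hball] with y hy
    rw [Metric.mem_ball, Real.dist_eq] at hy
    have hyN : |y| / δ ≤ N := by
      refine le_trans ?_ (Nat.le_ceil _)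
      gcongr
      have := abs_sub_abs_le_abs_sub y y₀
      linarith
    rw [coSum, hN y N hyN]
  refine (Continuous.continuousAt ?_).congr_of_eventuallyEq hev
  exact (continuous_finsetSum _ fun n _ ↦ h.continuous_term n).sub continuous_const

/-- `P'(α)` is bounded. [cite: Burnol2004, Thm 3.9 (TeX l. 1137)] -/
theorem IsTestAway.exists_norm_coSum_le (h : IsTestAway α) :
    ∃ B : ℝ, 0 ≤ B ∧ ∀ y : ℝ, ‖coSum α y‖ ≤ B := by
  obtain ⟨K, hK0, hK⟩ := h.exists_norm_coSum_le_div_sq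
  obtain ⟨B₁, hB₁⟩ := (isCompact_Icc (a := (-1 : ℝ)) (b := 1)).exists_bound_of_continuousOn
    (h.continuous_coSum.continuousOn)
  refine ⟨max B₁ K, le_trans hK0.le (le_max_right _ _), fun y ↦ ?_⟩
  by_cases hy : |y| ≤ 1
  · exact (hB₁ y (by rw [mem_Icc]; exact abs_le.1 hy)).trans (le_max_left _ _)
  · rw [not_le] at hy
    have hy0 : y ≠ 0 := by rintro rfl; simp at hy; linarith
    have hy2 : 1 ≤ y ^ 2 := by nlinarith [sq_abs y]
    calc ‖coSum α y‖ ≤ K / y ^ 2 := hK y hy0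
      _ ≤ K := div_le_self hK0.le hy2
      _ ≤ max B₁ K := le_max_right _ _

/-- Global majorant `‖P'(α)(y)‖ ≤ M/(1+y²)`. [cite: Burnol2004, Thm 3.9 (TeX l. 1137)] -/
theorem IsTestAway.exists_norm_coSum_le_inv_one_add_sq (h : IsTestAway α) :
    ∃ M : ℝ, 0 ≤ M ∧ ∀ y : ℝ, ‖coSum α y‖ ≤ M * (1 + y ^ 2)⁻¹ := by
  obtain ⟨K, hK0, hK⟩ := h.exists_norm_coSum_le_div_sq
  obtain ⟨B, hB0, hB⟩ := h.exists_norm_coSum_le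
  refine ⟨B + K, by positivity, fun y ↦ ?_⟩
  rw [← div_eq_mul_inv, le_div_iff₀ (by positivity)]
  have h1 := hB y
  rcases eq_or_ne y 0 with rfl | hy
  · simp; linarith
  · have h2 := hK y hy
    have hy2 : 0 < y ^ 2 := by positivity
    rw [le_div_iff₀ hy2] at h2
    nlinarith [norm_nonneg (coSum α y)]

/-- `P'(α) ∈ L¹(ℝ)` (Thm 4.5: "continuous `L¹`-functions"; Thm 3.9). [cite: Burnol2004, Thm 4.5 (TeX l. 1418)] -/
theorem IsTestAway.integrable_coSum (h : IsTestAway α) : Integrable (coSum α) := by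
  obtain ⟨M, hM0, hM⟩ := h.exists_norm_coSum_le_inv_one_add_sq
  exact (integrable_inv_one_add_sq.const_mul M).mono'
    h.continuous_coSum.aestronglyMeasurable (Eventually.of_forall hM)

/-- `P'(α) ∈ L²(ℝ)` (Thm 3.8: "a square-integrable function"). [cite: Burnol2004, Thm 3.8 (TeX l. 1040)] -/
theorem IsTestAway.memLp_two_coSum (h : IsTestAway α) :
    MemLp (coSum α) 2 (volume : Measure ℝ) := by
  obtain ⟨M, hM0, hM⟩ := h.exists_norm_coSum_le_inv_one_add_sq
  rw [memLp_two_iff_integrable_sq_norm h.continuous_coSum.aestronglyMeasurable]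
  refine (integrable_inv_one_add_sq.const_mul (M ^ 2)).mono'
    (h.continuous_coSum.norm.pow 2).aestronglyMeasurable (Eventually.of_forall fun y ↦ ?_)
  rw [Real.norm_of_nonneg (by positivity)]
  have h1 := hM y
  have h2 : 0 ≤ (1 + y ^ 2)⁻¹ := by positivity
  have h3 : (1 + y ^ 2)⁻¹ ≤ 1 := inv_le_one_of_one_le₀ (by nlinarith)
  calc ‖coSum α y‖ ^ 2 ≤ (M * (1 + y ^ 2)⁻¹) ^ 2 := by
        gcongr
    _ = M ^ 2 * (1 + y ^ 2)⁻¹ * (1 + y ^ 2)⁻¹ := by ring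
    _ ≤ M ^ 2 * (1 + y ^ 2)⁻¹ * 1 := by gcongr
    _ = M ^ 2 * (1 + y ^ 2)⁻¹ := by ring

end CoPoisson

open CoPoisson in
/-- **Proof of Burnol 2004, Theorem 3.8** (statement on `ℝ`): `P'(α)` is square-integrable and equals `-∫_0^∞ α(u) du/u` near the origin. Discharges `Literature.NumberTheory.LFunctions.Burnol2004_thm_3_8`. [cite: Burnol2004, Thm 3.8 (TeX l. 1040)] -/
theorem Burnol2004_thm_3_8_holds : Burnol2004_thm_3_8 :=
  fun _ h ↦ ⟨h.memLp_two_coSum, h.coSum_eventually_eq⟩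

namespace CoPoisson

/-! ## G. The weak intertwining identity `∫ φ·P'(α) = ∫ 𝓕φ·P'(Iα)` (Burnol's first proof of
co-Poisson intertwining, TeX l. 1163–1200), for an even Schwartz function `φ` -/

section pairing

variable {α : ℝ → ℂ} {φ : ℝ → ℂ} {C : ℝ}

/-- Decay transport: if `t²‖φ t‖ ≤ C` then `‖φ((n+1)u)‖ ≤ C/((n+1)²δ²)` for `|u| ≥ δ > 0`.
[folklore] -/
private theorem norm_dilate_le (hC : ∀ t : ℝ, t ^ 2 * ‖φ t‖ ≤ C) {δ : ℝ} (hδ : 0 < δ)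
    {u : ℝ} (hu : δ ≤ |u|) (n : ℕ) :
    ‖φ (((n : ℝ) + 1) * u)‖ ≤ C / (((n : ℝ) + 1) ^ 2 * δ ^ 2) := by
  have hn1 : (0 : ℝ) < (n : ℝ) + 1 := by positivity
  have ht : δ * ((n : ℝ) + 1) ≤ |((n : ℝ) + 1) * u| := by
    rw [abs_mul, abs_of_pos hn1]; nlinarith
  have h1 := hC (((n : ℝ) + 1) * u)
  rw [le_div_iff₀ (by positivity)]
  calc ‖φ (((n : ℝ) + 1) * u)‖ * (((n : ℝ) + 1) ^ 2 * δ ^ 2)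
      = ‖φ (((n : ℝ) + 1) * u)‖ * (δ * ((n : ℝ) + 1)) ^ 2 := by ring
    _ ≤ ‖φ (((n : ℝ) + 1) * u)‖ * |((n : ℝ) + 1) * u| ^ 2 := by
        gcongr
    _ = (((n : ℝ) + 1) * u) ^ 2 * ‖φ (((n : ℝ) + 1) * u)‖ := by rw [sq_abs]; ring
    _ ≤ C := h1

/-- The dilated products `u ↦ φ((n+1)u) α(u)` are integrable. [folklore] -/
private theorem integrable_dilate_mul (hφ : Continuous φ) (hα : IsTestAway α) (n : ℕ) :
    Integrable fun u : ℝ ↦ φ (((n : ℝ) + 1) * u) * α u :=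
  ((hφ.comp (continuous_const.mul continuous_id)).mul hα.continuous).integrable_of_hasCompactSupport
    hα.hasCompactSupport.mul_left

/-- `∫ ‖φ((n+1)u) α(u)‖ du ≤ C/((n+1)²δ²) · ‖α‖₁`. [folklore] -/
private theorem integral_norm_dilate_mul_le (hC : ∀ t : ℝ, t ^ 2 * ‖φ t‖ ≤ C)
    (hα : IsTestAway α) {δ : ℝ} (hδ : 0 < δ) (hz : ∀ y : ℝ, |y| < δ → α y = 0) (n : ℕ) :
    ∫ u : ℝ, ‖φ (((n : ℝ) + 1) * u) * α u‖ ≤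
      C / (((n : ℝ) + 1) ^ 2 * δ ^ 2) * ∫ u : ℝ, ‖α u‖ := by
  rw [← integral_const_mul]
  refine integral_mono_of_nonneg (Eventually.of_forall fun _ ↦ norm_nonneg _)
    (hα.integrable.norm.const_mul _) (Eventually.of_forall fun u ↦ ?_)
  simp only
  by_cases hu : |u| < δ
  · simp [hz u hu]
  · rw [not_lt] at hu
    rw [norm_mul]
    exact mul_le_mul_of_nonneg_right (norm_dilate_le hC hδ hu n) (norm_nonneg _)

/-- Hence `Σ_n ∫ ‖φ((n+1)u) α(u)‖ du < ∞`. [folklore] -/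
private theorem summable_integral_norm_dilate_mul (hC : ∀ t : ℝ, t ^ 2 * ‖φ t‖ ≤ C)
    (hα : IsTestAway α) :
    Summable fun n : ℕ ↦ ∫ u : ℝ, ‖φ (((n : ℝ) + 1) * u) * α u‖ := by
  obtain ⟨δ, hδ, hz⟩ := hα.exists_ball
  have hC0 : 0 ≤ C := le_trans (by positivity) (hC 0)
  have hs : Summable fun n : ℕ ↦ C / (((n : ℝ) + 1) ^ 2 * δ ^ 2) * ∫ u : ℝ, ‖α u‖ := by
    have h1 := (summable_nat_add_iff 1).2 (Real.summable_one_div_nat_pow.2 one_lt_two)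
    have h2 : Summable fun n : ℕ ↦ (C / δ ^ 2 * ∫ u : ℝ, ‖α u‖) * (1 / ((n : ℝ) + 1) ^ 2) := by
      refine Summable.mul_left _ ?_
      simpa [Nat.cast_succ] using h1
    refine h2.congr fun n ↦ ?_
    field_simp
  refine Summable.of_nonneg_of_le (fun n ↦ integral_nonneg fun _ ↦ norm_nonneg _)
    (fun n ↦ integral_norm_dilate_mul_le hC hα hδ hz n) hs

/-- The substitution `u = y/(n+1)`: `∫ φ(y) α(y/(n+1))/(n+1) dy = ∫ φ((n+1)u) α(u) du`.
[folklore] -/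
private theorem integral_mul_term_eq (φ : ℝ → ℂ) (α : ℝ → ℂ) (n : ℕ) :
    ∫ y : ℝ, φ y * (α (y / ((n : ℝ) + 1)) / ((n : ℂ) + 1)) =
      ∫ u : ℝ, φ (((n : ℝ) + 1) * u) * α u := by
  have hn1 : (0 : ℝ) < (n : ℝ) + 1 := by positivity
  have h := Measure.integral_comp_div (fun u : ℝ ↦ φ (((n : ℝ) + 1) * u) * α u) ((n : ℝ) + 1)
  simp only [abs_of_pos hn1] at h
  have e : (fun y : ℝ ↦ φ (((n : ℝ) + 1) * (y / ((n : ℝ) + 1))) * α (y / ((n : ℝ) + 1))) =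
      fun y : ℝ ↦ φ y * α (y / ((n : ℝ) + 1)) := by
    funext y; rw [mul_div_cancel₀ _ hn1.ne']
  rw [e] at h
  have hn1C : ((n : ℂ) + 1) ≠ 0 := by exact_mod_cast hn1.ne'
  calc ∫ y : ℝ, φ y * (α (y / ((n : ℝ) + 1)) / ((n : ℂ) + 1))
      = (((n : ℝ) + 1 : ℝ) : ℂ)⁻¹ * ∫ y : ℝ, φ y * α (y / ((n : ℝ) + 1)) := by
        rw [← integral_const_mul]; congr 1; funext y; push_cast; field_simp
    _ = ∫ u : ℝ, φ (((n : ℝ) + 1) * u) * α u := by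
        rw [h, Complex.real_smul, ← mul_assoc]
        rw [show ((((n : ℝ) + 1 : ℝ) : ℂ)⁻¹ * (((n : ℝ) + 1 : ℝ) : ℂ)) = 1 from
          inv_mul_cancel₀ (by exact_mod_cast hn1.ne'), one_mul]

/-- The same substitution for the norms. [folklore] -/
private theorem integral_norm_mul_term_eq (φ : ℝ → ℂ) (α : ℝ → ℂ) (n : ℕ) :
    ∫ y : ℝ, ‖φ y * (α (y / ((n : ℝ) + 1)) / ((n : ℂ) + 1))‖ =
      ∫ u : ℝ, ‖φ (((n : ℝ) + 1) * u) * α u‖ := by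
  have hn1 : (0 : ℝ) < (n : ℝ) + 1 := by positivity
  have h := Measure.integral_comp_div (fun u : ℝ ↦ ‖φ (((n : ℝ) + 1) * u) * α u‖) ((n : ℝ) + 1)
  simp only [abs_of_pos hn1] at h
  have e : (fun y : ℝ ↦ ‖φ (((n : ℝ) + 1) * (y / ((n : ℝ) + 1))) * α (y / ((n : ℝ) + 1))‖) =
      fun y : ℝ ↦ ‖φ y * α (y / ((n : ℝ) + 1))‖ := by
    funext y; rw [mul_div_cancel₀ _ hn1.ne']
  rw [e] at h
  have hnC : ‖((n : ℂ) + 1)‖ = (n : ℝ) + 1 := by exact_mod_cast Complex.norm_natCast (n + 1)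
  have hnorm : ∀ y : ℝ, ‖φ y * (α (y / ((n : ℝ) + 1)) / ((n : ℂ) + 1))‖ =
      ((n : ℝ) + 1)⁻¹ * ‖φ y * α (y / ((n : ℝ) + 1))‖ := by
    intro y
    rw [← mul_div_assoc, norm_div, hnC, div_eq_inv_mul]
  simp_rw [hnorm]
  rw [integral_const_mul, h, smul_eq_mul, ← mul_assoc, inv_mul_cancel₀ hn1.ne', one_mul]

/-- **Tonelli step, left form**: `∫ φ(y) S_α(y) dy = Σ_n ∫ φ((n+1)u) α(u) du`, where
`S_α(y) = Σ_n α(y/(n+1))/(n+1)`. [folklore] -/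
private theorem integral_mul_tsum_eq_tsum (hC : ∀ t : ℝ, t ^ 2 * ‖φ t‖ ≤ C) (hφ : Continuous φ)
    (hα : IsTestAway α) :
    ∫ y : ℝ, φ y * ∑' n : ℕ, α (y / ((n : ℝ) + 1)) / ((n : ℂ) + 1) =
      ∑' n : ℕ, ∫ u : ℝ, φ (((n : ℝ) + 1) * u) * α u := by
  have hint : ∀ n : ℕ, Integrable fun y : ℝ ↦ φ y * (α (y / ((n : ℝ) + 1)) / ((n : ℂ) + 1)) := by
    intro n
    have hc : Continuous fun y : ℝ ↦ φ y * (α (y / ((n : ℝ) + 1)) / ((n : ℂ) + 1)) :=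
      hφ.mul ((hα.continuous.comp (continuous_id.div_const _)).div_const _)
    refine hc.integrable_of_hasCompactSupport ?_
    have hn1 : ((n : ℝ) + 1) ≠ 0 := by positivity
    have h1 : HasCompactSupport fun y : ℝ ↦ α (y / ((n : ℝ) + 1)) :=
      hα.hasCompactSupport_comp_div hn1
    refine h1.mono ?_
    intro y hy
    rw [Function.mem_support] at hy ⊢
    contrapose! hy
    simp [hy]
  have hsum : Summable fun n : ℕ ↦ ∫ y : ℝ, ‖φ y * (α (y / ((n : ℝ) + 1)) / ((n : ℂ) + 1))‖ := by
    simp_rw [integral_norm_mul_term_eq]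
    exact summable_integral_norm_dilate_mul hC hα
  have h := integral_tsum_of_summable_integral_norm hint hsum
  simp_rw [integral_mul_term_eq] at h
  have e : (fun y : ℝ ↦ φ y * ∑' n : ℕ, α (y / ((n : ℝ) + 1)) / ((n : ℂ) + 1)) =
      fun y : ℝ ↦ ∑' n : ℕ, φ y * (α (y / ((n : ℝ) + 1)) / ((n : ℂ) + 1)) := by
    funext y; rw [tsum_mul_left]
  rw [e]
  exact h.symm

/-- **Tonelli step, right form**: `∫ (Σ_n φ((n+1)u)) α(u) du = Σ_n ∫ φ((n+1)u) α(u) du`.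
[folklore] -/
private theorem integral_tsum_mul_eq_tsum (hC : ∀ t : ℝ, t ^ 2 * ‖φ t‖ ≤ C) (hφ : Continuous φ)
    (hα : IsTestAway α) :
    ∫ u : ℝ, (∑' n : ℕ, φ (((n : ℝ) + 1) * u)) * α u =
      ∑' n : ℕ, ∫ u : ℝ, φ (((n : ℝ) + 1) * u) * α u := by
  have e : (fun u : ℝ ↦ (∑' n : ℕ, φ (((n : ℝ) + 1) * u)) * α u) =
      fun u : ℝ ↦ ∑' n : ℕ, φ (((n : ℝ) + 1) * u) * α u := by
    funext u; rw [tsum_mul_right]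
  rw [e]
  exact (integral_tsum_of_summable_integral_norm (integrable_dilate_mul hφ hα)
    (summable_integral_norm_dilate_mul hC hα)).symm

end pairing

/-! ### Poisson summation for a dilated even Schwartz function -/

section poisson

/-- Quadratic decay of a Schwartz function. [folklore] -/
private theorem schwartz_sq_decay (φ : 𝓢(ℝ, ℂ)) : ∃ C : ℝ, ∀ t : ℝ, t ^ 2 * ‖φ t‖ ≤ C := by
  obtain ⟨C, -, hC⟩ := φ.decay 2 0
  refine ⟨C, fun t ↦ ?_⟩
  have h := hC t
  rwa [norm_iteratedFDeriv_zero, Real.norm_eq_abs, sq_abs] at h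

/-- Quadratic decay of the Fourier transform of a Schwartz function. [folklore] -/
private theorem schwartz_fourier_sq_decay (φ : 𝓢(ℝ, ℂ)) :
    ∃ C : ℝ, ∀ t : ℝ, t ^ 2 * ‖𝓕 (φ : ℝ → ℂ) t‖ ≤ C := by
  obtain ⟨C, hC⟩ := schwartz_sq_decay (𝓕 φ)
  refine ⟨C, fun t ↦ ?_⟩
  have h := hC t
  rwa [congrFun (SchwartzMap.fourier_coe φ) t] at h

/-- Summability of `m ↦ g(y(m+1))` from quadratic decay (`y ≠ 0`). [folklore] -/
private theorem summable_mul_succ_of_sq_decay {g : ℝ → ℂ} {C : ℝ}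
    (hC : ∀ t : ℝ, t ^ 2 * ‖g t‖ ≤ C) {y : ℝ} (hy : y ≠ 0) :
    Summable fun m : ℕ ↦ g (y * ((m : ℝ) + 1)) := by
  have hs : Summable fun m : ℕ ↦ C / y ^ 2 * (1 / ((m : ℝ) + 1) ^ 2) := by
    have := (summable_nat_add_iff 1).2 (Real.summable_one_div_nat_pow.2 one_lt_two)
    refine (Summable.mul_left (C / y ^ 2) ?_)
    simpa [Nat.cast_succ] using this
  refine Summable.of_norm_bounded hs fun m ↦ ?_
  have hm : y * ((m : ℝ) + 1) ≠ 0 := mul_ne_zero hy (by positivity)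
  have h1 := hC (y * ((m : ℝ) + 1))
  have hpos : 0 < (y * ((m : ℝ) + 1)) ^ 2 := by positivity
  rw [show C / y ^ 2 * (1 / ((m : ℝ) + 1) ^ 2) = C / (y * ((m : ℝ) + 1)) ^ 2 by field_simp]
  rw [le_div_iff₀ hpos, mul_comm]
  exact h1

/-- **Poisson summation for the dilate of an even Schwartz function** (`u ≠ 0`):
`Σ_{n ≥ 1} φ(nu) = −φ(0)/2 + 𝓕φ(0)/(2|u|) + |u|⁻¹ Σ_{m ≥ 1} 𝓕φ(m/u)`
(Burnol 2004, TeX l. 1175–1185). [folklore] -/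
private theorem tsum_dilate_eq (φ : 𝓢(ℝ, ℂ)) (he : ∀ x : ℝ, φ (-x) = φ x) {u : ℝ} (hu : u ≠ 0) :
    ∑' n : ℕ, φ (((n : ℝ) + 1) * u) =
      -(φ 0) / 2 + ((|u|⁻¹ : ℝ) : ℂ) * 𝓕 (φ : ℝ → ℂ) 0 / 2 +
        ((|u|⁻¹ : ℝ) : ℂ) * ∑' m : ℕ, 𝓕 (φ : ℝ → ℂ) (u⁻¹ * ((m : ℝ) + 1)) := by
  set ψ : 𝓢(ℝ, ℂ) := SchwartzMap.compCLMOfContinuousLinearEquiv ℂ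
    (ContinuousLinearEquiv.unitsEquivAut ℝ (Units.mk0 u hu)) φ with hψ
  have hψapply : ∀ x : ℝ, ψ x = φ (x * u) := fun x ↦ rfl
  have hP := SchwartzMap.tsum_eq_tsum_fourier ψ 0
  simp only [zero_add, QuotientAddGroup.mk_zero, fourier_eval_zero, mul_one] at hP
  -- Fourier transform of the dilate
  have hFψ : ∀ m : ℤ, (𝓕 ψ) m = ((|u⁻¹| : ℝ) : ℂ) * 𝓕 (φ : ℝ → ℂ) (u⁻¹ * m) := by
    intro m
    rw [congrFun (SchwartzMap.fourier_coe ψ) m]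
    have e : (ψ : ℝ → ℂ) = fun x : ℝ ↦ φ (x / u⁻¹) := by
      funext x; rw [hψapply, div_inv_eq_mul]
    rw [e]
    exact fourier_comp_div_eq (φ : ℝ → ℂ) (inv_ne_zero hu) m
  simp only [hψapply, hFψ] at hP
  -- split both sides
  obtain ⟨C₁, hC₁⟩ := schwartz_sq_decay φ
  obtain ⟨C₂, hC₂⟩ := schwartz_fourier_sq_decay φ
  have hLeven : ∀ n : ℤ, φ (((-n : ℤ) : ℝ) * u) = φ ((n : ℝ) * u) := by
    intro n; rw [Int.cast_neg, neg_mul, he]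
  have hLsum : Summable fun n : ℕ ↦ φ ((n : ℝ) * u) := by
    have h1 : Summable fun n : ℕ ↦ φ (u * ((n : ℝ) + 1)) := summable_mul_succ_of_sq_decay hC₁ hu
    have h2 := (summable_nat_add_iff (f := fun n : ℕ ↦ φ ((n : ℝ) * u)) 1).1
    apply h2
    refine h1.congr fun n ↦ ?_
    push_cast; ring_nf
  have hL := tsum_int_of_even (F := fun n : ℤ ↦ φ ((n : ℝ) * u)) hLeven (by simpa using hLsum)
  have hFeven : ∀ w : ℝ, 𝓕 (φ : ℝ → ℂ) (-w) = 𝓕 (φ : ℝ → ℂ) w := fourier_neg_of_even he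
  have hReven : ∀ m : ℤ, ((|u⁻¹| : ℝ) : ℂ) * 𝓕 (φ : ℝ → ℂ) (u⁻¹ * ((-m : ℤ) : ℝ)) =
      ((|u⁻¹| : ℝ) : ℂ) * 𝓕 (φ : ℝ → ℂ) (u⁻¹ * (m : ℝ)) := by
    intro m; rw [Int.cast_neg, mul_neg, hFeven]
  have hRsum : Summable fun m : ℕ ↦ ((|u⁻¹| : ℝ) : ℂ) * 𝓕 (φ : ℝ → ℂ) (u⁻¹ * (m : ℝ)) := by
    have h1 : Summable fun m : ℕ ↦ ((|u⁻¹| : ℝ) : ℂ) * 𝓕 (φ : ℝ → ℂ) (u⁻¹ * ((m : ℝ) + 1)) :=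
      (summable_mul_succ_of_sq_decay hC₂ (inv_ne_zero hu)).mul_left _
    have h2 := (summable_nat_add_iff
      (f := fun m : ℕ ↦ ((|u⁻¹| : ℝ) : ℂ) * 𝓕 (φ : ℝ → ℂ) (u⁻¹ * (m : ℝ))) 1).1
    apply h2
    simpa [Nat.cast_succ] using h1
  have hR := tsum_int_of_even
    (F := fun m : ℤ ↦ ((|u⁻¹| : ℝ) : ℂ) * 𝓕 (φ : ℝ → ℂ) (u⁻¹ * (m : ℝ))) hReven
    (by simpa using hRsum)
  simp only [Int.cast_zero, zero_mul, mul_zero] at hL hR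
  rw [hL, hR] at hP
  have h3 : (∑' n : ℕ, φ ((((n : ℤ) + 1 : ℤ) : ℝ) * u)) = ∑' n : ℕ, φ (((n : ℝ) + 1) * u) := by
    congr 1; funext n; push_cast; rfl
  have h4 : (∑' m : ℕ, ((|u⁻¹| : ℝ) : ℂ) * 𝓕 (φ : ℝ → ℂ) (u⁻¹ * ((((m : ℤ) + 1 : ℤ) : ℝ)))) =
      ((|u⁻¹| : ℝ) : ℂ) * ∑' m : ℕ, 𝓕 (φ : ℝ → ℂ) (u⁻¹ * ((m : ℝ) + 1)) := by
    rw [← tsum_mul_left]; congr 1; funext m; push_cast; rfl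
  rw [h3, h4, abs_inv] at hP
  linear_combination hP / 2

end poisson

/-! ### Assembly of the weak identity -/

section weak

variable {α : ℝ → ℂ}

/-- `u ↦ |u|⁻¹ α(u)` is integrable. [folklore] -/
private theorem integrable_abs_inv_mul (hα : IsTestAway α) :
    Integrable fun u : ℝ ↦ ((|u|⁻¹ : ℝ) : ℂ) * α u := by
  have hmeas : AEStronglyMeasurable (fun u : ℝ ↦ ((|u|⁻¹ : ℝ) : ℂ) * α u) volume :=
    ((Complex.measurable_ofReal.comp (continuous_abs.measurable.inv)).mul
      hα.continuous.measurable).aestronglyMeasurable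
  refine hα.integrable_div.congr' hmeas (Eventually.of_forall fun u ↦ ?_)
  simp only [norm_mul, norm_inv, Complex.norm_real, Real.norm_eq_abs, abs_abs, div_eq_inv_mul]

/-- `∫ |u|⁻¹ α(u) du = 2 ∫_0^∞ α(u) du/u` for even `α`. [folklore] -/
private theorem integral_abs_inv_mul (hα : IsTestAway α) :
    ∫ u : ℝ, ((|u|⁻¹ : ℝ) : ℂ) * α u = 2 * ∫ v in Ioi (0 : ℝ), α v / (v : ℂ) := by
  rw [integral_eq_two_mul_Ioi (integrable_abs_inv_mul hα) (fun u ↦ by rw [abs_neg, hα.even])]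
  congr 1
  refine setIntegral_congr_fun measurableSet_Ioi fun u hu ↦ ?_
  have hu0 : (0 : ℝ) < u := hu
  simp only [abs_of_pos hu0, Complex.ofReal_inv]
  rw [div_eq_inv_mul]

/-- `∫ α = 2 ∫_0^∞ α`. [folklore] -/
private theorem integral_eq_two (hα : IsTestAway α) :
    ∫ u : ℝ, α u = 2 * ∫ v in Ioi (0 : ℝ), α v :=
  integral_eq_two_mul_Ioi hα.integrable hα.even

/-- Uniform bound of a Schwartz function. [folklore] -/
private theorem schwartz_norm_le (φ : 𝓢(ℝ, ℂ)) : ∃ M : ℝ, ∀ t : ℝ, ‖φ t‖ ≤ M := by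
  obtain ⟨M, -, hM⟩ := φ.decay 0 0
  exact ⟨M, fun t ↦ by simpa [norm_iteratedFDeriv_zero] using hM t⟩

/-- The terms `H_m(u) = |u|⁻¹ 𝓕φ((m+1)/u) α(u)` of the dual side: integrable, with summable
`L¹` norms, and `∫ H_m = ∫ 𝓕φ((m+1)v) β(v) dv` (`β = Iα`). [folklore] -/
private theorem dual_terms (hα : IsTestAway α) (φ : 𝓢(ℝ, ℂ)) (he : ∀ x : ℝ, φ (-x) = φ x) :
    (∀ m : ℕ, Integrable fun u : ℝ ↦
        ((|u|⁻¹ : ℝ) : ℂ) * 𝓕 (φ : ℝ → ℂ) (u⁻¹ * ((m : ℝ) + 1)) * α u) ∧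
    (Summable fun m : ℕ ↦ ∫ u : ℝ,
        ‖((|u|⁻¹ : ℝ) : ℂ) * 𝓕 (φ : ℝ → ℂ) (u⁻¹ * ((m : ℝ) + 1)) * α u‖) ∧
    (∀ m : ℕ, ∫ u : ℝ, ((|u|⁻¹ : ℝ) : ℂ) * 𝓕 (φ : ℝ → ℂ) (u⁻¹ * ((m : ℝ) + 1)) * α u =
        ∫ v : ℝ, 𝓕 (φ : ℝ → ℂ) (((m : ℝ) + 1) * v) * inv α v) := by
  set Fφ : ℝ → ℂ := 𝓕 (φ : ℝ → ℂ) with hFφ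
  have hFcont : Continuous Fφ := by
    rw [hFφ, ← SchwartzMap.fourier_coe]; exact (𝓕 φ).continuous
  have hFeven : ∀ w : ℝ, Fφ (-w) = Fφ w := fourier_neg_of_even he
  obtain ⟨δ, hδ, hz⟩ := hα.exists_ball
  obtain ⟨R, hR, hRz⟩ := hα.exists_bound
  obtain ⟨C₂, hC₂⟩ := schwartz_fourier_sq_decay φ
  obtain ⟨M, hM⟩ := schwartz_norm_le (𝓕 φ)
  have hM' : ∀ t : ℝ, ‖Fφ t‖ ≤ M := fun t ↦ by
    rw [hFφ, ← congrFun (SchwartzMap.fourier_coe φ) t]; exact hM t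
  have hM0 : 0 ≤ M := le_trans (norm_nonneg _) (hM' 0)
  -- measurability of the terms
  have hmeas : ∀ m : ℕ, AEStronglyMeasurable (fun u : ℝ ↦
      ((|u|⁻¹ : ℝ) : ℂ) * Fφ (u⁻¹ * ((m : ℝ) + 1)) * α u) volume := by
    intro m
    refine ((Measurable.mul ?_ ?_).mul hα.continuous.measurable).aestronglyMeasurable
    · exact Complex.measurable_ofReal.comp (measurable_inv.comp measurable_norm)
    · exact hFcont.measurable.comp (measurable_inv.mul_const _)
  -- pointwise bounds
  have hb1 : ∀ (m : ℕ) (u : ℝ), ‖((|u|⁻¹ : ℝ) : ℂ) * Fφ (u⁻¹ * ((m : ℝ) + 1)) * α u‖ ≤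
      δ⁻¹ * M * ‖α u‖ := by
    intro m u
    by_cases hu : |u| < δ
    · simp [hz u hu]
    · rw [not_lt] at hu
      rw [norm_mul, norm_mul, Complex.norm_real, Real.norm_eq_abs, abs_inv, abs_abs]
      exact mul_le_mul (mul_le_mul (inv_anti₀ hδ hu) (hM' _) (norm_nonneg _)
        (by positivity)) le_rfl (norm_nonneg _) (by positivity)
  have hb2 : ∀ (m : ℕ) (u : ℝ), ‖((|u|⁻¹ : ℝ) : ℂ) * Fφ (u⁻¹ * ((m : ℝ) + 1)) * α u‖ ≤
      C₂ * R / ((m : ℝ) + 1) ^ 2 * ‖α u‖ := by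
    intro m u
    by_cases hu : R < |u|
    · simp [hRz u hu]
    rw [not_lt] at hu
    rcases eq_or_ne u 0 with rfl | hu0
    · simp [hα.apply_zero]
    have hC0 : 0 ≤ C₂ := le_trans (by positivity) (hC₂ 0)
    rw [norm_mul, norm_mul, Complex.norm_real, Real.norm_eq_abs, abs_inv, abs_abs]
    refine mul_le_mul_of_nonneg_right ?_ (norm_nonneg _)
    have ht : u⁻¹ * ((m : ℝ) + 1) ≠ 0 := mul_ne_zero (inv_ne_zero hu0) (by positivity)
    have h1 := hC₂ (u⁻¹ * ((m : ℝ) + 1))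
    have hpos : 0 < (u⁻¹ * ((m : ℝ) + 1)) ^ 2 := by positivity
    have h2 : ‖Fφ (u⁻¹ * ((m : ℝ) + 1))‖ ≤ C₂ / (u⁻¹ * ((m : ℝ) + 1)) ^ 2 := by
      rw [le_div_iff₀ hpos, mul_comm]; exact h1
    have hupos : 0 < |u| := abs_pos.2 hu0
    calc |u|⁻¹ * ‖Fφ (u⁻¹ * ((m : ℝ) + 1))‖ ≤ |u|⁻¹ * (C₂ / (u⁻¹ * ((m : ℝ) + 1)) ^ 2) := by
          gcongr
      _ = C₂ * |u| / ((m : ℝ) + 1) ^ 2 := by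
          rw [mul_pow, inv_pow, ← sq_abs u]
          field_simp
      _ ≤ C₂ * R / ((m : ℝ) + 1) ^ 2 := by gcongr
  have hint : ∀ m : ℕ, Integrable fun u : ℝ ↦
      ((|u|⁻¹ : ℝ) : ℂ) * Fφ (u⁻¹ * ((m : ℝ) + 1)) * α u := fun m ↦
    ((hα.integrable.norm.const_mul (δ⁻¹ * M)).mono' (hmeas m) (Eventually.of_forall (hb1 m)))
  refine ⟨hint, ?_, ?_⟩
  · -- summable `L¹` norms
    have hs : Summable fun m : ℕ ↦ C₂ * R / ((m : ℝ) + 1) ^ 2 * ∫ u : ℝ, ‖α u‖ := by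
      have h1 := (summable_nat_add_iff 1).2 (Real.summable_one_div_nat_pow.2 one_lt_two)
      have h2 : Summable fun m : ℕ ↦ (C₂ * R * ∫ u : ℝ, ‖α u‖) * (1 / ((m : ℝ) + 1) ^ 2) := by
        refine Summable.mul_left _ ?_
        simpa [Nat.cast_succ] using h1
      refine h2.congr fun m ↦ ?_
      field_simp
    refine Summable.of_nonneg_of_le (fun m ↦ integral_nonneg fun _ ↦ norm_nonneg _)
      (fun m ↦ ?_) hs
    rw [← integral_const_mul]
    exact integral_mono_of_nonneg (Eventually.of_forall fun _ ↦ norm_nonneg _)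
      (hα.integrable.norm.const_mul _) (Eventually.of_forall (hb2 m))
  · -- the substitution `u = 1/v`
    intro m
    have hβ := hα.isTestAway_inv
    have hevenH : ∀ u : ℝ, ((|(-u)|⁻¹ : ℝ) : ℂ) * Fφ ((-u)⁻¹ * ((m : ℝ) + 1)) * α (-u) =
        ((|u|⁻¹ : ℝ) : ℂ) * Fφ (u⁻¹ * ((m : ℝ) + 1)) * α u := by
      intro u; rw [abs_neg, inv_neg, neg_mul, hFeven, hα.even]
    have hF' : Integrable fun v : ℝ ↦ Fφ (((m : ℝ) + 1) * v) * inv α v :=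
      integrable_dilate_mul hFcont hβ m
    have hevenF : ∀ v : ℝ, Fφ (((m : ℝ) + 1) * (-v)) * inv α (-v) =
        Fφ (((m : ℝ) + 1) * v) * inv α v := by
      intro v; rw [mul_neg, hFeven, hβ.even]
    rw [integral_eq_two_mul_Ioi (hint m) hevenH, integral_eq_two_mul_Ioi hF' hevenF]
    congr 1
    -- on `(0,∞)`: `∫ u⁻¹ Fφ((m+1)/u) α(u) du = ∫ Fφ((m+1)v) β(v) dv`
    have h := integral_comp_rpow_Ioi (fun v : ℝ ↦ Fφ (((m : ℝ) + 1) * v) * inv α v)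
      (p := -1) (by norm_num)
    rw [← h]
    refine setIntegral_congr_fun measurableSet_Ioi fun x hx ↦ ?_
    have hx0 : (0 : ℝ) < x := hx
    simp only [Real.rpow_neg_one]
    have hx2 : x ^ ((-1 : ℝ) - 1) = (x ^ 2)⁻¹ := by
      rw [show ((-1 : ℝ) - 1) = -2 by norm_num, Real.rpow_neg hx0.le, Real.rpow_two]
    rw [hx2, abs_neg, abs_one, one_mul, Complex.real_smul, abs_of_pos hx0,
      inv_apply_of_pos α (inv_pos.2 hx0), inv_inv]
    have hxC : (x : ℂ) ≠ 0 := by exact_mod_cast hx0.ne'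
    push_cast
    field_simp

/-- **The weak intertwining identity** (Burnol's first proof of the co-Poisson formula,
TeX l. 1163–1200): for an even Schwartz function `φ` and a smooth even `α` with compact support
away from the origin, `∫ φ · P'(α) = ∫ 𝓕φ · P'(I(α))`.
[cite: Burnol2004, proof preceding Lemma 4.1 (TeX l. 1163–1200)] -/
theorem IsTestAway.integral_mul_coSum_eq (hα : IsTestAway α) (φ : 𝓢(ℝ, ℂ))
    (he : ∀ x : ℝ, φ (-x) = φ x) :
    ∫ y : ℝ, φ y * coSum α y = ∫ y : ℝ, 𝓕 (φ : ℝ → ℂ) y * coSum (inv α) y := by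
  have hβ := hα.isTestAway_inv
  set Fφ : ℝ → ℂ := 𝓕 (φ : ℝ → ℂ) with hFφ
  have hFcont : Continuous Fφ := by
    rw [hFφ, ← SchwartzMap.fourier_coe]; exact (𝓕 φ).continuous
  have hFint : Integrable Fφ := by
    rw [hFφ, ← SchwartzMap.fourier_coe]; exact (𝓕 φ).integrable
  obtain ⟨C₁, hC₁⟩ := schwartz_sq_decay φ
  obtain ⟨C₂, hC₂⟩ := schwartz_fourier_sq_decay φ
  -- abbreviations for the constants
  set c : ℂ := ∫ v in Ioi (0 : ℝ), α v / (v : ℂ) with hc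
  set I₀ : ℂ := ∫ v in Ioi (0 : ℝ), α v with hI₀
  have hcβ : ∫ v in Ioi (0 : ℝ), inv α v / (v : ℂ) = I₀ := integral_Ioi_inv_div α
  -- Step 1: `∫ φ P'α = ∫ φ S_α - c ∫ φ`
  obtain ⟨B, -, hB⟩ := hα.exists_norm_coSum_le
  obtain ⟨B', -, hB'⟩ := hβ.exists_norm_coSum_le
  have hint1 : Integrable fun y : ℝ ↦ φ y * coSum α y :=
    φ.integrable.mul_bdd hα.continuous_coSum.aestronglyMeasurable (Eventually.of_forall hB)
  have hint2 : Integrable fun y : ℝ ↦ Fφ y * coSum (inv α) y :=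
    hFint.mul_bdd hβ.continuous_coSum.aestronglyMeasurable (Eventually.of_forall hB')
  have hS : ∀ y : ℝ, φ y * ∑' n : ℕ, α (y / ((n : ℝ) + 1)) / ((n : ℂ) + 1) =
      φ y * coSum α y + c * φ y := by
    intro y; rw [coSum]; ring
  have hSβ : ∀ y : ℝ, Fφ y * ∑' n : ℕ, inv α (y / ((n : ℝ) + 1)) / ((n : ℂ) + 1) =
      Fφ y * coSum (inv α) y + I₀ * Fφ y := by
    intro y; rw [coSum, hcβ]; ring
  have h1 : ∫ y : ℝ, φ y * ∑' n : ℕ, α (y / ((n : ℝ) + 1)) / ((n : ℂ) + 1) =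
      (∫ y : ℝ, φ y * coSum α y) + c * ∫ y : ℝ, φ y := by
    simp_rw [hS]
    rw [integral_add hint1 (φ.integrable.const_mul c), integral_const_mul]
  have h1β : ∫ y : ℝ, Fφ y * ∑' n : ℕ, inv α (y / ((n : ℝ) + 1)) / ((n : ℂ) + 1) =
      (∫ y : ℝ, Fφ y * coSum (inv α) y) + I₀ * ∫ y : ℝ, Fφ y := by
    simp_rw [hSβ]
    rw [integral_add hint2 (hFint.const_mul I₀), integral_const_mul]
  -- Step 2/3: Tonelli
  have h2 := integral_mul_tsum_eq_tsum hC₁ φ.continuous hα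
  have h3 := integral_tsum_mul_eq_tsum hC₁ φ.continuous hα
  have h2β := integral_mul_tsum_eq_tsum hC₂ hFcont hβ
  -- Step 4: Poisson pointwise, written with the family `K`
  obtain ⟨hKint, hKsum, hKeq⟩ := dual_terms hα φ he
  set A : ℝ → ℂ := fun u ↦ (-(φ 0) / 2 + ((|u|⁻¹ : ℝ) : ℂ) * Fφ 0 / 2) * α u with hA
  set H : ℕ → ℝ → ℂ := fun m u ↦ ((|u|⁻¹ : ℝ) : ℂ) * Fφ (u⁻¹ * ((m : ℝ) + 1)) * α u with hH
  set K : ℕ → ℝ → ℂ := fun k ↦ Nat.casesOn k A H with hK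
  have hK0 : K 0 = A := rfl
  have hKs : ∀ m : ℕ, K (m + 1) = H m := fun m ↦ rfl
  have hHsum : ∀ u : ℝ, Summable fun m : ℕ ↦ H m u := by
    intro u
    rcases eq_or_ne u 0 with rfl | hu0
    · simp only [hH, hα.apply_zero, mul_zero]; exact summable_zero
    · simp only [hH]
      exact ((summable_mul_succ_of_sq_decay hC₂ (inv_ne_zero hu0)).mul_left _).mul_right _
  have hTot : ∀ u : ℝ, (∑' n : ℕ, φ (((n : ℝ) + 1) * u)) * α u = ∑' k : ℕ, K k u := by
    intro u
    have hKu : Summable fun k : ℕ ↦ K k u := by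
      rw [← summable_nat_add_iff 1]; simpa only [hKs] using hHsum u
    rw [hKu.tsum_eq_zero_add]
    simp only [hK0, hKs]
    rcases eq_or_ne u 0 with rfl | hu0
    · simp [hA, hH, hα.apply_zero]
    · rw [tsum_dilate_eq φ he hu0]
      simp only [hA, hH]
      rw [tsum_mul_right, tsum_mul_left]
      simp only [← hFφ]
      ring
  -- Step 5: integrate termwise over `K`
  have hAint : Integrable A := by
    have h1 : Integrable fun u : ℝ ↦ ((|u|⁻¹ : ℝ) : ℂ) * α u := integrable_abs_inv_mul hα
    have : A = fun u ↦ (-(φ 0) / 2) * α u + (Fφ 0 / 2) * (((|u|⁻¹ : ℝ) : ℂ) * α u) := by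
      funext u; simp only [hA]; ring
    rw [this]
    exact (hα.integrable.const_mul _).add (h1.const_mul _)
  have hKint' : ∀ k : ℕ, Integrable (K k) := by
    intro k; cases k with
    | zero => exact hAint
    | succ m => exact hKint m
  have hKsum' : Summable fun k : ℕ ↦ ∫ u : ℝ, ‖K k u‖ := by
    rw [← summable_nat_add_iff 1]; simpa only [hKs] using hKsum
  have h5 : ∫ u : ℝ, (∑' n : ℕ, φ (((n : ℝ) + 1) * u)) * α u =
      (∫ u : ℝ, A u) + ∑' m : ℕ, ∫ u : ℝ, H m u := by
    simp_rw [hTot]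
    rw [← integral_tsum_of_summable_integral_norm hKint' hKsum']
    have hs : Summable fun k : ℕ ↦ ∫ u : ℝ, K k u :=
      hKsum'.of_norm_bounded fun k ↦ norm_integral_le_integral_norm _
    rw [hs.tsum_eq_zero_add]
    simp only [hK0, hKs]
  -- Step 6: `∫ A`
  have h6 : ∫ u : ℝ, A u = -(φ 0) * I₀ + Fφ 0 * c := by
    have h1 : Integrable fun u : ℝ ↦ ((|u|⁻¹ : ℝ) : ℂ) * α u := integrable_abs_inv_mul hα
    have : A = fun u ↦ (-(φ 0) / 2) * α u + (Fφ 0 / 2) * (((|u|⁻¹ : ℝ) : ℂ) * α u) := by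
      funext u; simp only [hA]; ring
    rw [this, integral_add (hα.integrable.const_mul _) (h1.const_mul _), integral_const_mul,
      integral_const_mul, integral_eq_two hα, integral_abs_inv_mul hα]
    ring
  -- Step 7: `Σ ∫ H_m = ∫ 𝓕φ S_β`
  have h7 : ∑' m : ℕ, ∫ u : ℝ, H m u =
      ∫ y : ℝ, Fφ y * ∑' n : ℕ, inv α (y / ((n : ℝ) + 1)) / ((n : ℂ) + 1) := by
    rw [h2β]; exact tsum_congr hKeq
  -- Step 8: `∫ 𝓕φ = φ 0`
  have h8 : ∫ y : ℝ, Fφ y = φ 0 := by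
    have hinv := Continuous.fourierInv_fourier_eq φ.continuous φ.integrable hFint
    have := congrFun hinv 0
    rw [Real.fourierInv_eq_fourier_neg, neg_zero, fourier_apply_zero] at this
    exact this
  have h9 : ∫ y : ℝ, (φ : ℝ → ℂ) y = Fφ 0 := (fourier_apply_zero _).symm
  -- assemble
  rw [← sub_eq_zero]
  have eq1 : ∫ y : ℝ, φ y * coSum α y =
      (∫ y : ℝ, φ y * ∑' n : ℕ, α (y / ((n : ℝ) + 1)) / ((n : ℂ) + 1)) - c * Fφ 0 := by
    rw [h1, h9]; ring
  have eq2 : ∫ y : ℝ, Fφ y * coSum (inv α) y =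
      (∫ y : ℝ, Fφ y * ∑' n : ℕ, inv α (y / ((n : ℝ) + 1)) / ((n : ℂ) + 1)) - I₀ * φ 0 := by
    rw [h1β, h8]; ring
  rw [eq1, eq2, h2, ← h3, h5, h6, h7]
  ring

end weak

/-! ## H. Theorem 4.4: `𝓕(P'(α)) = P'(I(α))` -/

section thm44

variable {α : ℝ → ℂ}

/-- Symmetrisation of a real test function against an even function:
`∫ g•F = ∫ g_e•F`, `g_e(x) = (g(x)+g(−x))/2`. [folklore] -/
private theorem integral_smul_eq_symm {F : ℝ → ℂ} (hF : Continuous F) (hFe : ∀ x, F (-x) = F x)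
    {g : ℝ → ℝ} (hg : Continuous g) (hgs : HasCompactSupport g) :
    ∫ x : ℝ, g x • F x = ∫ x : ℝ, (((g x + g (-x)) / 2 : ℝ) : ℂ) * F x := by
  have hi1 : Integrable fun x : ℝ ↦ g x • F x :=
    ((hg.smul hF).integrable_of_hasCompactSupport hgs.smul_right)
  have hi2 : Integrable fun x : ℝ ↦ g (-x) • F x := by
    have h := (hg.comp continuous_neg).smul hF
    refine h.integrable_of_hasCompactSupport ?_
    exact (hgs.comp_homeomorph (Homeomorph.neg ℝ)).smul_right
  have hneg : ∫ x : ℝ, g (-x) • F x = ∫ x : ℝ, g x • F x := by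
    have := integral_neg_eq_self (fun x : ℝ ↦ g x • F x) volume
    simp only [hFe] at this
    exact this
  have e : (fun x : ℝ ↦ (((g x + g (-x)) / 2 : ℝ) : ℂ) * F x) =
      fun x : ℝ ↦ (1 / 2 : ℂ) * (g x • F x) + (1 / 2 : ℂ) * (g (-x) • F x) := by
    funext x
    simp only [Complex.real_smul]
    push_cast
    ring
  rw [e, integral_add (hi1.const_mul _) (hi2.const_mul _), integral_const_mul, integral_const_mul,
    hneg]
  ring

/-- `𝓕(𝓕ψ) = ψ` for an even Schwartz function. [folklore] -/
private theorem fourier_fourier_of_even (ψ : 𝓢(ℝ, ℂ)) (he : ∀ x : ℝ, ψ (-x) = ψ x) (w : ℝ) :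
    𝓕 (𝓕 (ψ : ℝ → ℂ)) w = ψ w := by
  have hFint : Integrable (𝓕 (ψ : ℝ → ℂ)) := by
    rw [← SchwartzMap.fourier_coe]; exact (𝓕 ψ).integrable
  have hinv := Continuous.fourierInv_fourier_eq ψ.continuous ψ.integrable hFint
  have h1 : 𝓕 (𝓕 (ψ : ℝ → ℂ)) w = 𝓕⁻ (𝓕 (ψ : ℝ → ℂ)) (-w) := by
    rw [Real.fourierInv_eq_fourier_neg, neg_neg]
  rw [h1, hinv, he]

/-- **Proof of Burnol 2004, Theorem 4.4** — the co-Poisson intertwining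
`𝓕(P'(α)) = P'(I(α))` for `α` smooth, even, compactly supported away from the origin.
The proof is Burnol's first (distributional) proof, TeX l. 1163–1200: the weak identity
`IsTestAway.integral_mul_coSum_eq` against even Schwartz functions, self-adjointness of `𝓕`,
and the passage from distributional to pointwise equality for the two continuous functions
`𝓕(P'(α))` (`P'(α) ∈ L¹`) and `P'(I(α))`. Discharges
`Literature.NumberTheory.LFunctions.Burnol2004_thm_4_4`. [cite: Burnol2004, Thm 4.4 (TeX l. 1287)] -/
theorem _root_.Literature.NumberTheory.LFunctions.Burnol2004_thm_4_4_holds :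
    Burnol2004_thm_4_4 := by
  intro α hα
  have hβ := hα.isTestAway_inv
  have hFint := hα.integrable_coSum
  set F : ℝ → ℂ := 𝓕 (coSum α) with hF
  set G : ℝ → ℂ := coSum (inv α) with hG
  have hFcont : Continuous F := Literature.Analysis.FunctionSpaces.continuous_fourierIntegral hFint
  have hGcont : Continuous G := hβ.continuous_coSum
  have hFe : ∀ w : ℝ, F (-w) = F w := fourier_neg_of_even (coSum_neg hα.even)
  have hGe : ∀ w : ℝ, G (-w) = G w := coSum_neg hβ.even
  refine (Continuous.ae_eq_iff_eq (μ := volume) hFcont hGcont).1 ?_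
  refine ae_eq_of_integral_contDiff_smul_eq hFcont.locallyIntegrable hGcont.locallyIntegrable
    fun g hg hgs ↦ ?_
  -- symmetrise the real test function and view it as an even Schwartz function
  set ge : ℝ → ℂ := fun x ↦ (((g x + g (-x)) / 2 : ℝ) : ℂ) with hge
  have hge_smooth : ContDiff ℝ ∞ ge := by
    have h1 : ContDiff ℝ ∞ fun x : ℝ ↦ (g x + g (-x)) / 2 :=
      (hg.add (hg.comp contDiff_neg)).div_const _
    exact (Complex.ofRealCLM.contDiff).comp h1
  have hge_supp : HasCompactSupport ge := by
    have h1 : HasCompactSupport fun x : ℝ ↦ g x + g (-x) :=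
      hgs.add (hgs.comp_homeomorph (Homeomorph.neg ℝ))
    have h2 : HasCompactSupport fun x : ℝ ↦ (g x + g (-x)) / 2 := by
      refine h1.mono ?_
      intro x hx
      rw [Function.mem_support] at hx ⊢
      contrapose! hx
      simp [hx]
    exact h2.comp_left Complex.ofReal_zero
  set ψ : 𝓢(ℝ, ℂ) := hge_supp.toSchwartzMap hge_smooth with hψ
  have hψapply : ∀ x : ℝ, ψ x = ge x := fun x ↦ rfl
  have hψe : ∀ x : ℝ, ψ (-x) = ψ x := by
    intro x; simp only [hψapply, hge, neg_neg]; ring_nf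
  -- `𝓕ψ` as an even Schwartz function
  set Φ : 𝓢(ℝ, ℂ) := 𝓕 ψ with hΦ
  have hΦapply : ∀ y : ℝ, Φ y = 𝓕 (ψ : ℝ → ℂ) y := fun y ↦ congrFun (SchwartzMap.fourier_coe ψ) y
  have hΦe : ∀ y : ℝ, Φ (-y) = Φ y := by
    intro y; rw [hΦapply, hΦapply]; exact fourier_neg_of_even hψe y
  -- the chain of equalities
  calc ∫ x : ℝ, g x • F x = ∫ x : ℝ, ge x * F x := integral_smul_eq_symm hFcont hFe hg.continuous hgs
    _ = ∫ x : ℝ, ψ x • 𝓕 (coSum α) x := by simp only [hψapply, smul_eq_mul, hF]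
    _ = ∫ x : ℝ, 𝓕 (ψ : ℝ → ℂ) x • coSum α x :=
        (Literature.Analysis.FunctionSpaces.integral_fourier_schwartz_smul_eq ψ hFint).symm
    _ = ∫ x : ℝ, Φ x * coSum α x := by simp only [hΦapply, smul_eq_mul]
    _ = ∫ x : ℝ, 𝓕 (Φ : ℝ → ℂ) x * coSum (inv α) x := hα.integral_mul_coSum_eq Φ hΦe
    _ = ∫ x : ℝ, ψ x * G x := by
        congr 1; funext x
        rw [hG]
        congr 1
        have : (Φ : ℝ → ℂ) = 𝓕 (ψ : ℝ → ℂ) := SchwartzMap.fourier_coe ψ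
        rw [this]
        exact fourier_fourier_of_even ψ hψe x
    _ = ∫ x : ℝ, ge x * G x := by simp only [hψapply]
    _ = ∫ x : ℝ, g x • G x := (integral_smul_eq_symm hGcont hGe hg.continuous hgs).symm

end thm44

/-! ## I. Theorem 4.2: the co-Poisson intertwining as tempered distributions, for measurable
`g` with `∫₀^∞ |g(t)| dt/t + ∫₀^∞ |g(t)| dt < ∞` (TeX l. 1235–1285)

The printed proof applies `∫` against `φ` and `𝓕φ` and uses "Everything is absolutely
convergent" (TeX l. 1283). We follow the route of Part G with the absolute-convergence
bookkeeping redone for this class: the dilation-sum bound `Σ_{n≥1} |ψ(nu)| ≤ (M+C)/|u| + M`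
(`ψ` bounded by `M` with `t²|ψ(t)| ≤ C`) replaces the compact-support arguments, the class is
stable under `I`, and the identity for a general Schwartz `φ` is reduced to the even part of `φ`. -/

section measurable

variable {g ψ : ℝ → ℂ} {C M : ℝ}

/-- A countable sum of a.e.-measurable `ℝ≥0∞`-valued functions is a.e.-measurable. [folklore] -/
private theorem aemeasurable_ennreal_tsum {f : ℕ → ℝ → ENNReal}
    (h : ∀ i, AEMeasurable (f i) volume) : AEMeasurable (fun x ↦ ∑' i, f i x) volume := by
  simp_rw [ENNReal.tsum_eq_iSup_sum]
  exact AEMeasurable.iSup fun s ↦ Finset.aemeasurable_fun_sum s fun i _ ↦ h i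

/-- Integrability of an `L¹`-absolutely summable series of integrable functions. [folklore] -/
private theorem integrable_tsum_of_summable_integral_norm {F : ℕ → ℝ → ℂ}
    (hF_int : ∀ i, Integrable (F i)) (hF_sum : Summable fun i ↦ ∫ a, ‖F i a‖) :
    Integrable (fun a ↦ ∑' i, F i a) := by
  have h1 : ∀ i, ∫⁻ a, ‖F i a‖ₑ = ENNReal.ofReal (∫ a, ‖F i a‖) := fun i ↦
    (ofReal_integral_norm_eq_lintegral_enorm (hF_int i)).symm
  have h2 : ∑' i, ∫⁻ a, ‖F i a‖ₑ ≠ ⊤ := by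
    simp_rw [h1]
    rw [← ENNReal.ofReal_tsum_of_nonneg (fun i ↦ integral_nonneg fun a ↦ norm_nonneg _) hF_sum]
    exact ENNReal.ofReal_ne_top
  have hmeas : ∀ i, AEMeasurable (fun a ↦ ‖F i a‖ₑ) volume := fun i ↦ (hF_int i).1.enorm
  have hmeas' : AEMeasurable (fun a ↦ ∑' i, ‖F i a‖ₑ) volume := aemeasurable_ennreal_tsum hmeas
  have h3 : ∫⁻ a, ∑' i, ‖F i a‖ₑ ≠ ⊤ := by rwa [lintegral_tsum hmeas]
  -- a.e. absolute summability
  have h4 : ∀ᵐ a : ℝ, Summable fun i ↦ ‖F i a‖ := by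
    filter_upwards [ae_lt_top' hmeas' h3] with a ha
    have h : ∑' i, (‖F i a‖₊ : ENNReal) ≠ ⊤ := ha.ne
    rw [ENNReal.tsum_coe_ne_top_iff_summable] at h
    exact NNReal.summable_coe.2 h
  -- measurability of the sum (a.e. limit of the partial sums)
  have h5 : AEStronglyMeasurable (fun a ↦ ∑' i, F i a) volume := by
    refine aestronglyMeasurable_of_tendsto_ae atTop
      (fun n ↦ Finset.aestronglyMeasurable_fun_sum (Finset.range n) fun i _ ↦ (hF_int i).1) ?_
    filter_upwards [h4] with a ha
    exact (Summable.of_norm ha).hasSum.tendsto_sum_nat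
  -- the dominating function
  have h6 : Integrable (fun a ↦ (∑' i, ‖F i a‖ₑ).toReal) :=
    integrable_toReal_of_lintegral_ne_top hmeas' h3
  refine h6.mono' h5 ?_
  filter_upwards [h4] with a ha
  have hne : ∀ i, (‖F i a‖ₑ : ENNReal) ≠ ⊤ := fun i ↦ enorm_ne_top
  rw [ENNReal.tsum_toReal_eq hne]
  simp only [toReal_enorm]
  exact norm_tsum_le_tsum_norm ha

/-- A telescoping bound: `Σ_{i<K} 1/((i+N)(i+N+1)) ≤ 1/N` for `N ≥ 1`. [folklore] -/
private theorem sum_range_telescope_le {N : ℕ} (hN : 1 ≤ N) (K : ℕ) :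
    ∑ i ∈ Finset.range K, (1 / (((i : ℝ) + N) * ((i : ℝ) + N + 1))) ≤ 1 / (N : ℝ) := by
  have hN0 : (0 : ℝ) < N := by exact_mod_cast hN
  have e : ∀ i ∈ Finset.range K, (1 / (((i : ℝ) + N) * ((i : ℝ) + N + 1))) =
      1 / ((i : ℝ) + N) - 1 / (((i + 1 : ℕ) : ℝ) + N) := by
    intro i _
    have h1 : (0 : ℝ) < (i : ℝ) + N := by positivity
    push_cast
    field_simp
    ring
  rw [Finset.sum_congr rfl e, Finset.sum_range_sub' (f := fun i : ℕ ↦ 1 / ((i : ℝ) + N))]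
  simp only [Nat.cast_zero, zero_add]
  have : 0 ≤ 1 / ((K : ℝ) + N) := by positivity
  linarith

/-- **Dilation sums of a bounded function with quadratic decay**: if `‖ψ‖ ≤ M` and
`t²‖ψ(t)‖ ≤ C` then for `u ≠ 0` the series `Σ_{n≥1} ‖ψ(nu)‖` converges and is at most
`(M + C)/|u| + M` (count the `n ≤ 1/|u|` with the sup bound, the others with the decay).
[folklore] -/
private theorem tsum_norm_dilate_le (hM : ∀ t, ‖ψ t‖ ≤ M) (hC : ∀ t : ℝ, t ^ 2 * ‖ψ t‖ ≤ C)
    {u : ℝ} (hu : u ≠ 0) :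
    Summable (fun n : ℕ ↦ ‖ψ (((n : ℝ) + 1) * u)‖) ∧
      ∑' n : ℕ, ‖ψ (((n : ℝ) + 1) * u)‖ ≤ (M + C) / |u| + M := by
  have hx : 0 < |u| := abs_pos.2 hu
  have hM0 : 0 ≤ M := le_trans (norm_nonneg _) (hM 0)
  have hC0 : 0 ≤ C := le_trans (by positivity) (hC 0)
  -- termwise decay bound
  have hdec : ∀ n : ℕ, ‖ψ (((n : ℝ) + 1) * u)‖ ≤ C / (((n : ℝ) + 1) ^ 2 * |u| ^ 2) :=
    fun n ↦ norm_dilate_le hC hx le_rfl n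
  have hs : Summable fun n : ℕ ↦ ‖ψ (((n : ℝ) + 1) * u)‖ := by
    have h1 := (summable_nat_add_iff 1).2 (Real.summable_one_div_nat_pow.2 one_lt_two)
    have h2 : Summable fun n : ℕ ↦ C / |u| ^ 2 * (1 / ((n : ℝ) + 1) ^ 2) := by
      refine Summable.mul_left _ ?_
      simpa [Nat.cast_succ] using h1
    refine Summable.of_nonneg_of_le (fun n ↦ norm_nonneg _) (fun n ↦ (hdec n).trans_eq ?_) h2
    field_simp
  refine ⟨hs, ?_⟩
  -- split at `N = ⌈1/|u|⌉`
  set N : ℕ := ⌈|u|⁻¹⌉₊ with hN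
  have hN1 : 1 ≤ N := Nat.one_le_iff_ne_zero.2 (by rw [hN]; exact (Nat.ceil_pos.2 (inv_pos.2 hx)).ne')
  have hNge : |u|⁻¹ ≤ (N : ℝ) := Nat.le_ceil _
  have hNlt : (N : ℝ) < |u|⁻¹ + 1 := Nat.ceil_lt_add_one (inv_pos.2 hx).le
  rw [← hs.sum_add_tsum_nat_add N]
  -- head
  have hhead : ∑ i ∈ Finset.range N, ‖ψ (((i : ℝ) + 1) * u)‖ ≤ M / |u| + M := by
    calc ∑ i ∈ Finset.range N, ‖ψ (((i : ℝ) + 1) * u)‖ ≤ ∑ i ∈ Finset.range N, M :=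
          Finset.sum_le_sum fun i _ ↦ hM _
      _ = (N : ℝ) * M := by rw [Finset.sum_const, Finset.card_range, nsmul_eq_mul]
      _ ≤ (|u|⁻¹ + 1) * M := by gcongr
      _ = M / |u| + M := by ring
  -- tail
  have htail : ∑' i : ℕ, ‖ψ ((((i + N : ℕ) : ℝ) + 1) * u)‖ ≤ C / |u| := by
    have hN0 : (0 : ℝ) < N := by exact_mod_cast hN1
    have hterm : ∀ i : ℕ, ‖ψ ((((i + N : ℕ) : ℝ) + 1) * u)‖ ≤
        C / |u| ^ 2 * (1 / (((i : ℝ) + N) * ((i : ℝ) + N + 1))) := by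
      intro i
      refine (hdec (i + N)).trans ?_
      have h1 : (0 : ℝ) < (i : ℝ) + N := by positivity
      rw [mul_one_div, div_div]
      push_cast
      refine div_le_div_of_nonneg_left hC0 (by positivity) ?_
      have h2 : ((i : ℝ) + N) * ((i : ℝ) + N + 1) ≤ ((i : ℝ) + N + 1) ^ 2 := by nlinarith
      calc |u| ^ 2 * (((i : ℝ) + N) * ((i : ℝ) + N + 1)) ≤ |u| ^ 2 * ((i : ℝ) + N + 1) ^ 2 := by
            gcongr
        _ = ((i : ℝ) + N + 1) ^ 2 * |u| ^ 2 := by ring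
    have hbound : ∀ K : ℕ, ∑ i ∈ Finset.range K, ‖ψ ((((i + N : ℕ) : ℝ) + 1) * u)‖ ≤
        C / |u| ^ 2 * (1 / (N : ℝ)) := by
      intro K
      calc ∑ i ∈ Finset.range K, ‖ψ ((((i + N : ℕ) : ℝ) + 1) * u)‖
          ≤ ∑ i ∈ Finset.range K, C / |u| ^ 2 * (1 / (((i : ℝ) + N) * ((i : ℝ) + N + 1))) :=
            Finset.sum_le_sum fun i _ ↦ hterm i
        _ = C / |u| ^ 2 * ∑ i ∈ Finset.range K, (1 / (((i : ℝ) + N) * ((i : ℝ) + N + 1))) := by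
            rw [Finset.mul_sum]
        _ ≤ C / |u| ^ 2 * (1 / (N : ℝ)) := by
            gcongr
            exact sum_range_telescope_le hN1 K
    refine (Real.tsum_le_of_sum_range_le (fun i ↦ norm_nonneg _) hbound).trans ?_
    -- `C/(|u|² N) ≤ C/|u|` from `N ≥ 1/|u|`
    have hinv : 1 / (N : ℝ) ≤ |u| := by
      rw [one_div]; exact inv_le_of_inv_le₀ hx hNge
    calc C / |u| ^ 2 * (1 / (N : ℝ)) ≤ C / |u| ^ 2 * |u| := by gcongr
      _ = C / |u| := by field_simp
  calc ∑ i ∈ Finset.range N, ‖ψ (((i : ℝ) + 1) * u)‖ + ∑' i : ℕ, ‖ψ ((((i + N : ℕ) : ℝ) + 1) * u)‖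
      ≤ (M / |u| + M) + C / |u| := add_le_add hhead htail
    _ = (M + C) / |u| + M := by ring

/-- From a pointwise-summable family with an integrable majorant of the sum of norms to the
summability of the `L¹` norms (Tonelli). [folklore] -/
private theorem summable_integral_norm_of_le {T : ℕ → ℝ → ℂ} {B : ℝ → ℝ}
    (hT : ∀ n, AEStronglyMeasurable (T n) volume) (hB : Integrable B)
    (hle : ∀ᵐ u : ℝ, (Summable fun n ↦ ‖T n u‖) ∧ ∑' n, ‖T n u‖ ≤ B u) :
    Summable fun n ↦ ∫ u, ‖T n u‖ := by
  have hmeas : ∀ n, AEMeasurable (fun u ↦ ‖T n u‖ₑ) volume := fun n ↦ (hT n).enorm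
  have h1 : ∑' n, ∫⁻ u, ‖T n u‖ₑ ≠ ⊤ := by
    rw [← lintegral_tsum hmeas]
    refine ne_top_of_le_ne_top hB.2.ne ?_
    refine lintegral_mono_ae ?_
    filter_upwards [hle] with u hu
    have e : ∑' n, (‖T n u‖ₑ : ENNReal) = ENNReal.ofReal (∑' n, ‖T n u‖) := by
      rw [ENNReal.ofReal_tsum_of_nonneg (fun n ↦ norm_nonneg _) hu.1]
      simp only [ofReal_norm]
    rw [e, Real.enorm_eq_ofReal (le_trans (tsum_nonneg fun n ↦ norm_nonneg _) hu.2)]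
    exact ENNReal.ofReal_le_ofReal hu.2
  have h2 : ∀ n, ∫ u, ‖T n u‖ = (∫⁻ u, ‖T n u‖ₑ).toReal := fun n ↦
    integral_norm_eq_lintegral_enorm (hT n)
  simp_rw [h2]
  exact ENNReal.summable_toReal h1

/-- The dilated products `u ↦ ψ((n+1)u) g(u)` (`ψ` continuous and bounded, `g ∈ L¹`) are
integrable. [folklore] -/
private theorem integrable_dilate_mul' (hψ : Continuous ψ) (hM : ∀ t, ‖ψ t‖ ≤ M)
    (hgi : Integrable g) (n : ℕ) :
    Integrable fun u : ℝ ↦ ψ (((n : ℝ) + 1) * u) * g u :=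
  hgi.bdd_mul (hψ.comp (continuous_const.mul continuous_id)).aestronglyMeasurable
    (Eventually.of_forall fun _ ↦ hM _)

/-- `Σ_n ∫ ‖ψ((n+1)u) g(u)‖ du < ∞` for `g ∈ L¹(du) ∩ L¹(du/|u|)`. [folklore] -/
private theorem summable_integral_norm_dilate_mul' (hψ : Continuous ψ) (hM : ∀ t, ‖ψ t‖ ≤ M)
    (hC : ∀ t : ℝ, t ^ 2 * ‖ψ t‖ ≤ C) (hgi : Integrable g)
    (hgi' : Integrable fun u : ℝ ↦ ((|u|⁻¹ : ℝ) : ℂ) * g u) :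
    Summable fun n : ℕ ↦ ∫ u : ℝ, ‖ψ (((n : ℝ) + 1) * u) * g u‖ := by
  have hT : ∀ n : ℕ, AEStronglyMeasurable (fun u : ℝ ↦ ψ (((n : ℝ) + 1) * u) * g u) volume :=
    fun n ↦ (integrable_dilate_mul' hψ hM hgi n).1
  -- majorant `((M+C)|u|⁻¹ + M) ‖g u‖`
  have hB : Integrable fun u : ℝ ↦ ((M + C) * |u|⁻¹ + M) * ‖g u‖ := by
    have h1 : Integrable fun u : ℝ ↦ |u|⁻¹ * ‖g u‖ := by
      refine hgi'.norm.congr (Eventually.of_forall fun u ↦ ?_)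
      simp only [norm_mul, Complex.norm_real, Real.norm_eq_abs, abs_inv, abs_abs]
    have e : (fun u : ℝ ↦ ((M + C) * |u|⁻¹ + M) * ‖g u‖) =
        fun u ↦ (M + C) * (|u|⁻¹ * ‖g u‖) + M * ‖g u‖ := by
      funext u; ring
    rw [e]
    exact (h1.const_mul _).add (hgi.norm.const_mul _)
  refine summable_integral_norm_of_le hT hB ?_
  have hae : ∀ᵐ u : ℝ, u ≠ 0 := by
    rw [ae_iff]; simp
  filter_upwards [hae] with u hu
  obtain ⟨hs, hle⟩ := tsum_norm_dilate_le hM hC hu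
  refine ⟨(hs.mul_right ‖g u‖).congr fun n ↦ (norm_mul _ _).symm, ?_⟩
  calc ∑' n : ℕ, ‖ψ (((n : ℝ) + 1) * u) * g u‖ = (∑' n : ℕ, ‖ψ (((n : ℝ) + 1) * u)‖) * ‖g u‖ := by
        rw [← tsum_mul_right]; exact tsum_congr fun n ↦ norm_mul _ _
    _ ≤ ((M + C) / |u| + M) * ‖g u‖ := mul_le_mul_of_nonneg_right hle (norm_nonneg _)
    _ = ((M + C) * |u|⁻¹ + M) * ‖g u‖ := by rw [div_eq_mul_inv]

/-- **Tonelli, left form** for `g ∈ L¹(du) ∩ L¹(du/|u|)`: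
`∫ ψ(y) S_g(y) dy = Σ_n ∫ ψ((n+1)u) g(u) du`, together with the integrability of
`y ↦ ψ(y) S_g(y)`. [folklore] -/
private theorem integral_mul_tsum_eq_tsum' (hψ : Continuous ψ) (hM : ∀ t, ‖ψ t‖ ≤ M)
    (hC : ∀ t : ℝ, t ^ 2 * ‖ψ t‖ ≤ C) (hgi : Integrable g)
    (hgi' : Integrable fun u : ℝ ↦ ((|u|⁻¹ : ℝ) : ℂ) * g u) :
    Integrable (fun y : ℝ ↦ ψ y * ∑' n : ℕ, g (y / ((n : ℝ) + 1)) / ((n : ℂ) + 1)) ∧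
    ∫ y : ℝ, ψ y * ∑' n : ℕ, g (y / ((n : ℝ) + 1)) / ((n : ℂ) + 1) =
      ∑' n : ℕ, ∫ u : ℝ, ψ (((n : ℝ) + 1) * u) * g u := by
  have hint : ∀ n : ℕ, Integrable fun y : ℝ ↦ ψ y * (g (y / ((n : ℝ) + 1)) / ((n : ℂ) + 1)) := by
    intro n
    have hn1 : ((n : ℝ) + 1) ≠ 0 := by positivity
    have h1 : Integrable fun y : ℝ ↦ g (y / ((n : ℝ) + 1)) / ((n : ℂ) + 1) :=
      (hgi.comp_div hn1).div_const _
    exact h1.bdd_mul hψ.aestronglyMeasurable (Eventually.of_forall fun y ↦ hM _)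
  have hsum : Summable fun n : ℕ ↦ ∫ y : ℝ, ‖ψ y * (g (y / ((n : ℝ) + 1)) / ((n : ℂ) + 1))‖ := by
    simp_rw [integral_norm_mul_term_eq]
    exact summable_integral_norm_dilate_mul' hψ hM hC hgi hgi'
  have e : (fun y : ℝ ↦ ψ y * ∑' n : ℕ, g (y / ((n : ℝ) + 1)) / ((n : ℂ) + 1)) =
      fun y : ℝ ↦ ∑' n : ℕ, ψ y * (g (y / ((n : ℝ) + 1)) / ((n : ℂ) + 1)) := by
    funext y; rw [tsum_mul_left]
  rw [e]
  refine ⟨integrable_tsum_of_summable_integral_norm hint hsum, ?_⟩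
  have h := integral_tsum_of_summable_integral_norm hint hsum
  simp_rw [integral_mul_term_eq] at h
  exact h.symm

/-- **Tonelli, right form**: `∫ (Σ_n ψ((n+1)u)) g(u) du = Σ_n ∫ ψ((n+1)u) g(u) du`.
[folklore] -/
private theorem integral_tsum_mul_eq_tsum' (hψ : Continuous ψ) (hM : ∀ t, ‖ψ t‖ ≤ M)
    (hC : ∀ t : ℝ, t ^ 2 * ‖ψ t‖ ≤ C) (hgi : Integrable g)
    (hgi' : Integrable fun u : ℝ ↦ ((|u|⁻¹ : ℝ) : ℂ) * g u) :
    ∫ u : ℝ, (∑' n : ℕ, ψ (((n : ℝ) + 1) * u)) * g u =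
      ∑' n : ℕ, ∫ u : ℝ, ψ (((n : ℝ) + 1) * u) * g u := by
  have e : (fun u : ℝ ↦ (∑' n : ℕ, ψ (((n : ℝ) + 1) * u)) * g u) =
      fun u : ℝ ↦ ∑' n : ℕ, ψ (((n : ℝ) + 1) * u) * g u := by
    funext u; rw [tsum_mul_right]
  rw [e]
  exact (integral_tsum_of_summable_integral_norm (integrable_dilate_mul' hψ hM hgi)
    (summable_integral_norm_dilate_mul' hψ hM hC hgi hgi')).symm

/-! ### The class `L¹(du) ∩ L¹(du/|u|)` of even measurable functions and its stability under `I` -/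

/-- An even function integrable on `(0,∞)` is integrable. [folklore] -/
private theorem integrable_of_even {f : ℝ → ℂ} (hf : IntegrableOn f (Ioi 0)) (he : ∀ u, f (-u) = f u) :
    Integrable f := by
  have hneg : IntegrableOn f (Iio 0) := by
    have h := (Measure.measurePreserving_neg (volume : Measure ℝ)).integrableOn_comp_preimage
      (Homeomorph.neg ℝ).measurableEmbedding (f := f) (s := Ioi 0)
    have e1 : (f ∘ Neg.neg) = f := funext fun u ↦ he u
    have e2 : (Neg.neg ⁻¹' Ioi (0 : ℝ)) = Iio 0 := by
      ext x; simp
    rw [e1, e2] at h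
    exact h.2 hf
  have hIic : IntegrableOn f (Iic 0) :=
    (integrableOn_Iic_iff_integrableOn_Iio' (μ := volume) (f := f) (b := (0 : ℝ))
      (by rw [Real.volume_singleton]; exact ENNReal.zero_ne_top) enorm_ne_top).2 hneg
  rw [← integrableOn_univ, ← Iic_union_Ioi (a := (0 : ℝ))]
  exact hIic.union hf

/-- `u ↦ |u|⁻¹ g(u)` is integrable when `∫₀^∞ |g| du/u < ∞` and `g` is even. [folklore] -/
private theorem integrable_abs_inv_mul' (hge : ∀ u, g (-u) = g u)
    (hg1 : IntegrableOn (fun u : ℝ ↦ g u / (u : ℂ)) (Ioi 0)) :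
    Integrable fun u : ℝ ↦ ((|u|⁻¹ : ℝ) : ℂ) * g u := by
  refine integrable_of_even ?_ (fun u ↦ by rw [abs_neg, hge])
  refine hg1.congr_fun (fun u hu ↦ ?_) measurableSet_Ioi
  have hu0 : (0 : ℝ) < u := hu
  simp only [abs_of_pos hu0, Complex.ofReal_inv, div_eq_inv_mul]

/-- `inv g` is measurable. [folklore] -/
private theorem measurable_inv' (hgm : Measurable g) : Measurable (inv g) := by
  unfold inv
  exact (hgm.comp measurable_inv).div (Complex.measurable_ofReal.comp continuous_abs.measurable)

/-- `I` is `(0,∞)`-integrability–exchanging: `∫₀^∞ |Ig| < ∞ ⟺ ∫₀^∞ |g| du/u < ∞`. [folklore] -/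
private theorem integrableOn_inv_Ioi (hg1 : IntegrableOn (fun u : ℝ ↦ g u / (u : ℂ)) (Ioi 0)) :
    IntegrableOn (inv g) (Ioi 0) := by
  have h := (integrableOn_Ioi_comp_rpow_iff' (fun v : ℝ ↦ g v / (v : ℂ)) (p := -1)
    (by norm_num)).2 hg1
  refine h.congr_fun (fun x hx ↦ ?_) measurableSet_Ioi
  have hx0 : (0 : ℝ) < x := hx
  have hx2 : x ^ ((-1 : ℝ) - 1) = (x ^ 2)⁻¹ := by
    rw [show ((-1 : ℝ) - 1) = -2 by norm_num, Real.rpow_neg hx0.le, Real.rpow_two]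
  simp only [Real.rpow_neg_one, hx2, Complex.real_smul, inv_apply_of_pos g hx0]
  have hxC : (x : ℂ) ≠ 0 := by exact_mod_cast hx0.ne'
  push_cast
  field_simp

/-- `∫₀^∞ |Ig(u)| du/u < ∞ ⟸ ∫₀^∞ |g| < ∞`. [folklore] -/
private theorem integrableOn_inv_div_Ioi (hg2 : IntegrableOn g (Ioi 0)) :
    IntegrableOn (fun u : ℝ ↦ inv g u / (u : ℂ)) (Ioi 0) := by
  have h := (integrableOn_Ioi_comp_rpow_iff' g (p := -1) (by norm_num)).2 hg2
  refine h.congr_fun (fun x hx ↦ ?_) measurableSet_Ioi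
  have hx0 : (0 : ℝ) < x := hx
  have hx2 : x ^ ((-1 : ℝ) - 1) = (x ^ 2)⁻¹ := by
    rw [show ((-1 : ℝ) - 1) = -2 by norm_num, Real.rpow_neg hx0.le, Real.rpow_two]
  simp only [Real.rpow_neg_one, hx2, Complex.real_smul, inv_apply_of_pos g hx0]
  have hxC : (x : ℂ) ≠ 0 := by exact_mod_cast hx0.ne'
  push_cast
  field_simp

/-- `inv g` is even when `g` is. [folklore] -/
private theorem inv_even (hge : ∀ u, g (-u) = g u) (u : ℝ) : inv g (-u) = inv g u := by
  simp only [inv, inv_neg, hge, abs_neg]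

/-- `P'(I g) = (the dual co-Poisson sum of g)`: `Σ_n I(g)(t/n)/n − ∫₀^∞ I(g)(u)du/u =
Σ_n g(n/t)/|t| − ∫₀^∞ g`. [folklore] -/
private theorem coSum_inv_eq_coSumDual (g : ℝ → ℂ) (t : ℝ) : coSum (inv g) t = coSumDual g t := by
  rw [coSum, coSumDual, integral_Ioi_inv_div, ← tsum_div_const]
  congr 1
  refine tsum_congr fun n ↦ ?_
  rcases eq_or_ne t 0 with rfl | ht
  · simp [CoPoisson.inv]
  · have hn1 : (0 : ℝ) < (n : ℝ) + 1 := by positivity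
    rw [CoPoisson.inv, inv_div, abs_div, abs_of_pos hn1]
    have h1 : (((n : ℝ) + 1 : ℝ) : ℂ) ≠ 0 := by exact_mod_cast hn1.ne'
    have h2 : ((|t| : ℝ) : ℂ) ≠ 0 := by exact_mod_cast (abs_pos.2 ht).ne'
    push_cast
    field_simp

/-! ### The weak identity for the class, against even Schwartz functions -/

/-- **The weak intertwining identity for `g ∈ L¹(du) ∩ L¹(du/|u|)` even measurable**:
`∫ φ · P'(g) = ∫ 𝓕φ · P'(I g)` for every even Schwartz `φ` (the computation TeX l. 1163–1200
with "everything absolutely convergent", TeX l. 1283). [cite: Burnol2004, Thm 4.2 (TeX l. 1235)] -/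
private theorem integral_mul_coSum_eq' (hgm : Measurable g) (hge : ∀ u, g (-u) = g u)
    (hgi : Integrable g) (hgi' : Integrable fun u : ℝ ↦ ((|u|⁻¹ : ℝ) : ℂ) * g u)
    (hβi : Integrable (inv g)) (hβi' : Integrable fun u : ℝ ↦ ((|u|⁻¹ : ℝ) : ℂ) * inv g u)
    (φ : 𝓢(ℝ, ℂ)) (he : ∀ x : ℝ, φ (-x) = φ x) :
    ∫ y : ℝ, φ y * coSum g y = ∫ y : ℝ, 𝓕 (φ : ℝ → ℂ) y * coSum (inv g) y := by
  have hβm : Measurable (inv g) := measurable_inv' hgm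
  have hβe : ∀ u, inv g (-u) = inv g u := inv_even hge
  set Fφ : ℝ → ℂ := 𝓕 (φ : ℝ → ℂ) with hFφ
  have hFcont : Continuous Fφ := by
    rw [hFφ, ← SchwartzMap.fourier_coe]; exact (𝓕 φ).continuous
  have hFint : Integrable Fφ := by
    rw [hFφ, ← SchwartzMap.fourier_coe]; exact (𝓕 φ).integrable
  have hFeven : ∀ w : ℝ, Fφ (-w) = Fφ w := fourier_neg_of_even he
  obtain ⟨C₁, hC₁⟩ := schwartz_sq_decay φ
  obtain ⟨C₂, hC₂⟩ := schwartz_fourier_sq_decay φ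
  obtain ⟨M₁, hM₁⟩ := schwartz_norm_le φ
  obtain ⟨M₂, hM₂⟩ := schwartz_norm_le (𝓕 φ)
  have hM₂' : ∀ t : ℝ, ‖Fφ t‖ ≤ M₂ := fun t ↦ by
    rw [hFφ, ← congrFun (SchwartzMap.fourier_coe φ) t]; exact hM₂ t
  have hM₂0 : 0 ≤ M₂ := le_trans (norm_nonneg _) (hM₂' 0)
  -- constants
  set c : ℂ := ∫ v in Ioi (0 : ℝ), g v / (v : ℂ) with hc
  set I₀ : ℂ := ∫ v in Ioi (0 : ℝ), g v with hI₀
  have hcβ : ∫ v in Ioi (0 : ℝ), inv g v / (v : ℂ) = I₀ := integral_Ioi_inv_div g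
  -- Step 1: Tonelli, and the splitting `∫ φ P'g = ∫ φ S_g - c ∫ φ`
  obtain ⟨hint1', h2⟩ := integral_mul_tsum_eq_tsum' φ.continuous hM₁ hC₁ hgi hgi'
  have h3 := integral_tsum_mul_eq_tsum' φ.continuous hM₁ hC₁ hgi hgi'
  obtain ⟨hint2', h2β⟩ := integral_mul_tsum_eq_tsum' hFcont hM₂' hC₂ hβi hβi'
  have hS : ∀ y : ℝ, φ y * coSum g y =
      φ y * (∑' n : ℕ, g (y / ((n : ℝ) + 1)) / ((n : ℂ) + 1)) - c * φ y := by
    intro y; rw [coSum]; ring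
  have hSβ : ∀ y : ℝ, Fφ y * coSum (inv g) y =
      Fφ y * (∑' n : ℕ, inv g (y / ((n : ℝ) + 1)) / ((n : ℂ) + 1)) - I₀ * Fφ y := by
    intro y; rw [coSum, hcβ]; ring
  have h1 : ∫ y : ℝ, φ y * coSum g y =
      (∫ y : ℝ, φ y * ∑' n : ℕ, g (y / ((n : ℝ) + 1)) / ((n : ℂ) + 1)) - c * ∫ y : ℝ, φ y := by
    simp_rw [hS]
    rw [integral_sub hint1' (φ.integrable.const_mul c), integral_const_mul]
  have h1β : ∫ y : ℝ, Fφ y * coSum (inv g) y =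
      (∫ y : ℝ, Fφ y * ∑' n : ℕ, inv g (y / ((n : ℝ) + 1)) / ((n : ℂ) + 1)) -
        I₀ * ∫ y : ℝ, Fφ y := by
    simp_rw [hSβ]
    rw [integral_sub hint2' (hFint.const_mul I₀), integral_const_mul]
  -- Step 2: the dual terms `H_m(u) = |u|⁻¹ 𝓕φ((m+1)/u) g(u)` and `A`
  set A : ℝ → ℂ := fun u ↦ (-(φ 0) / 2 + ((|u|⁻¹ : ℝ) : ℂ) * Fφ 0 / 2) * g u with hA
  set H : ℕ → ℝ → ℂ := fun m u ↦ ((|u|⁻¹ : ℝ) : ℂ) * Fφ (u⁻¹ * ((m : ℝ) + 1)) * g u with hH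
  set K : ℕ → ℝ → ℂ := fun k ↦ Nat.casesOn k A H with hK
  have hK0 : K 0 = A := rfl
  have hKs : ∀ m : ℕ, K (m + 1) = H m := fun m ↦ rfl
  have hHmeas : ∀ m : ℕ, AEStronglyMeasurable (H m) volume := by
    intro m
    refine ((Measurable.mul ?_ ?_).mul hgm).aestronglyMeasurable
    · exact Complex.measurable_ofReal.comp (measurable_inv.comp measurable_norm)
    · exact hFcont.measurable.comp (measurable_inv.mul_const _)
  have hHint : ∀ m : ℕ, Integrable (H m) := by
    intro m
    refine (hgi'.norm.const_mul M₂).mono' (hHmeas m) (Eventually.of_forall fun u ↦ ?_)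
    simp only [hH, norm_mul]
    calc ‖((|u|⁻¹ : ℝ) : ℂ)‖ * ‖Fφ (u⁻¹ * ((m : ℝ) + 1))‖ * ‖g u‖
        ≤ ‖((|u|⁻¹ : ℝ) : ℂ)‖ * M₂ * ‖g u‖ := by gcongr; exact hM₂' _
      _ = M₂ * (‖((|u|⁻¹ : ℝ) : ℂ)‖ * ‖g u‖) := by ring
  have hHsumL1 : Summable fun m : ℕ ↦ ∫ u : ℝ, ‖H m u‖ := by
    -- majorant `((M₂ + C₂)|u| · |u|⁻¹ + M₂ |u|⁻¹) ‖g u‖ ≤ ((M₂+C₂) + M₂|u|⁻¹) ‖g u‖`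
    have hB : Integrable fun u : ℝ ↦ ((M₂ + C₂) + M₂ * |u|⁻¹) * ‖g u‖ := by
      have h1 : Integrable fun u : ℝ ↦ |u|⁻¹ * ‖g u‖ := by
        refine hgi'.norm.congr (Eventually.of_forall fun u ↦ ?_)
        simp only [norm_mul, Complex.norm_real, Real.norm_eq_abs, abs_inv, abs_abs]
      have e : (fun u : ℝ ↦ ((M₂ + C₂) + M₂ * |u|⁻¹) * ‖g u‖) =
          fun u ↦ (M₂ + C₂) * ‖g u‖ + M₂ * (|u|⁻¹ * ‖g u‖) := by
        funext u; ring
      rw [e]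
      exact (hgi.norm.const_mul _).add (h1.const_mul _)
    refine summable_integral_norm_of_le hHmeas hB ?_
    have hae : ∀ᵐ u : ℝ, u ≠ 0 := by
      rw [ae_iff]; simp
    filter_upwards [hae] with u hu
    have hu' : u⁻¹ ≠ 0 := inv_ne_zero hu
    obtain ⟨hs, hle⟩ := tsum_norm_dilate_le hM₂' hC₂ hu'
    have hnorm : ∀ m : ℕ, ‖H m u‖ = |u|⁻¹ * ‖Fφ (((m : ℝ) + 1) * u⁻¹)‖ * ‖g u‖ := by
      intro m
      simp only [hH, norm_mul, Complex.norm_real, Real.norm_eq_abs, abs_inv, abs_abs, mul_comm]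
    simp_rw [hnorm]
    refine ⟨((hs.mul_left |u|⁻¹).mul_right ‖g u‖).congr fun m ↦ by ring, ?_⟩
    rw [tsum_mul_right, tsum_mul_left]
    have hupos : 0 < |u| := abs_pos.2 hu
    calc |u|⁻¹ * (∑' m : ℕ, ‖Fφ (((m : ℝ) + 1) * u⁻¹)‖) * ‖g u‖
        ≤ |u|⁻¹ * ((M₂ + C₂) / |u⁻¹| + M₂) * ‖g u‖ := by gcongr
      _ = ((M₂ + C₂) + M₂ * |u|⁻¹) * ‖g u‖ := by
          rw [abs_inv]
          field_simp
  -- pointwise Poisson, valid for `u ≠ 0`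
  have hHsum : ∀ u : ℝ, Summable fun m : ℕ ↦ H m u := by
    intro u
    rcases eq_or_ne u 0 with rfl | hu0
    · simp only [hH, abs_zero, inv_zero, Complex.ofReal_zero, zero_mul]; exact summable_zero
    · simp only [hH]
      exact ((summable_mul_succ_of_sq_decay hC₂ (inv_ne_zero hu0)).mul_left _).mul_right _
  have hTot : ∀ᵐ u : ℝ, (∑' n : ℕ, φ (((n : ℝ) + 1) * u)) * g u = ∑' k : ℕ, K k u := by
    have hae : ∀ᵐ u : ℝ, u ≠ 0 := by
      rw [ae_iff]; simp
    filter_upwards [hae] with u hu0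
    have hKu : Summable fun k : ℕ ↦ K k u := by
      rw [← summable_nat_add_iff 1]; simpa only [hKs] using hHsum u
    rw [hKu.tsum_eq_zero_add]
    simp only [hK0, hKs]
    rw [tsum_dilate_eq φ he hu0]
    simp only [hA, hH]
    rw [tsum_mul_right, tsum_mul_left]
    simp only [← hFφ]
    ring
  -- Step 3: integrate termwise over `K`
  have hAint : Integrable A := by
    have : A = fun u ↦ (-(φ 0) / 2) * g u + (Fφ 0 / 2) * (((|u|⁻¹ : ℝ) : ℂ) * g u) := by
      funext u; simp only [hA]; ring
    rw [this]
    exact (hgi.const_mul _).add (hgi'.const_mul _)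
  have hKint' : ∀ k : ℕ, Integrable (K k) := by
    intro k; cases k with
    | zero => exact hAint
    | succ m => exact hHint m
  have hKsum' : Summable fun k : ℕ ↦ ∫ u : ℝ, ‖K k u‖ := by
    rw [← summable_nat_add_iff 1]; simpa only [hKs] using hHsumL1
  have h5 : ∫ u : ℝ, (∑' n : ℕ, φ (((n : ℝ) + 1) * u)) * g u =
      (∫ u : ℝ, A u) + ∑' m : ℕ, ∫ u : ℝ, H m u := by
    rw [integral_congr_ae hTot, ← integral_tsum_of_summable_integral_norm hKint' hKsum']
    have hs : Summable fun k : ℕ ↦ ∫ u : ℝ, K k u :=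
      hKsum'.of_norm_bounded fun k ↦ norm_integral_le_integral_norm _
    rw [hs.tsum_eq_zero_add]
    simp only [hK0, hKs]
  -- Step 4: `∫ A`
  have h6 : ∫ u : ℝ, A u = -(φ 0) * I₀ + Fφ 0 * c := by
    have : A = fun u ↦ (-(φ 0) / 2) * g u + (Fφ 0 / 2) * (((|u|⁻¹ : ℝ) : ℂ) * g u) := by
      funext u; simp only [hA]; ring
    have hIg : ∫ u : ℝ, g u = 2 * I₀ := integral_eq_two_mul_Ioi hgi hge
    have hIg' : ∫ u : ℝ, ((|u|⁻¹ : ℝ) : ℂ) * g u = 2 * c := by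
      rw [integral_eq_two_mul_Ioi hgi' (fun u ↦ by rw [abs_neg, hge])]
      congr 1
      refine setIntegral_congr_fun measurableSet_Ioi fun u hu ↦ ?_
      have hu0 : (0 : ℝ) < u := hu
      simp only [abs_of_pos hu0, Complex.ofReal_inv]
      rw [div_eq_inv_mul]
    rw [this, integral_add (hgi.const_mul _) (hgi'.const_mul _), integral_const_mul,
      integral_const_mul, hIg, hIg']
    ring
  -- Step 5: `∫ H_m = ∫ 𝓕φ((m+1)v) (Ig)(v) dv` (substitution `u = 1/v` on both half-lines)
  have hKeq : ∀ m : ℕ, ∫ u : ℝ, H m u = ∫ v : ℝ, Fφ (((m : ℝ) + 1) * v) * inv g v := by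
    intro m
    have hevenH : ∀ u : ℝ, H m (-u) = H m u := by
      intro u; simp only [hH]; rw [abs_neg, inv_neg, neg_mul, hFeven, hge]
    have hF' : Integrable fun v : ℝ ↦ Fφ (((m : ℝ) + 1) * v) * inv g v :=
      integrable_dilate_mul' hFcont hM₂' hβi m
    have hevenF : ∀ v : ℝ, Fφ (((m : ℝ) + 1) * (-v)) * inv g (-v) =
        Fφ (((m : ℝ) + 1) * v) * inv g v := by
      intro v; rw [mul_neg, hFeven, hβe]
    rw [integral_eq_two_mul_Ioi (hHint m) hevenH, integral_eq_two_mul_Ioi hF' hevenF]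
    congr 1
    have h := integral_comp_rpow_Ioi (fun v : ℝ ↦ Fφ (((m : ℝ) + 1) * v) * inv g v)
      (p := -1) (by norm_num)
    rw [← h]
    refine setIntegral_congr_fun measurableSet_Ioi fun x hx ↦ ?_
    have hx0 : (0 : ℝ) < x := hx
    simp only [hH, Real.rpow_neg_one]
    have hx2 : x ^ ((-1 : ℝ) - 1) = (x ^ 2)⁻¹ := by
      rw [show ((-1 : ℝ) - 1) = -2 by norm_num, Real.rpow_neg hx0.le, Real.rpow_two]
    rw [hx2, abs_neg, abs_one, one_mul, Complex.real_smul, abs_of_pos hx0,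
      inv_apply_of_pos g (inv_pos.2 hx0), inv_inv]
    have hxC : (x : ℂ) ≠ 0 := by exact_mod_cast hx0.ne'
    push_cast
    field_simp
  have h7 : ∑' m : ℕ, ∫ u : ℝ, H m u =
      ∫ y : ℝ, Fφ y * ∑' n : ℕ, inv g (y / ((n : ℝ) + 1)) / ((n : ℂ) + 1) := by
    rw [h2β]; exact tsum_congr hKeq
  -- Step 6: `∫ 𝓕φ = φ 0`, `∫ φ = 𝓕φ 0`
  have h8 : ∫ y : ℝ, Fφ y = φ 0 := by
    have hinv := Continuous.fourierInv_fourier_eq φ.continuous φ.integrable hFint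
    have := congrFun hinv 0
    rw [Real.fourierInv_eq_fourier_neg, neg_zero, fourier_apply_zero] at this
    exact this
  have h9 : ∫ y : ℝ, (φ : ℝ → ℂ) y = Fφ 0 := (fourier_apply_zero _).symm
  -- assemble
  rw [h1, h1β, h9, h8, h2, ← h3, h5, h6, h7]
  ring

/-! ### Even parts of Schwartz functions -/

/-- `𝓕(x ↦ f(−x))(w) = 𝓕f(−w)`. [folklore] -/
private theorem fourier_comp_neg_apply (f : ℝ → ℂ) (w : ℝ) :
    𝓕 (fun x : ℝ ↦ f (-x)) w = 𝓕 f (-w) := by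
  rw [← Real.fourierInv_eq_fourier_neg, Real.fourierInv_eq_fourier_comp_neg]

/-- Pairing an even function against `ψ` and against `x ↦ ψ(−x)` gives the same integral.
[folklore] -/
private theorem integral_mul_comp_neg {F ψ : ℝ → ℂ} (hFe : ∀ x, F (-x) = F x) :
    ∫ x : ℝ, F x * ψ (-x) = ∫ x : ℝ, F x * ψ x := by
  have h := integral_neg_eq_self (fun x : ℝ ↦ F x * ψ x) volume
  simp only [hFe] at h
  exact h

/-- **Proof of Burnol 2004, Theorem 4.2** (the co-Poisson intertwining as an identity of
tempered distributions, for even measurable `g` with `∫₀^∞|g(t)|dt/t + ∫₀^∞|g(t)|dt < ∞`): both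
pairings converge absolutely and `∫ P'(g)·𝓕φ = ∫ (Σ g(n/t)/|t| − ∫₀^∞ g)·φ` for every Schwartz
`φ`. Route: the weak identity `integral_mul_coSum_eq'` for the `I`-transformed datum `Ig`
(the class is `I`-stable and `I(Ig) = g` off `0`) against the even part of `φ`, to which both
sides reduce because `P'(g)` and its dual are even. Discharges
`Literature.NumberTheory.LFunctions.Burnol2004_thm_4_2`. [cite: Burnol2004, Thm 4.2 (TeX l. 1235)] -/
theorem _root_.Literature.NumberTheory.LFunctions.Burnol2004_thm_4_2_holds :
    Burnol2004_thm_4_2 := by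
  intro g hgm hge hg1 hg2 φ
  -- the class data for `g` and `Ig`
  have hgi : Integrable g := integrable_of_even hg2 hge
  have hgi' : Integrable fun u : ℝ ↦ ((|u|⁻¹ : ℝ) : ℂ) * g u := integrable_abs_inv_mul' hge hg1
  have hβm : Measurable (inv g) := measurable_inv' hgm
  have hβe : ∀ u, inv g (-u) = inv g u := inv_even hge
  have hβ1 : IntegrableOn (fun u : ℝ ↦ inv g u / (u : ℂ)) (Ioi 0) := integrableOn_inv_div_Ioi hg2
  have hβ2 : IntegrableOn (inv g) (Ioi 0) := integrableOn_inv_Ioi hg1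
  have hβi : Integrable (inv g) := integrable_of_even hβ2 hβe
  have hβi' : Integrable fun u : ℝ ↦ ((|u|⁻¹ : ℝ) : ℂ) * inv g u :=
    integrable_abs_inv_mul' hβe hβ1
  have hββe : ∀ u, inv (inv g) (-u) = inv (inv g) u := inv_even hβe
  have hββi : Integrable (inv (inv g)) :=
    integrable_of_even (integrableOn_inv_Ioi hβ1) hββe
  have hββi' : Integrable fun u : ℝ ↦ ((|u|⁻¹ : ℝ) : ℂ) * inv (inv g) u :=
    integrable_abs_inv_mul' hββe (integrableOn_inv_div_Ioi hβ2)
  -- `P'(I(Ig)) = P'(g)` off `0`, hence a.e.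
  have hcoSum_ββ : ∀ y : ℝ, y ≠ 0 → coSum (inv (inv g)) y = coSum g y := by
    intro y hy
    rw [coSum, coSum, integral_Ioi_inv_div, integral_Ioi_inv]
    congr 1
    refine tsum_congr fun n ↦ ?_
    rw [inv_inv_apply g (div_ne_zero hy (by positivity))]
  have hae : ∀ᵐ y : ℝ, y ≠ 0 := by
    rw [ae_iff]; simp
  -- Schwartz data
  set Fφ : ℝ → ℂ := 𝓕 (φ : ℝ → ℂ) with hFφ
  have hFcont : Continuous Fφ := by
    rw [hFφ, ← SchwartzMap.fourier_coe]; exact (𝓕 φ).continuous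
  obtain ⟨C₁, hC₁⟩ := schwartz_sq_decay φ
  obtain ⟨C₂, hC₂⟩ := schwartz_fourier_sq_decay φ
  obtain ⟨M₁, hM₁⟩ := schwartz_norm_le φ
  obtain ⟨M₂, hM₂⟩ := schwartz_norm_le (𝓕 φ)
  have hM₂' : ∀ t : ℝ, ‖Fφ t‖ ≤ M₂ := fun t ↦ by
    rw [hFφ, ← congrFun (SchwartzMap.fourier_coe φ) t]; exact hM₂ t
  -- clause 1: `P'(g) · 𝓕φ ∈ L¹`
  have hI1 : Integrable fun y : ℝ ↦ coSum g y * Fφ y := by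
    obtain ⟨h, -⟩ := integral_mul_tsum_eq_tsum' hFcont hM₂' hC₂ hgi hgi'
    have hFint : Integrable Fφ := by
      rw [hFφ, ← SchwartzMap.fourier_coe]; exact (𝓕 φ).integrable
    refine (h.sub (hFint.const_mul (∫ v in Ioi (0 : ℝ), g v / (v : ℂ)))).congr
      (Eventually.of_forall fun y ↦ ?_)
    show Fφ y * (∑' n : ℕ, g (y / ((n : ℝ) + 1)) / ((n : ℂ) + 1)) -
        (∫ v in Ioi (0 : ℝ), g v / (v : ℂ)) * Fφ y = coSum g y * Fφ y
    rw [coSum]; ring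
  -- clause 2: `(dual sum) · φ ∈ L¹`
  have hI2 : Integrable fun t : ℝ ↦ coSumDual g t * φ t := by
    obtain ⟨h, -⟩ := integral_mul_tsum_eq_tsum' φ.continuous hM₁ hC₁ hβi hβi'
    refine (h.sub (φ.integrable.const_mul (∫ v in Ioi (0 : ℝ), inv g v / (v : ℂ)))).congr
      (Eventually.of_forall fun t ↦ ?_)
    show φ t * (∑' n : ℕ, inv g (t / ((n : ℝ) + 1)) / ((n : ℂ) + 1)) -
        (∫ v in Ioi (0 : ℝ), inv g v / (v : ℂ)) * φ t = coSumDual g t * φ t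
    rw [← coSum_inv_eq_coSumDual, coSum]; ring
  refine ⟨hI1, hI2, ?_⟩
  -- clause 3: reduce to the even part `φₑ` of `φ`
  set φn : 𝓢(ℝ, ℂ) := SchwartzMap.compCLMOfContinuousLinearEquiv ℂ (ContinuousLinearEquiv.neg ℝ) φ
    with hφn
  have hφn_apply : ∀ x : ℝ, φn x = φ (-x) := fun x ↦ rfl
  set φe : 𝓢(ℝ, ℂ) := (1 / 2 : ℂ) • (φ + φn) with hφe
  have hφe_apply : ∀ x : ℝ, φe x = (1 / 2 : ℂ) * (φ x + φ (-x)) := fun x ↦ rfl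
  have hφe_even : ∀ x : ℝ, φe (-x) = φe x := by
    intro x; rw [hφe_apply, hφe_apply, neg_neg, add_comm]
  have hFφe : ∀ y : ℝ, 𝓕 (φe : ℝ → ℂ) y = (1 / 2 : ℂ) * (Fφ y + Fφ (-y)) := by
    intro y
    have e1 : (𝓕 φe : 𝓢(ℝ, ℂ)) = (1 / 2 : ℂ) • (𝓕 φ + 𝓕 φn) := by
      rw [hφe, ← SchwartzMap.fourierTransformCLM_apply ℂ, map_smul, map_add,
        SchwartzMap.fourierTransformCLM_apply, SchwartzMap.fourierTransformCLM_apply]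
    have e2 := congrFun (SchwartzMap.fourier_coe φe) y
    rw [← e2, e1]
    have h1 : (𝓕 φ : 𝓢(ℝ, ℂ)) y = Fφ y := congrFun (SchwartzMap.fourier_coe φ) y
    have h2 : (𝓕 φn : 𝓢(ℝ, ℂ)) y = Fφ (-y) := by
      rw [congrFun (SchwartzMap.fourier_coe φn) y]
      have : (φn : ℝ → ℂ) = fun x : ℝ ↦ φ (-x) := funext hφn_apply
      rw [this, fourier_comp_neg_apply]
    show (1 / 2 : ℂ) * ((𝓕 φ : 𝓢(ℝ, ℂ)) y + (𝓕 φn : 𝓢(ℝ, ℂ)) y) = (1 / 2 : ℂ) * (Fφ y + Fφ (-y))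
    rw [h1, h2]
  -- both sides only see `φₑ`
  have hcoSum_even : ∀ y : ℝ, coSum g (-y) = coSum g y := coSum_neg hge
  have hdual_even : ∀ t : ℝ, coSumDual g (-t) = coSumDual g t := coSumDual_neg hge
  have hL : ∫ y : ℝ, coSum g y * 𝓕 (φe : ℝ → ℂ) y = ∫ y : ℝ, coSum g y * Fφ y := by
    have hI1n : Integrable fun y : ℝ ↦ coSum g y * Fφ (-y) := by
      have h := ((Measure.measurePreserving_neg (volume : Measure ℝ)).integrable_comp_emb
        (Homeomorph.neg ℝ).measurableEmbedding).2 hI1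
      refine h.congr (Eventually.of_forall fun y ↦ ?_)
      simp [hcoSum_even]
    simp_rw [hFφe]
    have e : (fun y : ℝ ↦ coSum g y * (1 / 2 * (Fφ y + Fφ (-y)))) =
        fun y ↦ (1 / 2 : ℂ) * (coSum g y * Fφ y) + (1 / 2 : ℂ) * (coSum g y * Fφ (-y)) := by
      funext y; ring
    rw [e, integral_add (hI1.const_mul _) (hI1n.const_mul _), integral_const_mul,
      integral_const_mul, integral_mul_comp_neg hcoSum_even]
    ring
  have hR : ∫ t : ℝ, coSumDual g t * φe t = ∫ t : ℝ, coSumDual g t * φ t := by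
    have hI2n : Integrable fun t : ℝ ↦ coSumDual g t * φ (-t) := by
      have h := ((Measure.measurePreserving_neg (volume : Measure ℝ)).integrable_comp_emb
        (Homeomorph.neg ℝ).measurableEmbedding).2 hI2
      refine h.congr (Eventually.of_forall fun t ↦ ?_)
      simp [hdual_even]
    simp_rw [hφe_apply]
    have e : (fun t : ℝ ↦ coSumDual g t * (1 / 2 * (φ t + φ (-t)))) =
        fun t ↦ (1 / 2 : ℂ) * (coSumDual g t * φ t) + (1 / 2 : ℂ) * (coSumDual g t * φ (-t)) := by
      funext t; ring
    rw [e, integral_add (hI2.const_mul _) (hI2n.const_mul _), integral_const_mul,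
      integral_const_mul, integral_mul_comp_neg hdual_even]
    ring
  rw [← hL, ← hR]
  -- the weak identity for the datum `Ig` against `φₑ`
  have hW := integral_mul_coSum_eq' hβm hβe hβi hβi' hββi hββi' φe hφe_even
  calc ∫ y : ℝ, coSum g y * 𝓕 (φe : ℝ → ℂ) y
      = ∫ y : ℝ, 𝓕 (φe : ℝ → ℂ) y * coSum (inv (inv g)) y := by
        refine integral_congr_ae ?_
        filter_upwards [hae] with y hy
        rw [hcoSum_ββ y hy, mul_comm]
    _ = ∫ y : ℝ, φe y * coSum (inv g) y := hW.symm
    _ = ∫ t : ℝ, coSumDual g t * φe t := by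
        congr 1; funext t; rw [coSum_inv_eq_coSumDual, mul_comm]

end measurable

/-! ## J. Lemma 4.1: almost-everywhere absolute convergence, local integrability and the bound
`∫₀^u Σ_n g(t/n)/n dt = O(u)` for measurable `g` with `∫₀^∞ |g(u)| du/u < ∞` (TeX l. 1207–1232)

Printed proof: "`∫₀^T Σ_{n≥1} |g(t/n)|/n dt = Σ_{n≥1} ∫₀^{T/n} |g(t)| dt = ∫₀^∞ N_T(t)|g(t)| dt`
with `N_T(t) = #{n ≥ 1 : n ≤ T/t} ≤ T/t`" — formalised with lower Lebesgue integrals (Tonelli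
for `ℝ≥0∞`-valued series, the dilation `t = n s`, and the count `Σ_n 𝟙[(n+1)|s| < T] ≤ T/|s|`). -/

section lemma41

variable {g : ℝ → ℂ}

/-- A countable sum of measurable `ℝ≥0∞`-valued functions is measurable. [folklore] -/
private theorem measurable_ennreal_tsum {f : ℕ → ℝ → ENNReal} (h : ∀ i, Measurable (f i)) :
    Measurable (fun x ↦ ∑' i, f i x) := by
  simp_rw [ENNReal.tsum_eq_iSup_sum]
  exact Measurable.iSup fun s ↦ Finset.measurable_fun_sum s fun i _ ↦ h i

/-- Dilation change of variables for the lower Lebesgue integral on `ℝ` (no measurability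
needed): `∫ G(a s) ds = a⁻¹ ∫ G` for `a > 0`. [folklore] -/
private theorem lintegral_comp_mul_left' (G : ℝ → ENNReal) {a : ℝ} (ha : 0 < a) :
    ∫⁻ s, G (a * s) = ENNReal.ofReal a⁻¹ * ∫⁻ t, G t := by
  have h1 : ∫⁻ s, G (a * s) = ∫⁻ t, G t ∂(Measure.map (fun s ↦ a * s) volume) := by
    rw [show (fun s ↦ a * s) = ⇑(Homeomorph.mulLeft₀ a ha.ne').toMeasurableEquiv from rfl,
      lintegral_map_equiv]
    rfl
  rw [h1, Real.map_volume_mul_left ha.ne', lintegral_smul_measure, smul_eq_mul,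
    abs_of_pos (inv_pos.2 ha)]

/-- The counting bound `Σ_{n ≥ 0} 𝟙[(n+1)|s| < T] ≤ T/|s|` (`s ≠ 0`), in `ℝ≥0∞`. [folklore] -/
private theorem tsum_indicator_dilate_le {T s : ℝ} (hT : 0 < T) (hs : s ≠ 0) :
    ∑' n : ℕ, (Ioo (-T) T).indicator (fun _ ↦ (1 : ENNReal)) (((n : ℝ) + 1) * s) ≤
      ENNReal.ofReal (T / |s|) := by
  have hs' : 0 < |s| := abs_pos.2 hs
  set K : ℕ := ⌊T / |s|⌋₊ with hK
  -- the indicator vanishes for `n ≥ K`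
  have hzero : ∀ n : ℕ, K ≤ n →
      (Ioo (-T) T).indicator (fun _ ↦ (1 : ENNReal)) (((n : ℝ) + 1) * s) = 0 := by
    intro n hn
    apply Set.indicator_of_notMem
    intro hmem
    have h1 : |((n : ℝ) + 1) * s| < T := abs_lt.2 ⟨hmem.1, hmem.2⟩
    rw [abs_mul, abs_of_pos (by positivity : (0 : ℝ) < (n : ℝ) + 1)] at h1
    have h2 : (n : ℝ) + 1 < T / |s| := by rw [lt_div_iff₀ hs']; exact h1
    have h3 : (K : ℝ) ≤ n := by exact_mod_cast hn
    have h4 : T / |s| < (K : ℝ) + 1 := Nat.lt_floor_add_one _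
    linarith
  have hle : ∀ n : ℕ, (Ioo (-T) T).indicator (fun _ ↦ (1 : ENNReal)) (((n : ℝ) + 1) * s) ≤
      (Finset.range K : Set ℕ).indicator (fun _ ↦ (1 : ENNReal)) n := by
    intro n
    by_cases hn : n < K
    · rw [Set.indicator_of_mem (show n ∈ (Finset.range K : Set ℕ) by simpa using hn)]
      exact Set.indicator_apply_le' (fun _ ↦ le_rfl) (fun _ ↦ zero_le_one)
    · rw [hzero n (not_lt.1 hn)]; simp only [zero_le]
  calc ∑' n : ℕ, (Ioo (-T) T).indicator (fun _ ↦ (1 : ENNReal)) (((n : ℝ) + 1) * s)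
      ≤ ∑' n : ℕ, (Finset.range K : Set ℕ).indicator (fun _ ↦ (1 : ENNReal)) n :=
        ENNReal.tsum_le_tsum hle
    _ = ∑ n ∈ Finset.range K, (1 : ENNReal) := by
        rw [tsum_eq_sum (s := Finset.range K)]
        · exact Finset.sum_congr rfl fun n hn ↦ Set.indicator_of_mem (by simpa using hn) _
        · intro n hn
          exact Set.indicator_of_notMem (by simpa using hn) _
    _ = (K : ENNReal) := by simp
    _ ≤ ENNReal.ofReal (T / |s|) := by
        rw [← ENNReal.ofReal_natCast]
        exact ENNReal.ofReal_le_ofReal (Nat.floor_le (by positivity))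

/-- **The core estimate of Lemma 4.1**: for `T > 0`,
`∫_{(-T,T)} Σ_n |g(t/(n+1))|/(n+1) dt ≤ T · ∫ |g(u)| du/|u|` (lower Lebesgue integrals).
[cite: Burnol2004, proof of Lemma 4.1 (TeX l. 1215–1225)] -/
private theorem lintegral_Ioo_tsum_le (hgm : Measurable g) {T : ℝ} (hT : 0 < T) :
    ∫⁻ t in Ioo (-T) T, ∑' n : ℕ, ‖g (t / ((n : ℝ) + 1)) / ((n : ℂ) + 1)‖ₑ ≤
      ENNReal.ofReal T * ∫⁻ u : ℝ, ‖((|u|⁻¹ : ℝ) : ℂ) * g u‖ₑ := by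
  set S : Set ℝ := Ioo (-T) T with hS
  set χ : ℝ → ENNReal := S.indicator (fun _ ↦ (1 : ENNReal)) with hχ
  have hχm : Measurable χ := (measurable_const.indicator measurableSet_Ioo)
  have hgn : ∀ n : ℕ, Measurable fun t : ℝ ↦ (‖g (t / ((n : ℝ) + 1)) / ((n : ℂ) + 1)‖ₑ : ENNReal) :=
    fun n ↦ ((hgm.comp (measurable_id.div_const _)).div_const _).enorm
  -- rewrite the set integral with the indicator and exchange sum and integral
  have hmeas1 : ∀ n : ℕ,
      AEMeasurable (fun t : ℝ ↦ χ t * ‖g (t / ((n : ℝ) + 1)) / ((n : ℂ) + 1)‖ₑ) volume :=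
    fun n ↦ (hχm.mul (hgn n)).aemeasurable
  have hmeas2 : ∀ n : ℕ, AEMeasurable (fun s : ℝ ↦ χ (((n : ℝ) + 1) * s) * ‖g s‖ₑ) volume :=
    fun n ↦ ((hχm.comp (measurable_const.mul measurable_id)).mul hgm.enorm).aemeasurable
  have h1 : ∫⁻ t in S, ∑' n : ℕ, ‖g (t / ((n : ℝ) + 1)) / ((n : ℂ) + 1)‖ₑ =
      ∑' n : ℕ, ∫⁻ t : ℝ, χ t * ‖g (t / ((n : ℝ) + 1)) / ((n : ℂ) + 1)‖ₑ := by
    rw [← lintegral_indicator measurableSet_Ioo]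
    have e : (fun t ↦ S.indicator (fun t ↦ ∑' n : ℕ, (‖g (t / ((n : ℝ) + 1)) / ((n : ℂ) + 1)‖ₑ : ENNReal)) t) =
        fun t ↦ ∑' n : ℕ, χ t * ‖g (t / ((n : ℝ) + 1)) / ((n : ℂ) + 1)‖ₑ := by
      funext t
      by_cases ht : t ∈ S
      · simp [hχ, Set.indicator_of_mem ht]
      · simp [hχ, Set.indicator_of_notMem ht]
    rw [e, lintegral_tsum hmeas1]
  -- the dilation `t = (n+1) s` in each term
  have h2 : ∀ n : ℕ, ∫⁻ t : ℝ, χ t * ‖g (t / ((n : ℝ) + 1)) / ((n : ℂ) + 1)‖ₑ =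
      ∫⁻ s : ℝ, χ (((n : ℝ) + 1) * s) * ‖g s‖ₑ := by
    intro n
    have hn1 : (0 : ℝ) < (n : ℝ) + 1 := by positivity
    have hnorm : ∀ t : ℝ, (‖g (t / ((n : ℝ) + 1)) / ((n : ℂ) + 1)‖ₑ : ENNReal) =
        ENNReal.ofReal ((n : ℝ) + 1)⁻¹ * ‖g (t / ((n : ℝ) + 1))‖ₑ := by
      intro t
      rw [← ofReal_norm, ← ofReal_norm, norm_div, ← ENNReal.ofReal_mul (by positivity)]
      congr 1
      have : ‖((n : ℂ) + 1)‖ = (n : ℝ) + 1 := by exact_mod_cast Complex.norm_natCast (n + 1)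
      rw [this, div_eq_inv_mul]
    simp_rw [hnorm]
    -- `∫ G((n+1)⁻¹ t) dt = (n+1) ∫ G`
    have hsub := lintegral_comp_mul_left'
      (fun s : ℝ ↦ χ (((n : ℝ) + 1) * s) * (ENNReal.ofReal ((n : ℝ) + 1)⁻¹ * ‖g s‖ₑ))
      (inv_pos.2 hn1)
    have e : (fun t : ℝ ↦ χ (((n : ℝ) + 1) * (((n : ℝ) + 1)⁻¹ * t)) *
        (ENNReal.ofReal ((n : ℝ) + 1)⁻¹ * ‖g (((n : ℝ) + 1)⁻¹ * t)‖ₑ)) =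
        fun t : ℝ ↦ χ t * (ENNReal.ofReal ((n : ℝ) + 1)⁻¹ * ‖g (t / ((n : ℝ) + 1))‖ₑ) := by
      funext t
      rw [mul_inv_cancel_left₀ hn1.ne', div_eq_inv_mul]
    rw [e, inv_inv] at hsub
    rw [hsub, ← lintegral_const_mul' _ _ ENNReal.ofReal_ne_top]
    congr 1
    funext s
    rw [← mul_assoc, mul_comm (ENNReal.ofReal ((n : ℝ) + 1)), mul_assoc, ← mul_assoc
      (ENNReal.ofReal ((n : ℝ) + 1)), ← ENNReal.ofReal_mul hn1.le, mul_inv_cancel₀ hn1.ne',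
      ENNReal.ofReal_one, one_mul]
  simp_rw [h1, h2]
  -- exchange again and count
  rw [← lintegral_tsum hmeas2]
  simp_rw [ENNReal.tsum_mul_right]
  have hae : ∀ᵐ s : ℝ, s ≠ 0 := by
    rw [ae_iff]; simp
  calc ∫⁻ s : ℝ, (∑' n : ℕ, χ (((n : ℝ) + 1) * s)) * ‖g s‖ₑ
      ≤ ∫⁻ s : ℝ, ENNReal.ofReal (T / |s|) * ‖g s‖ₑ := by
        refine lintegral_mono_ae ?_
        filter_upwards [hae] with s hs
        gcongr
        exact tsum_indicator_dilate_le hT hs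
    _ = ∫⁻ s : ℝ, ENNReal.ofReal T * ‖((|s|⁻¹ : ℝ) : ℂ) * g s‖ₑ := by
        congr 1; funext s
        rw [enorm_mul, ← mul_assoc]
        congr 1
        rw [← ofReal_norm, Complex.norm_real, Real.norm_eq_abs, abs_inv, abs_abs,
          ← ENNReal.ofReal_mul hT.le, div_eq_mul_inv]
    _ = ENNReal.ofReal T * ∫⁻ u : ℝ, ‖((|u|⁻¹ : ℝ) : ℂ) * g u‖ₑ :=
        lintegral_const_mul' _ _ ENNReal.ofReal_ne_top

/-- **Proof of Burnol 2004, Lemma 4.1**: for an even measurable `g` with `∫₀^∞|g(u)|du/u < ∞`,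
the series `Σ_{n≥1} g(t/n)/n` converges absolutely for almost every `t`, its sum is locally
integrable, and `∫₀^u Σ_n g(t/n)/n dt = O(u)` (so that it is a tempered distribution).
Discharges `Literature.NumberTheory.LFunctions.Burnol2004_lemma_4_1`.
[cite: Burnol2004, Lemma 4.1 (TeX l. 1207–1232)] -/
theorem _root_.Literature.NumberTheory.LFunctions.Burnol2004_lemma_4_1_holds :
    Burnol2004_lemma_4_1 := by
  intro g hgm hge hg1
  -- the finite constant `c = ∫ |g(u)| du/|u|`
  have hgi' : Integrable fun u : ℝ ↦ ((|u|⁻¹ : ℝ) : ℂ) * g u := integrable_abs_inv_mul' hge hg1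
  set c : ENNReal := ∫⁻ u : ℝ, ‖((|u|⁻¹ : ℝ) : ℂ) * g u‖ₑ with hc
  have hc_top : c ≠ ⊤ := hgi'.2.ne
  set term : ℕ → ℝ → ℂ := fun n t ↦ g (t / ((n : ℝ) + 1)) / ((n : ℂ) + 1) with hterm
  have htm : ∀ n : ℕ, Measurable (term n) :=
    fun n ↦ (hgm.comp (measurable_id.div_const _)).div_const _
  set F : ℝ → ENNReal := fun t ↦ ∑' n : ℕ, ‖term n t‖ₑ with hF
  have hFm : Measurable F := measurable_ennreal_tsum fun n ↦ (htm n).enorm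
  have hE : ∀ T : ℝ, 0 < T → ∫⁻ t in Ioo (-T) T, F t ≤ ENNReal.ofReal T * c :=
    fun T hT ↦ lintegral_Ioo_tsum_le hgm hT
  have hE' : ∀ T : ℝ, 0 < T → ∫⁻ t in Ioo (-T) T, F t ≠ ⊤ := fun T hT ↦
    ne_top_of_le_ne_top (ENNReal.mul_ne_top ENNReal.ofReal_ne_top hc_top) (hE T hT)
  -- (i) a.e. absolute convergence
  have hae : ∀ᵐ t : ℝ, Summable fun n : ℕ ↦ ‖term n t‖ := by
    have hT : ∀ N : ℕ, ∀ᵐ t : ℝ, t ∈ Ioo (-((N : ℝ) + 1)) ((N : ℝ) + 1) → F t < ⊤ := by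
      intro N
      rw [← ae_restrict_iff' measurableSet_Ioo]
      exact ae_lt_top' hFm.aemeasurable (hE' _ (by positivity))
    have hall := ae_all_iff.2 hT
    filter_upwards [hall] with t ht
    have hmem : t ∈ Ioo (-((⌈|t|⌉₊ : ℝ) + 1)) ((⌈|t|⌉₊ : ℝ) + 1) := by
      have h1 : |t| ≤ ⌈|t|⌉₊ := Nat.le_ceil _
      constructor <;> linarith [neg_abs_le t, le_abs_self t]
    have hlt := ht ⌈|t|⌉₊ hmem
    have h : ∑' n, (‖term n t‖₊ : ENNReal) ≠ ⊤ := hlt.ne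
    rw [ENNReal.tsum_coe_ne_top_iff_summable] at h
    exact NNReal.summable_coe.2 h
  refine ⟨hae, ?_, ?_⟩
  -- measurability of the sum and the pointwise a.e. bound `‖A t‖ₑ ≤ F t`
  · have hA : AEStronglyMeasurable (fun t : ℝ ↦ ∑' n : ℕ, term n t) volume := by
      refine aestronglyMeasurable_of_tendsto_ae atTop
        (fun N ↦ Finset.aestronglyMeasurable_fun_sum (Finset.range N)
          fun n _ ↦ (htm n).aestronglyMeasurable) ?_
      filter_upwards [hae] with t ht
      exact (Summable.of_norm ht).hasSum.tendsto_sum_nat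
    have hbound : ∀ᵐ t : ℝ, (‖∑' n : ℕ, term n t‖ₑ : ENNReal) ≤ F t := by
      filter_upwards [hae] with t ht
      rw [hF]; dsimp only
      rw [← ofReal_norm]
      calc ENNReal.ofReal ‖∑' n : ℕ, term n t‖ ≤ ENNReal.ofReal (∑' n : ℕ, ‖term n t‖) :=
            ENNReal.ofReal_le_ofReal (norm_tsum_le_tsum_norm ht)
        _ = ∑' n : ℕ, (‖term n t‖ₑ : ENNReal) := by
            rw [ENNReal.ofReal_tsum_of_nonneg (fun n ↦ norm_nonneg _) ht]
            simp only [ofReal_norm]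
    -- (ii) local integrability: integrable on every `(-T, T)`
    have hint : ∀ T : ℝ, 0 < T → IntegrableOn (fun t : ℝ ↦ ∑' n : ℕ, term n t) (Ioo (-T) T) := by
      intro T hT
      refine ⟨hA.restrict, ?_⟩
      rw [hasFiniteIntegral_iff_enorm]
      calc ∫⁻ t in Ioo (-T) T, ‖∑' n : ℕ, term n t‖ₑ ≤ ∫⁻ t in Ioo (-T) T, F t :=
            lintegral_mono_ae (ae_restrict_of_ae hbound)
        _ < ⊤ := (hE' T hT).lt_top
    rw [locallyIntegrable_iff]
    intro k hk
    obtain ⟨R, hR⟩ := hk.isBounded.subset_closedBall 0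
    have hsub : k ⊆ Ioo (-(|R| + 1)) (|R| + 1) := by
      intro x hx
      have h1 := hR hx
      rw [Real.closedBall_eq_Icc, zero_sub, zero_add] at h1
      constructor <;> linarith [h1.1, h1.2, le_abs_self R, neg_abs_le R]
    exact (hint _ (by positivity)).mono_set hsub
  -- (iii) `∫₀^u A = O(u)`
  · have hA : AEStronglyMeasurable (fun t : ℝ ↦ ∑' n : ℕ, term n t) volume := by
      refine aestronglyMeasurable_of_tendsto_ae atTop
        (fun N ↦ Finset.aestronglyMeasurable_fun_sum (Finset.range N)
          fun n _ ↦ (htm n).aestronglyMeasurable) ?_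
      filter_upwards [hae] with t ht
      exact (Summable.of_norm ht).hasSum.tendsto_sum_nat
    have hbound : ∀ᵐ t : ℝ, (‖∑' n : ℕ, term n t‖ₑ : ENNReal) ≤ F t := by
      filter_upwards [hae] with t ht
      rw [hF]; dsimp only
      rw [← ofReal_norm]
      calc ENNReal.ofReal ‖∑' n : ℕ, term n t‖ ≤ ENNReal.ofReal (∑' n : ℕ, ‖term n t‖) :=
            ENNReal.ofReal_le_ofReal (norm_tsum_le_tsum_norm ht)
        _ = ∑' n : ℕ, (‖term n t‖ₑ : ENNReal) := by
            rw [ENNReal.ofReal_tsum_of_nonneg (fun n ↦ norm_nonneg _) ht]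
            simp only [ofReal_norm]
    rw [Asymptotics.isBigO_iff]
    refine ⟨2 * c.toReal, ?_⟩
    filter_upwards [Filter.eventually_ge_atTop (1 : ℝ)] with u hu
    have hu0 : 0 ≤ u := le_trans zero_le_one hu
    have hsub : Ioc (0 : ℝ) u ⊆ Ioo (-(u + 1)) (u + 1) := by
      intro x hx; constructor <;> linarith [hx.1, hx.2]
    have hfin : ∫⁻ t in Ioo (-(u + 1)) (u + 1), F t ≠ ⊤ := hE' _ (by linarith)
    calc ‖∫ t in (0 : ℝ)..u, ∑' n : ℕ, term n t‖
        ≤ ∫ t in (0 : ℝ)..u, ‖∑' n : ℕ, term n t‖ :=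
          intervalIntegral.norm_integral_le_integral_norm hu0
      _ = ∫ t in Ioc (0 : ℝ) u, ‖∑' n : ℕ, term n t‖ := intervalIntegral.integral_of_le hu0
      _ = (∫⁻ t in Ioc (0 : ℝ) u, ‖∑' n : ℕ, term n t‖ₑ).toReal :=
          integral_norm_eq_lintegral_enorm hA.restrict
      _ ≤ (∫⁻ t in Ioo (-(u + 1)) (u + 1), F t).toReal := by
          refine ENNReal.toReal_mono hfin ?_
          calc ∫⁻ t in Ioc (0 : ℝ) u, ‖∑' n : ℕ, term n t‖ₑ
              ≤ ∫⁻ t in Ioc (0 : ℝ) u, F t := lintegral_mono_ae (ae_restrict_of_ae hbound)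
            _ ≤ ∫⁻ t in Ioo (-(u + 1)) (u + 1), F t := lintegral_mono_set hsub
      _ ≤ (ENNReal.ofReal (u + 1) * c).toReal :=
          ENNReal.toReal_mono (ENNReal.mul_ne_top ENNReal.ofReal_ne_top hc_top) (hE _ (by linarith))
      _ = (u + 1) * c.toReal := by
          rw [ENNReal.toReal_mul, ENNReal.toReal_ofReal (by linarith)]
      _ ≤ 2 * c.toReal * ‖u‖ := by
          rw [Real.norm_of_nonneg hu0]
          have : 0 ≤ c.toReal := ENNReal.toReal_nonneg
          nlinarith

end lemma41

/-! ## K. Theorem 4.5 (= 4.6): the co-Poisson intertwining for `C²` data, pointwise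

For `g ∈ C²` even with compact support away from the origin the sums `P'(g)` and its dual are
continuous `L¹` functions and `𝓕(P'(g)) = (dual sum)` pointwise (TeX l. 1415–1502). Route: the
elementary structure of Parts A–C and F carries over verbatim to `C²` data; the decay
`t²|𝓕(Ig)(t)| ≤ C` now comes from `𝓕(f'') = (2πit)²𝓕(f)` (Mathlib `Real.fourier_iteratedDeriv`),
Poisson summation for the dilates from `Real.tsum_eq_tsum_fourier_of_rpow_decay`; the identity
itself is Theorem 4.2 (Part I) made pointwise through `∫ ψ·𝓕(P'g) = ∫ 𝓕ψ·P'g` (Fubini) and the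
continuity of both sides. -/

section thm45

variable {g : ℝ → ℂ}

namespace IsTestAway2

/-- Auxiliary step (elementary). [folklore] -/
private theorem continuous (h : IsTestAway2 g) : Continuous g := h.contDiff.continuous

/-- `g` vanishes on a neighbourhood `(-δ, δ)` of `0`. [folklore] -/
private theorem exists_ball (h : IsTestAway2 g) : ∃ δ : ℝ, 0 < δ ∧ ∀ y : ℝ, |y| < δ → g y = 0 := by
  have hopen : IsOpen (tsupport g)ᶜ := (isClosed_tsupport g).isOpen_compl
  obtain ⟨δ, hδ, hball⟩ := Metric.isOpen_iff.1 hopen 0 h.zero_notMem_tsupport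
  refine ⟨δ, hδ, fun y hy ↦ ?_⟩
  have hy' : y ∈ (tsupport g)ᶜ := hball (by simpa [Real.dist_eq] using hy)
  exact image_eq_zero_of_notMem_tsupport hy'

/-- `g` vanishes outside a bounded set `[-R, R]`. [folklore] -/
private theorem exists_bound (h : IsTestAway2 g) : ∃ R : ℝ, 0 < R ∧ ∀ y : ℝ, R < |y| → g y = 0 := by
  obtain ⟨R, hR⟩ := (h.hasCompactSupport.isCompact.isBounded).subset_closedBall 0
  refine ⟨max R 1, by positivity, fun y hy ↦ ?_⟩
  apply image_eq_zero_of_notMem_tsupport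
  intro hmem
  have := hR hmem
  rw [Metric.mem_closedBall, dist_zero_right, Real.norm_eq_abs] at this
  linarith [le_max_left R 1]

/-- Auxiliary step (elementary). [folklore] -/
private theorem apply_zero (h : IsTestAway2 g) : g 0 = 0 := by
  obtain ⟨δ, hδ, hz⟩ := h.exists_ball
  exact hz 0 (by simpa using hδ)

/-- Auxiliary step (elementary). [folklore] -/
private theorem integrable (h : IsTestAway2 g) : Integrable g :=
  h.continuous.integrable_of_hasCompactSupport h.hasCompactSupport

/-- `u ↦ g(u)/u` is integrable (the integrand vanishes near `0`). [folklore] -/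
private theorem integrable_div (h : IsTestAway2 g) : Integrable fun u : ℝ ↦ g u / (u : ℂ) := by
  obtain ⟨δ, hδ, hz⟩ := h.exists_ball
  refine (h.integrable.norm.mul_const δ⁻¹).mono'
    (h.continuous.measurable.mul (Complex.measurable_ofReal.inv)).aestronglyMeasurable
    (Eventually.of_forall fun u ↦ ?_)
  by_cases hu : |u| < δ
  · simp [hz u hu]
  · rw [not_lt] at hu
    rw [norm_div, Complex.norm_real, Real.norm_eq_abs, div_eq_mul_inv]
    gcongr

/-- The inversion `I` preserves the `C²` test class. [cite: Burnol2004, Thm 4.5 (TeX l. 1415–1420)] -/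
private theorem isTestAway2_inv (h : IsTestAway2 g) : IsTestAway2 (inv g) := by
  obtain ⟨δ, hδ, hz⟩ := h.exists_ball
  obtain ⟨R, hR, hR'⟩ := h.exists_bound
  have hnear : ∀ y : ℝ, |y| < R⁻¹ → inv g y = 0 := by
    intro y hy
    rcases eq_or_ne y 0 with rfl | hy0
    · simp [CoPoisson.inv, h.apply_zero]
    · have : R < |y⁻¹| := by
        rw [abs_inv]; rwa [lt_inv_comm₀ hR (abs_pos.2 hy0)]
      simp [CoPoisson.inv, hR' _ this]
  have hfar : ∀ y : ℝ, δ⁻¹ < |y| → inv g y = 0 := by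
    intro y hy
    have hy0 : y ≠ 0 := by
      rintro rfl; rw [abs_zero] at hy; linarith [inv_pos.2 hδ]
    have : |y⁻¹| < δ := by
      rw [abs_inv]; rwa [inv_lt_comm₀ (abs_pos.2 hy0) hδ]
    simp [CoPoisson.inv, hz _ this]
  refine ⟨?_, ?_, ?_, ?_⟩
  · rw [contDiff_iff_contDiffAt]
    intro y
    rcases eq_or_ne y 0 with rfl | hy0
    · have hev : (inv g) =ᶠ[𝓝 (0:ℝ)] fun _ ↦ (0 : ℂ) := by
        have : Metric.ball (0:ℝ) R⁻¹ ∈ 𝓝 (0 : ℝ) := Metric.ball_mem_nhds _ (inv_pos.2 hR)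
        filter_upwards [this] with y hy
        exact hnear y (by simpa using hy)
      exact (contDiffAt_const.congr_of_eventuallyEq hev)
    · rw [inv_eq_smul]
      have h1 : ContDiffAt ℝ 2 (fun y : ℝ ↦ y⁻¹) y := contDiffAt_inv ℝ hy0
      have h2 : ContDiffAt ℝ 2 (fun y : ℝ ↦ g y⁻¹) y := (h.contDiff.contDiffAt).comp y h1
      have h3 : ContDiffAt ℝ 2 (fun y : ℝ ↦ |y|⁻¹) y := by
        have : ContDiffAt ℝ 2 (fun y : ℝ ↦ ‖y‖) y := contDiffAt_norm ℝ hy0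
        simp only [Real.norm_eq_abs] at this
        exact this.inv (abs_pos.2 hy0).ne'
      have h4 : ContDiffAt ℝ 2 (fun y : ℝ ↦ ((|y|⁻¹ : ℝ) : ℂ)) y :=
        (Complex.ofRealCLM.contDiff.contDiffAt).comp y h3
      exact h4.mul h2
  · intro y
    simp only [CoPoisson.inv, inv_neg, h.even, abs_neg]
  · apply HasCompactSupport.of_support_subset_isCompact (isCompact_closedBall (0:ℝ) δ⁻¹)
    intro y hy
    rw [Metric.mem_closedBall, dist_zero_right, Real.norm_eq_abs]
    by_contra hlt
    exact hy (hfar y (not_le.1 hlt))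
  · intro hmem
    have hball : Metric.ball (0:ℝ) R⁻¹ ∈ 𝓝 (0:ℝ) := Metric.ball_mem_nhds _ (inv_pos.2 hR)
    have : (inv g) =ᶠ[𝓝 (0:ℝ)] 0 := by
      filter_upwards [hball] with y hy
      exact hnear y (by simpa using hy)
    exact (notMem_tsupport_iff_eventuallyEq.2 this) hmem

/-- Terms of the co-Poisson sum vanish beyond `n ≈ |y|/δ`. [folklore] -/
private theorem exists_terms_eq_zero (h : IsTestAway2 g) :
    ∃ δ : ℝ, 0 < δ ∧ (∀ y : ℝ, |y| < δ → g y = 0) ∧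
      ∀ (y : ℝ) (n : ℕ), |y| / δ ≤ n → g (y / ((n : ℝ) + 1)) = 0 := by
  obtain ⟨δ, hδ, hz⟩ := h.exists_ball
  refine ⟨δ, hδ, hz, fun y n hn ↦ hz _ ?_⟩
  have hn1 : (0 : ℝ) < (n : ℝ) + 1 := by positivity
  rw [abs_div, abs_of_pos hn1, div_lt_iff₀ hn1]
  rw [div_le_iff₀ hδ] at hn
  nlinarith

/-- For `|y|/δ ≤ N` the co-Poisson sum is a finite sum over `n < N`. [folklore] -/
private theorem tsum_term_eq_sum (h : IsTestAway2 g) :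
    ∃ δ : ℝ, 0 < δ ∧ (∀ y : ℝ, |y| < δ → g y = 0) ∧
      ∀ (y : ℝ) (N : ℕ), |y| / δ ≤ N →
        (∑' n : ℕ, g (y / ((n : ℝ) + 1)) / ((n : ℂ) + 1)) =
          ∑ n ∈ Finset.range N, g (y / ((n : ℝ) + 1)) / ((n : ℂ) + 1) := by
  obtain ⟨δ, hδ, hz, hN⟩ := h.exists_terms_eq_zero
  refine ⟨δ, hδ, hz, fun y N hyN ↦ tsum_eq_sum fun n hn ↦ ?_⟩
  rw [Finset.mem_range, not_lt] at hn
  have : |y| / δ ≤ n := hyN.trans (by exact_mod_cast hn)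
  simp [hN y n this]

/-- Auxiliary step (elementary). [folklore] -/
private theorem summable_term (h : IsTestAway2 g) (y : ℝ) :
    Summable fun n : ℕ ↦ g (y / ((n : ℝ) + 1)) / ((n : ℂ) + 1) := by
  obtain ⟨δ, hδ, -, hN⟩ := h.exists_terms_eq_zero
  refine summable_of_ne_finset_zero (s := Finset.range (⌈|y| / δ⌉₊)) fun n hn ↦ ?_
  rw [Finset.mem_range, not_lt] at hn
  have : |y| / δ ≤ n := (Nat.le_ceil _).trans (by exact_mod_cast hn)
  simp [hN y n this]

/-- `P'(g)` is continuous (locally a finite sum of dilates). [cite: Burnol2004, Thm 4.5 (TeX l. 1418)] -/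
private theorem continuous_coSum (h : IsTestAway2 g) : Continuous (coSum g) := by
  obtain ⟨δ, hδ, -, hN⟩ := h.tsum_term_eq_sum
  rw [continuous_iff_continuousAt]
  intro y₀
  set N : ℕ := ⌈(|y₀| + 1) / δ⌉₊ with hNdef
  have hev : coSum g =ᶠ[𝓝 y₀] fun y ↦ (∑ n ∈ Finset.range N, (g (y / ((n : ℝ) + 1)) / ((n : ℂ) + 1))) -
      ∫ u in Ioi (0 : ℝ), g u / (u : ℂ) := by
    have hball : Metric.ball y₀ 1 ∈ 𝓝 y₀ := Metric.ball_mem_nhds _ one_pos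
    filter_upwards [hball] with y hy
    rw [Metric.mem_ball, Real.dist_eq] at hy
    have hyN : |y| / δ ≤ N := by
      refine le_trans ?_ (Nat.le_ceil _)
      gcongr
      have := abs_sub_abs_le_abs_sub y y₀
      linarith
    rw [coSum, hN y N hyN]
  refine (Continuous.continuousAt ?_).congr_of_eventuallyEq hev
  exact (continuous_finsetSum _ fun n _ ↦
    ((h.continuous.comp (continuous_id.div_const _))).div_const _).sub continuous_const

/-- Iterated derivatives of a compactly supported function are compactly supported. [folklore] -/
private theorem _root_.Literature.NumberTheory.LFunctions.CoPoisson.hasCompactSupport_iteratedDeriv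
    {f : ℝ → ℂ} (hf : HasCompactSupport f) (n : ℕ) : HasCompactSupport (iteratedDeriv n f) := by
  induction n with
  | zero => simpa using hf
  | succ n ih => rw [iteratedDeriv_succ]; exact ih.deriv

/-- **Quadratic Fourier decay for `C²` compactly supported data**: `t² |𝓕β(t)| ≤ C`, from
`𝓕(β'')(t) = (2πit)² 𝓕β(t)` and `|𝓕(β'')| ≤ ‖β''‖₁`. [folklore] -/
private theorem exists_sq_mul_norm_fourier_le {β : ℝ → ℂ} (hβ : IsTestAway2 β) :
    ∃ C : ℝ, 0 < C ∧ ∀ t : ℝ, t ^ 2 * ‖𝓕 β t‖ ≤ C := by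
  have hint : ∀ n : ℕ, (n : ℕ∞) ≤ 2 → Integrable (iteratedDeriv n β) := by
    intro n hn
    refine (hβ.contDiff.continuous_iteratedDeriv n ?_).integrable_of_hasCompactSupport
      (hasCompactSupport_iteratedDeriv hβ.hasCompactSupport n)
    exact_mod_cast hn
  have key := Real.fourier_iteratedDeriv (N := (2 : ℕ∞)) (n := 2) (f := β)
    (by exact_mod_cast hβ.contDiff) hint le_rfl
  set C₀ : ℝ := ∫ x : ℝ, ‖iteratedDeriv 2 β x‖ with hC₀
  have hC₀0 : 0 ≤ C₀ := integral_nonneg fun _ ↦ norm_nonneg _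
  have hbound : ∀ t : ℝ, ‖𝓕 (iteratedDeriv 2 β) t‖ ≤ C₀ := fun t ↦
    VectorFourier.norm_fourierIntegral_le_integral_norm _ _ _ _ _
  refine ⟨C₀ / (4 * π ^ 2) + 1, by positivity, fun t ↦ ?_⟩
  have h1 := hbound t
  rw [key] at h1
  simp only [norm_smul, norm_pow, Complex.norm_mul, Complex.norm_real, Complex.norm_I,
    Complex.norm_ofNat, Real.norm_eq_abs, mul_one] at h1
  -- h1 : (2 * |π| * |t|) ^ 2 * ‖𝓕 β t‖ ≤ C₀  (up to normalisation)
  have hπ : |π| = π := abs_of_pos Real.pi_pos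
  have h2 : 4 * π ^ 2 * (t ^ 2 * ‖𝓕 β t‖) ≤ C₀ := by
    have e : (2 * |π| * |t|) ^ 2 * ‖𝓕 β t‖ = 4 * π ^ 2 * (t ^ 2 * ‖𝓕 β t‖) := by
      rw [hπ, mul_pow, mul_pow, sq_abs]; ring
    linarith [e.symm.le.trans h1, e.le]
  have hπ2 : 0 < 4 * π ^ 2 := by positivity
  calc t ^ 2 * ‖𝓕 β t‖ ≤ C₀ / (4 * π ^ 2) := by
        rw [le_div_iff₀ hπ2, mul_comm]; exact h2
    _ ≤ C₀ / (4 * π ^ 2) + 1 := by linarith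

/-- Auxiliary step (elementary). [folklore] -/
private theorem norm_fourier_le {β : ℝ → ℂ} (hβ : IsTestAway2 β) :
    ∃ C : ℝ, 0 < C ∧ ∀ t : ℝ, t ≠ 0 → ‖𝓕 β t‖ ≤ C / t ^ 2 := by
  obtain ⟨C, hC0, hC⟩ := hβ.exists_sq_mul_norm_fourier_le
  refine ⟨C, hC0, fun t ht ↦ ?_⟩
  rw [le_div_iff₀ (by positivity), mul_comm]
  exact hC t

/-- The dilate `x ↦ β(x/y)` (`y ≠ 0`) has compact support. [folklore] -/
private theorem hasCompactSupport_comp_div {β : ℝ → ℂ} (hβ : IsTestAway2 β) {y : ℝ}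
    (hy : y ≠ 0) : HasCompactSupport (fun x : ℝ ↦ β (x / y)) := by
  have h := hβ.hasCompactSupport.comp_homeomorph (Homeomorph.mulRight₀ y⁻¹ (inv_ne_zero hy))
  convert h using 1
  funext x
  simp [Homeomorph.coe_mulRight₀, div_eq_mul_inv]

/-- Poisson summation for the dilate `x ↦ β(x/y)` of a `C²` test function:
`Σ_{n ∈ ℤ} β(n/y) = |y| Σ_{m ∈ ℤ} 𝓕β(y m)` (Poisson summation under power decay of `f` and `𝓕f`).
[folklore] -/
private theorem tsum_int_comp_div {β : ℝ → ℂ} (hβ : IsTestAway2 β) {y : ℝ} (hy : y ≠ 0) :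
    ∑' n : ℤ, β (n / y) = ∑' m : ℤ, ((|y| : ℝ) : ℂ) * 𝓕 β (y * m) := by
  set f : ℝ → ℂ := fun x ↦ β (x / y) with hf
  have hfc : Continuous f := hβ.continuous.comp (continuous_id.div_const _)
  have hfsupp : HasCompactSupport f := hβ.hasCompactSupport_comp_div hy
  have hfO : f =O[cocompact ℝ] (fun x : ℝ ↦ |x| ^ (-(2 : ℝ))) := by
    have hev : f =ᶠ[cocompact ℝ] (fun _ ↦ (0 : ℂ)) := by
      filter_upwards [hfsupp.isCompact.compl_mem_cocompact] with x hx
      exact image_eq_zero_of_notMem_tsupport hx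
    exact (Asymptotics.isBigO_zero _ _).congr' hev.symm EventuallyEq.rfl
  have hFf : ∀ w : ℝ, 𝓕 f w = ((|y| : ℝ) : ℂ) * 𝓕 β (y * w) := fun w ↦ fourier_comp_div_eq β hy w
  obtain ⟨C, hC0, hC⟩ := hβ.norm_fourier_le
  have hFO : 𝓕 f =O[cocompact ℝ] (fun x : ℝ ↦ |x| ^ (-(2 : ℝ))) := by
    rw [Asymptotics.isBigO_iff]
    refine ⟨|y| * C / y ^ 2, ?_⟩
    have hmem : (Metric.closedBall (0 : ℝ) 1)ᶜ ∈ cocompact ℝ :=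
      (isCompact_closedBall (0 : ℝ) 1).compl_mem_cocompact
    filter_upwards [hmem] with w hw
    rw [Set.mem_compl_iff, Metric.mem_closedBall, dist_zero_right, Real.norm_eq_abs, not_le] at hw
    have hw0 : w ≠ 0 := by rintro rfl; rw [abs_zero] at hw; linarith
    rw [hFf, norm_mul, Complex.norm_real, Real.norm_eq_abs, abs_abs,
      Real.norm_of_nonneg (by positivity), Real.rpow_neg (abs_nonneg w), Real.rpow_two, sq_abs]
    have h1 := hC (y * w) (mul_ne_zero hy hw0)
    calc |y| * ‖𝓕 β (y * w)‖ ≤ |y| * (C / (y * w) ^ 2) := by gcongr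
      _ = |y| * C / y ^ 2 * (w ^ 2)⁻¹ := by field_simp
  have h := Real.tsum_eq_tsum_fourier_of_rpow_decay hfc one_lt_two hfO hFO 0
  simp only [zero_add, QuotientAddGroup.mk_zero, fourier_eval_zero, mul_one] at h
  have hL : ∀ n : ℤ, f n = β (n / y) := fun n ↦ rfl
  rw [tsum_congr (fun m : ℤ ↦ hFf (m : ℝ))] at h
  simp only [hL] at h
  exact h

/-- Summability of `m ↦ 𝓕β(y(m+1))` from the quadratic decay. [folklore] -/
private theorem summable_fourier_mul_nat {β : ℝ → ℂ} (hβ : IsTestAway2 β) {y : ℝ}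
    (hy : y ≠ 0) : Summable fun m : ℕ ↦ 𝓕 β (y * (((m : ℝ) + 1))) := by
  obtain ⟨C, hC0, hC⟩ := hβ.norm_fourier_le
  have hs : Summable fun m : ℕ ↦ C / y ^ 2 * (1 / ((m : ℝ) + 1) ^ 2) := by
    have := (summable_nat_add_iff 1).2 (Real.summable_one_div_nat_pow.2 one_lt_two)
    refine (Summable.mul_left (C / y ^ 2) ?_)
    simpa [Nat.cast_succ] using this
  refine Summable.of_norm_bounded hs fun m ↦ ?_
  have hm : y * ((m : ℝ) + 1) ≠ 0 := mul_ne_zero hy (by positivity)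
  refine (hC _ hm).trans (le_of_eq ?_)
  field_simp

/-- **Key formula for `C²` data**: for `y ≠ 0`, `P'(g)(y) = Σ_{m ≥ 1} 𝓕(I(g))(m y)`.
[cite: Burnol2004, proof of Thm 4.5 (TeX l. 1420–1500)] -/
private theorem coSum_eq_tsum_fourier (h : IsTestAway2 g) {y : ℝ} (hy : y ≠ 0) :
    coSum g y = ∑' m : ℕ, 𝓕 (inv g) (y * ((m : ℝ) + 1)) := by
  have hβ := h.isTestAway2_inv
  have hP := hβ.tsum_int_comp_div hy
  have hLsum : Summable fun n : ℕ ↦ inv g ((n : ℝ) / y) := by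
    have : Summable fun n : ℕ ↦ inv g (((n : ℝ) + 1) / y) := by
      simp only [inv_apply_nat_div]
      exact (h.summable_term y).mul_left _
    have h1 := (summable_nat_add_iff (f := fun n : ℕ ↦ inv g ((n : ℝ) / y)) 1).1
    apply h1
    simpa [Nat.cast_succ] using this
  have hLeven : ∀ n : ℤ, inv g (((-n : ℤ) : ℝ) / y) = inv g ((n : ℝ) / y) := by
    intro n; rw [Int.cast_neg, neg_div, hβ.even]
  have hL := tsum_int_of_even (F := fun n : ℤ ↦ inv g ((n : ℝ) / y)) hLeven
    (by simpa using hLsum)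
  have hRsum : Summable fun m : ℕ ↦ ((|y| : ℝ) : ℂ) * 𝓕 (inv g) (y * (m : ℝ)) := by
    have : Summable fun m : ℕ ↦ ((|y| : ℝ) : ℂ) * 𝓕 (inv g) (y * ((m : ℝ) + 1)) :=
      (hβ.summable_fourier_mul_nat hy).mul_left _
    have h1 := (summable_nat_add_iff
      (f := fun m : ℕ ↦ ((|y| : ℝ) : ℂ) * 𝓕 (inv g) (y * (m : ℝ))) 1).1
    apply h1
    simpa [Nat.cast_succ] using this
  have hReven : ∀ m : ℤ, ((|y| : ℝ) : ℂ) * 𝓕 (inv g) (y * ((-m : ℤ) : ℝ)) =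
      ((|y| : ℝ) : ℂ) * 𝓕 (inv g) (y * (m : ℝ)) := by
    intro m; rw [Int.cast_neg, mul_neg, fourier_neg_of_even hβ.even]
  have hR := tsum_int_of_even (F := fun m : ℤ ↦ ((|y| : ℝ) : ℂ) * 𝓕 (inv g) (y * (m : ℝ)))
    hReven (by simpa using hRsum)
  simp only [Int.cast_zero, zero_div, mul_zero] at hL hR
  rw [hL, hR] at hP
  have h0 : inv g 0 = 0 := hβ.apply_zero
  rw [h0, zero_add, fourier_apply_zero, integral_eq_two_mul_Ioi hβ.integrable hβ.even,
    integral_Ioi_inv] at hP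
  have hterm : (∑' n : ℕ, inv g ((((n : ℤ) + 1 : ℤ) : ℝ) / y)) =
      ((|y| : ℝ) : ℂ) * ∑' n : ℕ, (g (y / ((n : ℝ) + 1)) / ((n : ℂ) + 1)) := by
    rw [← tsum_mul_left]; congr 1; funext n; push_cast; exact inv_apply_nat_div g y n
  rw [hterm] at hP
  have hyC : ((|y| : ℝ) : ℂ) ≠ 0 := by exact_mod_cast (abs_pos.2 hy).ne'
  rw [coSum]
  have hP' : (∑' n : ℕ, (g (y / ((n : ℝ) + 1)) / ((n : ℂ) + 1))) = (∫ v in Ioi (0:ℝ), g v / (v : ℂ)) +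
      ∑' m : ℕ, 𝓕 (inv g) (y * ((m : ℝ) + 1)) := by
    have h2 : (∑' m : ℕ, ((|y| : ℝ) : ℂ) * 𝓕 (inv g) (y * ((((m : ℤ) + 1 : ℤ) : ℝ)))) =
        ((|y| : ℝ) : ℂ) * ∑' m : ℕ, 𝓕 (inv g) (y * ((m : ℝ) + 1)) := by
      rw [← tsum_mul_left]; congr 1; funext m; push_cast; rfl
    rw [h2] at hP
    have h3 : ((|y| : ℝ) : ℂ) * (∑' n : ℕ, (g (y / ((n : ℝ) + 1)) / ((n : ℂ) + 1))) =
        ((|y| : ℝ) : ℂ) * ((∫ v in Ioi (0:ℝ), g v / (v : ℂ)) +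
          ∑' m : ℕ, 𝓕 (inv g) (y * ((m : ℝ) + 1))) := by
      linear_combination hP / 2
    exact mul_left_cancel₀ hyC h3
  rw [hP']
  ring

/-- Decay `‖P'(g)(y)‖ ≤ K/y²` (`y ≠ 0`) for `C²` data. [cite: Burnol2004, Thm 4.5 (TeX l. 1418)] -/
private theorem exists_norm_coSum_le_div_sq (h : IsTestAway2 g) :
    ∃ K : ℝ, 0 < K ∧ ∀ y : ℝ, y ≠ 0 → ‖coSum g y‖ ≤ K / y ^ 2 := by
  have hβ := h.isTestAway2_inv
  obtain ⟨C, hC0, hC⟩ := hβ.norm_fourier_le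
  refine ⟨2 * C, by positivity, fun y hy ↦ ?_⟩
  rw [h.coSum_eq_tsum_fourier hy]
  have hb : ∀ m : ℕ, ‖𝓕 (inv g) (y * ((m : ℝ) + 1))‖ ≤ C / y ^ 2 * (1 / ((m : ℝ) + 1) ^ 2) := by
    intro m
    have hm : y * ((m : ℝ) + 1) ≠ 0 := mul_ne_zero hy (by positivity)
    refine (hC _ hm).trans (le_of_eq ?_)
    field_simp
  have hs : Summable fun m : ℕ ↦ C / y ^ 2 * (1 / ((m : ℝ) + 1) ^ 2) := by
    have := (summable_nat_add_iff 1).2 (Real.summable_one_div_nat_pow.2 one_lt_two)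
    refine (Summable.mul_left (C / y ^ 2) ?_)
    simpa [Nat.cast_succ] using this
  have hns : Summable fun m : ℕ ↦ ‖𝓕 (inv g) (y * ((m : ℝ) + 1))‖ :=
    Summable.of_nonneg_of_le (fun _ ↦ norm_nonneg _) hb hs
  calc ‖∑' m : ℕ, 𝓕 (inv g) (y * ((m : ℝ) + 1))‖
      ≤ ∑' m : ℕ, ‖𝓕 (inv g) (y * ((m : ℝ) + 1))‖ := norm_tsum_le_tsum_norm hns
    _ ≤ ∑' m : ℕ, C / y ^ 2 * (1 / ((m : ℝ) + 1) ^ 2) := hns.tsum_le_tsum hb hs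
    _ = C / y ^ 2 * ∑' m : ℕ, 1 / ((m : ℝ) + 1) ^ 2 := tsum_mul_left
    _ ≤ C / y ^ 2 * 2 :=
        mul_le_mul_of_nonneg_left tsum_one_div_nat_succ_sq_le_two (by positivity)
    _ = 2 * C / y ^ 2 := by ring

/-- `P'(g) ∈ L¹(ℝ)` for `C²` data (Thm 4.5: "continuous `L¹`-functions"). [cite: Burnol2004, Thm 4.5 (TeX l. 1418)] -/
private theorem integrable_coSum (h : IsTestAway2 g) : Integrable (coSum g) := by
  obtain ⟨K, hK0, hK⟩ := h.exists_norm_coSum_le_div_sq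
  obtain ⟨B₁, hB₁⟩ := (isCompact_Icc (a := (-1 : ℝ)) (b := 1)).exists_bound_of_continuousOn
    (h.continuous_coSum.continuousOn)
  have hB : ∀ y : ℝ, ‖coSum g y‖ ≤ (2 * max B₁ K) * (1 + y ^ 2)⁻¹ := by
    intro y
    rw [← div_eq_mul_inv, le_div_iff₀ (by positivity)]
    have hmax : 0 ≤ max B₁ K := le_trans hK0.le (le_max_right _ _)
    have hKM : K ≤ max B₁ K := le_max_right _ _
    by_cases hy : |y| ≤ 1
    · have h1 := (hB₁ y (by rw [mem_Icc]; exact abs_le.1 hy)).trans (le_max_left B₁ K)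
      have hy2 : y ^ 2 ≤ 1 := by nlinarith [abs_nonneg y, sq_abs y]
      nlinarith [norm_nonneg (coSum g y), mul_nonneg (sub_nonneg.2 h1) (sq_nonneg y),
        mul_nonneg hmax (sub_nonneg.2 hy2)]
    · rw [not_le] at hy
      have hy0 : y ≠ 0 := by rintro rfl; simp at hy; linarith
      have h2 := hK y hy0
      have hy2 : 0 < y ^ 2 := by positivity
      rw [le_div_iff₀ hy2] at h2
      have h3 : ‖coSum g y‖ ≤ K := by
        have hy1 : 1 ≤ y ^ 2 := by nlinarith [sq_abs y]
        exact (hK y hy0).trans (div_le_self hK0.le hy1)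
      nlinarith [norm_nonneg (coSum g y)]
  exact (integrable_inv_one_add_sq.const_mul _).mono'
    h.continuous_coSum.aestronglyMeasurable (Eventually.of_forall hB)

end IsTestAway2

/-- **Proof of Burnol 2004, Theorem 4.5** (= Theorem 4.6 in the `P`/`P'` formulation): for
`g ∈ C²` even with compact support away from the origin, `P'(g)` and its dual sum
`Σ g(n/t)/|t| − ∫₀^∞ g` are continuous `L¹` functions and `𝓕(P'(g)) = (dual sum)` pointwise.
Route: structure of `P'(g)` for `C²` data (Part K) + Theorem 4.2 (Part I) + Fubini
`∫ ψ·𝓕(P'g) = ∫ 𝓕ψ·P'g` for Schwartz `ψ` + `ae_eq_of_integral_contDiff_smul_eq` + continuity.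
Discharges `Literature.NumberTheory.LFunctions.Burnol2004_thm_4_5`. [cite: Burnol2004, Thm 4.5 (TeX l. 1415–1502)] -/
theorem _root_.Literature.NumberTheory.LFunctions.Burnol2004_thm_4_5_holds :
    Burnol2004_thm_4_5 := by
  intro g hg
  have hβ := hg.isTestAway2_inv
  have hc : Continuous (coSum g) := hg.continuous_coSum
  have hi : Integrable (coSum g) := hg.integrable_coSum
  have hdual : coSumDual g = coSum (inv g) := funext fun t ↦ (coSum_inv_eq_coSumDual g t).symm
  have hc' : Continuous (coSumDual g) := by rw [hdual]; exact hβ.continuous_coSum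
  have hi' : Integrable (coSumDual g) := by rw [hdual]; exact hβ.integrable_coSum
  refine ⟨hc, hi, hc', hi', ?_⟩
  -- Theorem 4.2 applies to `g`
  have h42 := Burnol2004_thm_4_2_holds g hg.continuous.measurable hg.even
    hg.integrable_div.integrableOn hg.integrable.integrableOn
  -- `𝓕(P'g)` is continuous, and agrees with the dual sum as a distribution
  set F : ℝ → ℂ := 𝓕 (coSum g) with hF
  have hFcont : Continuous F := Literature.Analysis.FunctionSpaces.continuous_fourierIntegral hi
  suffices hFG : F = coSumDual g from fun t ↦ congrFun hFG t
  refine (Continuous.ae_eq_iff_eq (μ := volume) hFcont hc').1 ?_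
  refine ae_eq_of_integral_contDiff_smul_eq hFcont.locallyIntegrable hc'.locallyIntegrable
    fun f hf hfs ↦ ?_
  -- the real test function as a Schwartz function
  set fc : ℝ → ℂ := fun x ↦ ((f x : ℝ) : ℂ) with hfc
  have hfc_smooth : ContDiff ℝ ∞ fc := (Complex.ofRealCLM.contDiff).comp hf
  have hfc_supp : HasCompactSupport fc := hfs.comp_left Complex.ofReal_zero
  set ψ : 𝓢(ℝ, ℂ) := hfc_supp.toSchwartzMap hfc_smooth with hψ
  have hψapply : ∀ x : ℝ, ψ x = fc x := fun x ↦ rfl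
  obtain ⟨-, -, hid⟩ := h42 ψ
  calc ∫ x : ℝ, f x • F x = ∫ x : ℝ, ψ x • 𝓕 (coSum g) x := by
        simp only [hψapply, hfc, smul_eq_mul, Complex.real_smul, hF]
    _ = ∫ x : ℝ, 𝓕 (ψ : ℝ → ℂ) x • coSum g x :=
        (Literature.Analysis.FunctionSpaces.integral_fourier_schwartz_smul_eq ψ hi).symm
    _ = ∫ x : ℝ, coSum g x * 𝓕 (ψ : ℝ → ℂ) x := by
        congr 1; funext x; rw [smul_eq_mul, mul_comm]
    _ = ∫ t : ℝ, coSumDual g t * ψ t := hid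
    _ = ∫ x : ℝ, f x • coSumDual g x := by
        congr 1; funext x; rw [hψapply, hfc, Complex.real_smul, mul_comm]

end thm45

/-! ## L. Theorem 3.9: `P'(α)` is a Schwartz function

Burnol (TeX l. 1137–1160): evenness and the value near the origin are Thm 3.8, the Fourier
transform is Thm 4.4, and "it is thus clear that `P'(α)` is in the Schwartz class" from the
formula `P'(α)(y) = Σ_{m≥1} γ(my)`, `γ = 𝓕(Iα)` a Schwartz function. We make the last step
explicit: smoothness everywhere from the local finiteness of the co-Poisson sum, and, on each of
the half-lines `y > 1/2`, `y < −1/2`, termwise differentiation of `Σ_m γ(my)`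
(`hasDerivAt_tsum_of_isPreconnected`) with the bounds
`|y|^p (m y)… |m^k γ^{(k)}(my)| ≤ C_{k,p}/m²` coming from the Schwartz decay of `γ^{(k)}` with
exponent `k + p + 2`. -/

section thm39

variable {α : ℝ → ℂ}

/-- `P'(α)` is smooth (locally a finite sum of dilates of `α`). [cite: Burnol2004, Thm 3.9 (TeX l. 1137)] -/
private theorem IsTestAway.contDiff_coSum (h : IsTestAway α) : ContDiff ℝ ∞ (coSum α) := by
  obtain ⟨δ, hδ, -, hN⟩ := h.tsum_term_eq_sum
  rw [contDiff_iff_contDiffAt]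
  intro y₀
  set N : ℕ := ⌈(|y₀| + 1) / δ⌉₊ with hNdef
  have hev : coSum α =ᶠ[𝓝 y₀] fun y ↦ (∑ n ∈ Finset.range N, (α (y / ((n : ℝ) + 1)) / ((n : ℂ) + 1))) -
      ∫ u in Ioi (0 : ℝ), α u / (u : ℂ) := by
    have hball : Metric.ball y₀ 1 ∈ 𝓝 y₀ := Metric.ball_mem_nhds _ one_pos
    filter_upwards [hball] with y hy
    rw [Metric.mem_ball, Real.dist_eq] at hy
    have hyN : |y| / δ ≤ N := by
      refine le_trans ?_ (Nat.le_ceil _)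
      gcongr
      have := abs_sub_abs_le_abs_sub y y₀
      linarith
    rw [coSum, hN y N hyN]
  refine (ContDiff.contDiffAt ?_).congr_of_eventuallyEq hev
  refine ContDiff.sub (ContDiff.sum fun n _ ↦ ?_) contDiff_const
  exact (h.contDiff.comp (contDiff_id.div_const _)).div_const _

/-- The Schwartz function `γ = 𝓕(Iα)` and the decay of its derivatives
`|t|^N ‖γ^{(k)}(t)‖ ≤ C`. [folklore] -/
private theorem IsTestAway.exists_fourier_schwartz (h : IsTestAway α) :
    ∃ Φ : 𝓢(ℝ, ℂ), (∀ t : ℝ, Φ t = 𝓕 (inv α) t) := by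
  have hβ := h.isTestAway_inv
  set ψ : 𝓢(ℝ, ℂ) := hβ.hasCompactSupport.toSchwartzMap hβ.contDiff with hψ
  refine ⟨𝓕 ψ, fun t ↦ ?_⟩
  exact congrFun (SchwartzMap.fourier_coe ψ) t

/-- Decay of the derivatives of a Schwartz function in the one-variable form. [folklore] -/
private theorem schwartz_iteratedDeriv_decay (Φ : 𝓢(ℝ, ℂ)) (k N : ℕ) :
    ∃ C : ℝ, 0 < C ∧ ∀ t : ℝ, |t| ^ N * ‖iteratedDeriv k Φ t‖ ≤ C := by
  obtain ⟨C, hC0, hC⟩ := Φ.decay N k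
  refine ⟨C, hC0, fun t ↦ ?_⟩
  have h1 := hC t
  rwa [Real.norm_eq_abs, norm_iteratedFDeriv_eq_norm_iteratedDeriv] at h1

/-- The derivative of `γ^{(k)}` is `γ^{(k+1)}` (Schwartz functions are smooth). [folklore] -/
private theorem schwartz_hasDerivAt_iteratedDeriv (Φ : 𝓢(ℝ, ℂ)) (k : ℕ) (t : ℝ) :
    HasDerivAt (iteratedDeriv k Φ) (iteratedDeriv (k + 1) Φ t) t := by
  have hd : Differentiable ℝ (iteratedDeriv k Φ) :=
    (Φ.smooth ⊤).differentiable_iteratedDeriv k (by exact_mod_cast ENat.coe_lt_top k)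
  rw [iteratedDeriv_succ]
  exact (hd t).hasDerivAt

/-- The terms `e_k(m, y) = (m+1)^k γ^{(k)}((m+1) y)` of the differentiated series and their
derivative in `y`. [folklore] -/
private theorem hasDerivAt_term (Φ : 𝓢(ℝ, ℂ)) (k m : ℕ) (y : ℝ) :
    HasDerivAt (fun y : ℝ ↦ (((m : ℝ) + 1) ^ k : ℝ) * iteratedDeriv k Φ (((m : ℝ) + 1) * y))
      ((((m : ℝ) + 1) ^ (k + 1) : ℝ) * iteratedDeriv (k + 1) Φ (((m : ℝ) + 1) * y)) y := by
  have h1 : HasDerivAt (fun y : ℝ ↦ ((m : ℝ) + 1) * y) (((m : ℝ) + 1) * 1) y :=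
    (hasDerivAt_id y).const_mul _
  have h2 := (schwartz_hasDerivAt_iteratedDeriv Φ k (((m : ℝ) + 1) * y)).scomp y h1
  have h3 := h2.const_mul ((((m : ℝ) + 1) ^ k : ℝ) : ℂ)
  refine h3.congr_deriv ?_
  rw [mul_one, Complex.real_smul, pow_succ]
  push_cast
  ring

/-- Uniform bounds for the terms on `{|y| ≥ η}`: `|y|^p ‖e_k(m, y)‖ ≤ C/(m+1)²`, from the
Schwartz decay of `γ^{(k)}` with exponent `k + p + 2`. [folklore] -/
private theorem norm_term_le (Φ : 𝓢(ℝ, ℂ)) (k p : ℕ) {η : ℝ} (hη : 0 < η) :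
    ∃ C : ℝ, 0 < C ∧ ∀ (m : ℕ) (y : ℝ), η ≤ |y| →
      |y| ^ p * ‖(((((m : ℝ) + 1) ^ k : ℝ) : ℂ)) * iteratedDeriv k Φ (((m : ℝ) + 1) * y)‖ ≤
        C / ((m : ℝ) + 1) ^ 2 := by
  obtain ⟨D, hD0, hD⟩ := schwartz_iteratedDeriv_decay Φ k (k + p + 2)
  refine ⟨D / η ^ (k + 2), by positivity, fun m y hy ↦ ?_⟩
  have hm : (0 : ℝ) < (m : ℝ) + 1 := by positivity
  have hy0 : 0 < |y| := lt_of_lt_of_le hη hy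
  set t : ℝ := ((m : ℝ) + 1) * y with ht
  have habs : |t| = ((m : ℝ) + 1) * |y| := by rw [ht, abs_mul, abs_of_pos hm]
  have h1 := hD t
  rw [habs] at h1
  rw [norm_mul, Complex.norm_real, Real.norm_of_nonneg (by positivity),
    le_div_iff₀ (by positivity), div_eq_mul_inv, mul_assoc, mul_assoc]
  -- goal: |y|^p * ((m+1)^k * (‖Φk t‖ * (m+1)^2)) ≤ D * (η^(k+2))⁻¹
  rw [← div_eq_mul_inv, le_div_iff₀ (by positivity)]
  have hyk : η ^ (k + 2) ≤ |y| ^ (k + 2) := pow_le_pow_left₀ hη.le hy _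
  have hm1 : (1 : ℝ) ≤ ((m : ℝ) + 1) ^ p := one_le_pow₀ (by linarith)
  set A := ‖iteratedDeriv k Φ t‖ with hA
  have hA0 : 0 ≤ A := norm_nonneg _
  calc |y| ^ p * (((m : ℝ) + 1) ^ k * (A * ((m : ℝ) + 1) ^ 2)) * η ^ (k + 2)
      ≤ |y| ^ p * (((m : ℝ) + 1) ^ k * (A * ((m : ℝ) + 1) ^ 2)) * |y| ^ (k + 2) := by
        gcongr
    _ = (((m : ℝ) + 1) ^ (k + 2) * |y| ^ (k + p + 2)) * A := by ring
    _ ≤ (((m : ℝ) + 1) ^ (k + 2) * ((m : ℝ) + 1) ^ p * |y| ^ (k + p + 2)) * A := by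
        gcongr
        exact le_mul_of_one_le_right (by positivity) hm1
    _ = (((m : ℝ) + 1) * |y|) ^ (k + p + 2) * A := by rw [mul_pow]; ring
    _ ≤ D := h1

/-- **Termwise differentiation of `Σ_m γ(my)` away from the origin.** On an open preconnected
set `s ⊆ {|y| ≥ η}` (`η > 0`) containing a point, for every `k`: `P'(α)^{(k)}(y) =
Σ_m (m+1)^k γ^{(k)}((m+1)y)` on `s`, with `|y|^p ‖P'(α)^{(k)}(y)‖ ≤ C_{k,p}` there.
[cite: Burnol2004, Thm 3.9 (TeX l. 1137–1160)] -/
private theorem IsTestAway.iteratedDeriv_coSum_eq_tsum (h : IsTestAway α) (Φ : 𝓢(ℝ, ℂ))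
    (hΦ : ∀ t : ℝ, Φ t = 𝓕 (inv α) t) {s : Set ℝ} (hs : IsOpen s) (hs' : IsPreconnected s)
    {η : ℝ} (hη : 0 < η) (hsub : ∀ y ∈ s, η ≤ |y|) {y₀ : ℝ} (hy₀ : y₀ ∈ s) (k : ℕ) :
    ∀ y ∈ s, iteratedDeriv k (coSum α) y =
      ∑' m : ℕ, ((((m : ℝ) + 1) ^ k : ℝ) : ℂ) * iteratedDeriv k Φ (((m : ℝ) + 1) * y) := by
  induction k with
  | zero =>
    intro y hy
    have hy0 : y ≠ 0 := by
      intro h0; have := hsub y hy; rw [h0, abs_zero] at this; linarith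
    rw [iteratedDeriv_zero, h.coSum_eq_tsum_fourier hy0]
    refine tsum_congr fun m ↦ ?_
    simp only [pow_zero, Complex.ofReal_one, one_mul, iteratedDeriv_zero, hΦ]
    rw [mul_comm]
  | succ k ih =>
    intro y hy
    -- summable majorants for the `(k+1)`-terms on `s`
    obtain ⟨C₁, hC₁0, hC₁⟩ := norm_term_le Φ (k + 1) 0 hη
    obtain ⟨C₀, hC₀0, hC₀⟩ := norm_term_le Φ k 0 hη
    have hsum2 : Summable fun m : ℕ ↦ C₁ / ((m : ℝ) + 1) ^ 2 := by
      have := (summable_nat_add_iff 1).2 (Real.summable_one_div_nat_pow.2 one_lt_two)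
      have h2 : Summable fun m : ℕ ↦ C₁ * (1 / ((m : ℝ) + 1) ^ 2) := by
        refine Summable.mul_left _ ?_
        simpa [Nat.cast_succ] using this
      refine h2.congr fun m ↦ ?_
      field_simp
    have hderiv : HasDerivAt
        (fun z : ℝ ↦ ∑' m : ℕ, ((((m : ℝ) + 1) ^ k : ℝ) : ℂ) * iteratedDeriv k Φ (((m : ℝ) + 1) * z))
        (∑' m : ℕ, ((((m : ℝ) + 1) ^ (k + 1) : ℝ) : ℂ) *
          iteratedDeriv (k + 1) Φ (((m : ℝ) + 1) * y)) y := by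
      refine hasDerivAt_tsum_of_isPreconnected hsum2 hs hs' (fun m z _ ↦ hasDerivAt_term Φ k m z)
        (fun m z hz ↦ ?_) hy₀ ?_ hy
      · have := hC₁ m z (hsub z hz)
        rwa [pow_zero, one_mul] at this
      · refine Summable.of_norm_bounded (g := fun m : ℕ ↦ C₀ / ((m : ℝ) + 1) ^ 2) ?_ fun m ↦ ?_
        · have := (summable_nat_add_iff 1).2 (Real.summable_one_div_nat_pow.2 one_lt_two)
          have h2 : Summable fun m : ℕ ↦ C₀ * (1 / ((m : ℝ) + 1) ^ 2) := by
            refine Summable.mul_left _ ?_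
            simpa [Nat.cast_succ] using this
          refine h2.congr fun m ↦ ?_
          field_simp
        · have := hC₀ m y₀ (hsub y₀ hy₀)
          rwa [pow_zero, one_mul] at this
    -- `F^{(k)} = Σ e_k` near `y`, hence the derivatives agree
    have hev : iteratedDeriv k (coSum α) =ᶠ[𝓝 y]
        fun z : ℝ ↦ ∑' m : ℕ, ((((m : ℝ) + 1) ^ k : ℝ) : ℂ) * iteratedDeriv k Φ (((m : ℝ) + 1) * z) := by
      filter_upwards [hs.mem_nhds hy] with z hz
      exact ih z hz
    rw [iteratedDeriv_succ, hev.deriv_eq, hderiv.deriv]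

/-- Decay of all derivatives of `P'(α)` on `{|y| ≥ η} ∩ s` for `s` as above. [folklore] -/
private theorem IsTestAway.pow_mul_norm_iteratedDeriv_coSum_le (h : IsTestAway α) (Φ : 𝓢(ℝ, ℂ))
    (hΦ : ∀ t : ℝ, Φ t = 𝓕 (inv α) t) {s : Set ℝ} (hs : IsOpen s) (hs' : IsPreconnected s)
    {η : ℝ} (hη : 0 < η) (hsub : ∀ y ∈ s, η ≤ |y|) {y₀ : ℝ} (hy₀ : y₀ ∈ s) (k p : ℕ) :
    ∃ C : ℝ, ∀ y ∈ s, |y| ^ p * ‖iteratedDeriv k (coSum α) y‖ ≤ C := by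
  obtain ⟨C, hC0, hC⟩ := norm_term_le Φ k p hη
  refine ⟨C * 2, fun y hy ↦ ?_⟩
  rw [h.iteratedDeriv_coSum_eq_tsum Φ hΦ hs hs' hη hsub hy₀ k y hy]
  have hyη := hsub y hy
  have hb : ∀ m : ℕ, ‖(|y| ^ p : ℝ) • (((((m : ℝ) + 1) ^ k : ℝ) : ℂ) *
      iteratedDeriv k Φ (((m : ℝ) + 1) * y))‖ ≤ C * (1 / ((m : ℝ) + 1) ^ 2) := by
    intro m
    rw [norm_smul, Real.norm_of_nonneg (by positivity), ← div_eq_mul_one_div]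
    exact hC m y hyη
  have hs2 : Summable fun m : ℕ ↦ C * (1 / ((m : ℝ) + 1) ^ 2) := by
    have := (summable_nat_add_iff 1).2 (Real.summable_one_div_nat_pow.2 one_lt_two)
    refine Summable.mul_left _ ?_
    simpa [Nat.cast_succ] using this
  have hns := Summable.of_norm_bounded hs2 hb
  calc |y| ^ p * ‖∑' m : ℕ, ((((m : ℝ) + 1) ^ k : ℝ) : ℂ) * iteratedDeriv k Φ (((m : ℝ) + 1) * y)‖
      = ‖∑' m : ℕ, (|y| ^ p : ℝ) • (((((m : ℝ) + 1) ^ k : ℝ) : ℂ) *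
          iteratedDeriv k Φ (((m : ℝ) + 1) * y))‖ := by
        rw [tsum_const_smul'' (|y| ^ p : ℝ), norm_smul, Real.norm_of_nonneg (by positivity)]
    _ ≤ ∑' m : ℕ, C * (1 / ((m : ℝ) + 1) ^ 2) :=
        (norm_tsum_le_tsum_norm hns.norm).trans (hns.norm.tsum_le_tsum hb hs2)
    _ = C * ∑' m : ℕ, 1 / ((m : ℝ) + 1) ^ 2 := tsum_mul_left
    _ ≤ C * 2 := mul_le_mul_of_nonneg_left tsum_one_div_nat_succ_sq_le_two hC0.le

/-- Global decay of all derivatives of `P'(α)`: `|y|^p ‖P'(α)^{(k)}(y)‖ ≤ C_{k,p}`. [cite: Burnol2004, Thm 3.9 (TeX l. 1137)] -/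
private theorem IsTestAway.pow_mul_norm_iteratedDeriv_coSum_le' (h : IsTestAway α) (k p : ℕ) :
    ∃ C : ℝ, ∀ y : ℝ, |y| ^ p * ‖iteratedDeriv k (coSum α) y‖ ≤ C := by
  obtain ⟨Φ, hΦ⟩ := h.exists_fourier_schwartz
  have hη : (0 : ℝ) < 1 / 2 := by norm_num
  -- right half-line
  obtain ⟨C₁, hC₁⟩ := h.pow_mul_norm_iteratedDeriv_coSum_le Φ hΦ (s := Ioi (1 / 2 : ℝ)) isOpen_Ioi
    isPreconnected_Ioi hη (fun y hy ↦ le_trans (le_of_lt hy) (le_abs_self y))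
    (y₀ := 1) (by norm_num) k p
  -- left half-line
  obtain ⟨C₂, hC₂⟩ := h.pow_mul_norm_iteratedDeriv_coSum_le Φ hΦ (s := Iio (-(1 / 2) : ℝ))
    isOpen_Iio isPreconnected_Iio hη
    (fun y hy ↦ by have : y < -(1/2) := hy; have := neg_abs_le y; rw [abs_eq_neg_self.2 (by linarith)]; linarith)
    (y₀ := -1) (by norm_num) k p
  -- the compact middle
  have hcont : Continuous fun y : ℝ ↦ |y| ^ p * ‖iteratedDeriv k (coSum α) y‖ :=
    (continuous_abs.pow p).mul
      (h.contDiff_coSum.continuous_iteratedDeriv k (by exact_mod_cast le_top)).norm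
  obtain ⟨C₃, hC₃⟩ := (isCompact_Icc (a := (-1 : ℝ)) (b := 1)).exists_bound_of_continuousOn
    hcont.continuousOn
  refine ⟨max C₁ (max C₂ C₃), fun y ↦ ?_⟩
  by_cases h1 : (1 / 2 : ℝ) < y
  · exact (hC₁ y h1).trans (le_max_left _ _)
  by_cases h2 : y < -(1 / 2)
  · exact (hC₂ y h2).trans ((le_max_left _ _).trans (le_max_right _ _))
  · have hy : y ∈ Icc (-1 : ℝ) 1 := by constructor <;> linarith [not_lt.1 h1, not_lt.1 h2]
    have := hC₃ y hy
    rw [Real.norm_of_nonneg (by positivity)] at this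
    exact this.trans ((le_max_right _ _).trans (le_max_right _ _))

/-- **`P'(α)` as a Schwartz function** (Thm 3.9: "Then `P'(α)` is an even function in the Schwartz
class"). [cite: Burnol2004, Thm 3.9 (TeX l. 1137–1160)] -/
theorem IsTestAway.exists_schwartzMap_coe_eq (h : IsTestAway α) :
    ∃ φ : 𝓢(ℝ, ℂ), (φ : ℝ → ℂ) = coSum α := by
  refine ⟨⟨coSum α, h.contDiff_coSum, fun p k ↦ ?_⟩, rfl⟩
  obtain ⟨C, hC⟩ := h.pow_mul_norm_iteratedDeriv_coSum_le' k p
  refine ⟨C, fun y ↦ ?_⟩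
  rw [Real.norm_eq_abs, norm_iteratedFDeriv_eq_norm_iteratedDeriv]
  exact hC y

/-- **Proof of Burnol 2004, Theorem 3.9**: for `α` smooth, even, compactly supported away from
the origin, `P'(α)` is an even Schwartz function, constant (`= −∫₀^∞ α(y)dy/y`) near `0`, whose
Fourier transform is `−∫₀^∞ α` near `0` and equals `P'(Iα)`. Discharges
`Literature.NumberTheory.LFunctions.Burnol2004_thm_3_9`. [cite: Burnol2004, Thm 3.9 (TeX l. 1137–1160)] -/
theorem _root_.Literature.NumberTheory.LFunctions.Burnol2004_thm_3_9_holds :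
    Burnol2004_thm_3_9 := by
  intro α hα
  have hβ := hα.isTestAway_inv
  have h44 : 𝓕 (coSum α) = coSum (inv α) := Burnol2004_thm_4_4_holds α hα
  refine ⟨hα.exists_schwartzMap_coe_eq, coSum_neg hα.even, hα.coSum_eventually_eq, ?_, h44⟩
  rw [h44]
  filter_upwards [hβ.coSum_eventually_eq] with w hw
  rw [hw, integral_Ioi_inv_div]

end thm39

end CoPoisson

end Literature.NumberTheory.LFunctions
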